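import Literature.Analysis.FluidPDE.TorusVorticityMomentBalance
import Literature.Analysis.FluidPDE.TorusNSVorticityLsCriterion
import Literature.Analysis.FunctionSpaces.TorusSobolevGagliardoNirenberg
import Literature.Analysis.FunctionSpaces.TorusLowOrderLeibniz
import Mathlib.MeasureTheory.Integral.Bochner.Set
import Mathlib.MeasureTheory.Integral.IntervalIntegral.FundThmCalculus
import Mathlib.Analysis.MeanInequalities
import Mathlib.Analysis.MeanInequalitiesPow
import Mathlib.Analysis.Convex.Integral
import Mathlib.Analysis.Convex.SpecificFunctions.Basic
import HarnessLib

/-!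
# Gibbon's vorticity-moment LADDER on `𝕋³`: `J̇ₘ` against `J_{m+1}` (Gibbon 2012, Thm 2, §5)

Analysis/FluidPDE proof file (theorems only; no named facts). Search for candidate a priori
estimates; no regularity claim (cell `pub-nsfunc`, literature seat: this file formalises a
PUBLISHED argument, nothing new).

J. D. Gibbon (J. Math. Phys. 53 (2012) 115608, Theorem 2 with the proof of §5; restated as
Gibbon, Procedia IUTAM 7 (2013) 39–48, Thm 2, and Gibbon–Donzis–Gupta–Kerr–Pandit–Vincenzi,
Nonlinearity 27 (2014) 2605, eq. (2.7)) proves, for the vorticity moments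
`Jₘ = ∫|ω|^{2m}` of a solution of the UNFORCED Navier–Stokes equations on the periodic box, the
"`Dₘ` ladder"

  `Ḋₘ ≤ Dₘ³ { −ϖ_{1,m} (D_{m+1}/Dₘ)^{ρₘ} + ϖ_{2,m} }`,  `ρₘ = ⅔ m(4m+1)`,

`Dₘ = (ϖ₀⁻¹Ωₘ)^{αₘ}`, `αₘ = 2m/(4m−3)`, `Ωₘ` the (regularised) `L^{2m}` norm of the vorticity,
`ϖ₀ = νL⁻²`. This file types the printed proof (§5, (5.1)–(5.20)) on the unit torus `𝕋³`
(`L = 1`, `ϖ₀ = ν`) for classical solutions and natural `m ≥ 1`, in the tree's vocabulary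
`|ω|² = torusVorticitySqAt`, `σ = torusStretchingDensity` (`= ω·Sω` for divergence-free fields,
`torusStretchingDensity_fin_three_of_isDivFree`):

* §1 (pointwise): `|σ| ≤ |ω|² |∇u|` (`abs_torusStretchingDensity_le_mul_sqrt`) and
  `(∂ₖ|ω|²)² ≤ 2|ω|² ∑ᵢⱼ(∂ₖWᵢⱼ)²`.
* §2 = (5.6)–(5.8): the stretching term `2m∫|ω|^{2(m−1)}σ ≤ 2m cₘ J_{m+1}^{1/2} Jₘ^{1/2}`
  (Hölder twice and the periodic Calderón–Zygmund bound `‖∇u‖_{2m+2} ≤ c‖ω‖_{2m+2}`,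
  `Torus.exists_gradLs_le_vorticityLs`).
* §3 = (5.3)–(5.5) with (5.13): the viscous term of the `Jₘ` balance controls
  `(∫|ω|^{6m})^{1/3}` from below (Sobolev `H¹ ⊂ L⁶` applied to `Aₘ = |ω|ᵐ`, through the smooth
  regularisation `(|ω|² + ε)^{m/2}`, `Torus.exists_integral_abs_rpow_sub_average_le_gradient`),
  and the interpolation `J_{m+1} ≤ Jₘ^{(2m−1)/2m} J_{3m}^{1/2m}` (Hölder).
* §4 = (5.9): along a classical solution, every one-sided derivative `R` of `Jₘ` obeys
  `R ≤ −ν c₁ J_{3m}^{1/3} + ν c₂ Jₘ + c₃ Jₘ^{1/2} J_{m+1}^{1/2}`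
  (`exists_vorticityMoment_ladder`), hence the two-rung form
  `R ≤ −ν c₁ J_{m+1}^{2m/3}/Jₘ^{(2m−1)/3} + ν c₂ Jₘ + c₃ Jₘ^{1/2} J_{m+1}^{1/2}`
  (`exists_vorticityMoment_ladder_twoRung`) — the `J`-form of Theorem 2; the printed
  `Dₘ`/`Ωₘ` normalisation ((5.15)–(5.20)) is a change of variables on top of it.
* §5: Gibbon's variables on the unit torus (`L = 1`, `ϖ₀ = ν`): `gibbonOmega ν m v =
  (∫|ω|^{2m} + ν^{2m})^{1/2m}` ((1.2)/(5.16)), `gibbonAlpha m = 2m/(4m−3)` ((1.3)),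
  `gibbonD ν m v = (Ωₘ/ν)^{αₘ}` ((1.4)), `gibbonRho m = ⅔m(4m+1)`; `Ωₘ ≥ ν`, `Dₘ ≥ 1`,
  `Jₘ ≤ Ωₘ^{2m}`, and the chain rules `2mΩₘ^{2m−1}Ω̇ₘ = J̇ₘ`, `Ḋₘ = αₘDₘΩ̇ₘ/Ωₘ`.
* §6: (5.17)–(5.18) `exists_gibbonOmega_ladder`
  (`Ω̇ₘ ≤ νΩₘ{−k₁(Ω_{m+1}/Ωₘ)^{βₘ} + k₂(Ωₘ/ν)^{2αₘ} + k₃}`, `βₘ = 4m(m+1)/3`), the identity (5.19)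
  `(Ω_{m+1}/Ωₘ)^{βₘ} = (D_{m+1}/Dₘ)^{ρₘ}Dₘ²` (`gibbonOmega_ratio_rpow_eq`), **THEOREM 2**
  `exists_gibbonD_ladder` (`Ḋₘ ≤ Dₘ³{−νc₁(D_{m+1}/Dₘ)^{ρₘ} + νc₂}`), and the ratio criterion
  `exists_gibbonD_deriv_nonpos_of_ratio_ge` (`D_{m+1} ≥ C Dₘ ⇒ Ḋₘ ≤ 0`; Gibbon 2013 (4.3)).
* §7: the stretching-only ladder for `ν ≥ 0` (Euler included), Gibbon 2013 IUTAM Prop. 1: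
  `J̇ₘ ≤ K Jₘ^{1/2}J_{m+1}^{1/2}` ((P1), `exists_vorticityMoment_stretching_ladder`) and
  `Ω̇ₘ ≤ K (Ω_{m+1}/Ωₘ)^{m+1}Ωₘ²` for the unregularised `Ωₘ = Jₘ^{1/2m}` ((P2),
  `exists_vorticityFrequency_stretching_ladder`).
* §8: **THEOREM 3** of Gibbon 2012 (the time-integral criterion,
  `exists_gibbonD_le_initial_of_log_integral_nonneg`): `∫ₐᵗ log((1 + D_{m+1}/Dₘ)/C) ≥ 0 ⇒
  Dₘ(t) ≤ Dₘ(a)` — the ladder divided by `Dₘ³`, integrated, and Jensen's inequality.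
* §9: Gibbon–Donzis–Gupta–Kerr–Pandit–Vincenzi 2014, §2.3: the interpolation
  `Ωₘ^{m²} ≤ Ω₁Ω_{m+1}^{m²−1}` (`gibbonOmega_pow_interpolation`), hence
  `Dₘ/D₁ ≤ (D_{m+1}/Dₘ)^{(m−1)(4m+1)}` (`gibbonD_div_first_le_ratio_pow`), the first-rung ladder
  `Ḋₘ ≤ Dₘ³{−νc₁(Dₘ/D₁)^{ηₘ} + νc₂}`, `ηₘ = 2m/3(m−1)` (`exists_gibbonD_ladder_firstRung`), and
  regime III `CₘD₁ ≤ Dₘ ⇒ Ḋₘ ≤ 0` (`exists_gibbonD_deriv_nonpos_of_mul_first_le`), all `m ≥ 2`.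
* §10: **LEMMA 1** of Gibbon 2012 (the `ε`-family, `0 < ε < 2`:
  `K^{ε/ρₘ}∫ₐᵗDₘ^ε ≤ ∫ₐᵗD_{m+1}^ε ⇒ Dₘ(t) ≤ Dₘ(a)`, `exists_gibbonD_le_initial_of_integral_rpow_le`)
  — the ladder divided by `Dₘ^{3−ε}`, integrated, and Hölder in time.
* §11: Gibbon et al. 2014, §3.1: the enstrophy stretching term in the `D₁–Dₘ` plane,
  `∫σ ≤ K (∫|ω|²)^{(2m−3)/(2m−2)}(∫|ω|^{2m})^{1/(2m−2)}`
  (`exists_integral_stretching_le_rpow_mul_rpow`, `m ≥ 2`).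
* §12: the forcing step (5.7) `∫|ω|^{2(m−1)}∑ᵢⱼWᵢⱼ(∂ᵢfⱼ − ∂ⱼfᵢ) ≤ 2Jₘ^{(2m−1)/2m}(∫|curl f|^{2m})^{1/2m}`
  (`integral_pow_mul_forcing_le`) and the FORCED `Jₘ` ladder
  (`exists_vorticityMoment_ladder_forced`, smooth forcing slice).

DEVIATIONS FROM PRINT (for the referee). (i) Classical solutions
(`Torus.IsClassicalNSSolutionOn`) on a compact window `[a, b]` with one-sided time derivatives,
instead of "formally, on the maximal interval `[0, T*)`" of a strong solution. (ii) `Ωₘ` is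
regularised by the power mean `(Jₘ + ν^{2m})^{1/2m}` used in the printed PROOF ((5.16)), not
additively (`‖ω‖_{2m} + ϖ₀`, (1.2)): with the additive convention the printed step (5.17) fails
for `m > 1` (the chain-rule factor `‖ω‖_{2m}^{1−2m}` is not controlled by the regularised ratios);
the two conventions differ by at most a factor `2`. (iii) Natural `m ≥ 1` (print: real
`1 ≤ m < ∞`). (iv) The inhomogeneous correction of the Sobolev–Poincaré inequality on the torus
is carried explicitly (`ν c₂ Jₘ` in §4, `k₃` in §6) where the print absorbs it into `ϖ₀`.
(v) The `Ωₘ`/`Dₘ` forms are unforced (the print's forcing term `ϖ_{3,m} Gr Dₘ` rests on the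
single-scale forcing hypothesis (5.8) and is not typed); the `Jₘ`-form carries a general smooth
forcing (§12). (vi) All constants
existential, as in print. (vii) The time-integral criteria (Lemma 1, Theorem 3) are typed
pointwise in the final instant: the hypothesis at `t` gives `Dₘ(t) ≤ Dₘ(a)` (the print's "on the
interval `[0, t]`" is this statement applied at each instant of the interval); the threshold
constants are `K^{ε/ρₘ}`, `K = c₂/c₁`, and `C = [2^{ρₘ−1}(1 + c₂/c₁)]^{1/ρₘ}` in place of the
print's `[c_{1,m}c_{2,m}]^{ε/ρₘ}` and `c_{4,m}` (same expressions in the normalisation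
`ϖ_{2,m}/ϖ_{1,m} = c₂/c₁`). (viii) §9 is typed for natural `m ≥ 2` (print: `m > 1`).
-- TODO(real m): real exponents `m ≥ 1` via the `C¹`-weight balance
-- `IsClassicalNSSolutionOn.hasDerivWithinAt_integral_comp_torusVorticitySqAt`.

A priori differential inequalities along smooth solutions only; constants existential (the
printed `c_{n,m}` are inexplicit too). Nothing here is a regularity statement.

## References

* [Gibbon2012JMP] J. D. Gibbon, *Conditional regularity of solutions of the three-dimensional
  Navier–Stokes equations and implications for intermittency*, J. Math. Phys. 53 (2012) 115608
  (arXiv:1108.4651): §1.2 (1.2)–(1.4), Thm 2, §5 (proof) (5.1)–(5.20), §2.1 Lemma 1 and Thm 3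
  (with proofs).
* [Gibbon2013IUTAM] J. D. Gibbon, *Dynamics of scaled norms of vorticity for the
  three-dimensional Navier–Stokes and Euler equations*, Procedia IUTAM 7 (2013) 39–48
  (arXiv:1212.0684): Prop. 1 (Euler), Thm 2, (4.3).
* [GibbonEtAl2014Nonlinearity] J. D. Gibbon, D. A. Donzis, A. Gupta, R. M. Kerr, R. Pandit,
  D. Vincenzi, *Regimes of nonlinear depletion and regularity in the 3D Navier–Stokes equations*,
  Nonlinearity 27 (2014) 2605–2625 (arXiv:1402.1080): (1.1), (2.7)–(2.8), §2.3 (the three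
  regimes; `Dₘ/D₁ ≤ (D_{m+1}/Dₘ)^{(m−1)(4m+1)}`, the `ηₘ`-ladder, regime III), §3.1 (the
  stretching term against `D₁`, `Dₘ`).
* [Gibbon2010] J. D. Gibbon, Proc. R. Soc. A 466 (2010) 2587–2604, App. A (the `Jₘ` balance).
* [MajdaBertozziCUP2002] A. J. Majda, A. L. Bertozzi, *Vorticity and Incompressible Flow*, CUP
  2002, §11.1 (11.9) (Calderón–Zygmund `‖∇v‖_p ≤ c_p‖ω‖_p`).
-/

noncomputable section

open Set MeasureTheory Finset Filter Topology
open scoped ContDiff InnerProductSpace RealInnerProductSpace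

namespace Literature.Analysis.FluidPDE

open Literature.Analysis.FunctionSpaces

namespace VorticityMomentLadder

/-! ### §0 Bookkeeping: smoothness, continuity, integrability on `𝕋³` -/

variable {d : Type*} [Fintype d] [DecidableEq d]

/-- `Wᵢⱼ` of a smooth field is smooth. [folklore] -/
private theorem isSmooth_W {v : UnitAddTorus d → EuclideanSpace ℝ d}
    (hv : Torus.IsSmooth v) (i j : d) : Torus.IsSmooth (torusVorticityTensor v i j) :=
  ((hv.partialDeriv i).apply j).sub ((hv.partialDeriv j).apply i)

/-- `|ω|²` of a smooth field is smooth. [folklore] -/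
private theorem isSmooth_Q {v : UnitAddTorus d → EuclideanSpace ℝ d}
    (hv : Torus.IsSmooth v) : Torus.IsSmooth (torusVorticitySqAt v) := by
  have h : ∀ i j, Torus.IsSmooth (fun y => torusVorticityTensor v i j y ^ 2) := fun i j => by
    have := isSmooth_W hv i j
    exact this.pow 2
  have hl : Torus.lift (torusVorticitySqAt v) =
      fun z => (2⁻¹ : ℝ) * ∑ i, ∑ j, Torus.lift (fun y => torusVorticityTensor v i j y ^ 2) z := by
    funext z; rfl
  unfold Torus.IsSmooth at h ⊢
  rw [hl]
  exact contDiff_const.mul (ContDiff.sum fun i _ => ContDiff.sum fun j _ => h i j)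

omit [DecidableEq d] in
/-- Continuous real functions on the (compact, probability) torus are integrable. [folklore] -/
private theorem integrable_of_continuous {g : UnitAddTorus d → ℝ} (hg : Continuous g) :
    Integrable g := by
  have := hg.continuousOn.integrableOn_compact (μ := volume) isCompact_univ
  simpa using this

omit [DecidableEq d] in
/-- Continuous real functions on the torus are in every `L^p`, `p` real. [folklore] -/
private theorem memLp_of_continuous {g : UnitAddTorus d → ℝ} (hg : Continuous g) (p : ℝ) :
    MemLp g (ENNReal.ofReal p) volume :=
  hg.memLp_of_hasCompactSupport (HasCompactSupport.of_compactSpace g)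

/-- The gradient magnitude `|∇v|(x) = (∑ⱼ ‖∂ⱼv(x)‖²)^{1/2}` of a smooth field is continuous.
[folklore] -/
private theorem continuous_sqrt_gradSq {v : UnitAddTorus d → EuclideanSpace ℝ d} (hv : Torus.IsSmooth v) :
    Continuous fun x => Real.sqrt (∑ j, ‖Torus.partialDeriv j v x‖ ^ 2) :=
  Real.continuous_sqrt.comp
    (continuous_finsetSum _ fun j _ => ((hv.partialDeriv j).continuous.norm).pow 2)

/-! ### §1 Pointwise algebra on `𝕋³` -/

/-- **`|σ| ≤ |ω|² |∇v|` pointwise** for divergence-free fields on `𝕋³`: with `σ = ωᵀSω`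
(`torusStretchingDensity_fin_three_of_isDivFree`), Cauchy–Schwarz in the nine entries gives
`|ωᵀSω| ≤ |ω|² ‖S‖_F ≤ |ω|² ‖∇v‖_F`, `‖∇v‖_F² = ∑ⱼ‖∂ⱼv‖²` (the step
`∫|ω|^{2(m−1)} ω·(ω·∇u) ≤ ∫|ω|^{2m}|∇u|` opening (5.6) of Gibbon 2012).
[cite: Gibbon2012JMP, §5 (5.6)] -/
theorem abs_torusStretchingDensity_le_mul_sqrt
    {v : UnitAddTorus (Fin 3) → EuclideanSpace ℝ (Fin 3)} (hv : Torus.IsContDiff 1 v)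
    (hdiv : Torus.IsDivFree v) (x : UnitAddTorus (Fin 3)) :
    |torusStretchingDensity v x| ≤
      torusVorticitySqAt v x * Real.sqrt (∑ j, ‖Torus.partialDeriv j v x‖ ^ 2) := by
  rw [torusStretchingDensity_fin_three_of_isDivFree hv hdiv x]
  set w : Fin 3 → ℝ := fun a => torusVorticityTensor v (a + 1) (a + 2) x with hw
  set P : Fin 3 → Fin 3 → ℝ := fun a b => Torus.partialDeriv a v x b with hP
  set S : Fin 3 → Fin 3 → ℝ := fun a b => (P a b + P b a) / 2 with hS
  have hA : torusVorticitySqAt v x = ∑ a, w a ^ 2 := by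
    rw [torusVorticitySqAt_eq_sum_sq_of_equiv (Equiv.refl (Fin 3))]
    simp [hw]
  have hG : ∑ j, ‖Torus.partialDeriv j v x‖ ^ 2 = ∑ a, ∑ b, P a b ^ 2 := by
    refine Finset.sum_congr rfl fun a _ => ?_
    rw [EuclideanSpace.norm_sq_eq]
    refine Finset.sum_congr rfl fun b _ => ?_
    rw [Real.norm_eq_abs, sq_abs]
  -- the quadratic form as a sum over pairs
  have hsum : (∑ a, ∑ b, torusVorticityTensor v (a + 1) (a + 2) x *
      ((Torus.partialDeriv a v x b + Torus.partialDeriv b v x a) / 2) *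
      torusVorticityTensor v (b + 1) (b + 2) x) =
      ∑ p : Fin 3 × Fin 3, (w p.1 * w p.2) * S p.1 p.2 := by
    rw [Fintype.sum_prod_type]
    refine Finset.sum_congr rfl fun a _ => Finset.sum_congr rfl fun b _ => ?_
    simp only [hw, hS, hP]
    ring
  -- Cauchy–Schwarz over the nine pairs
  have hcs := Finset.sum_mul_sq_le_sq_mul_sq (Finset.univ : Finset (Fin 3 × Fin 3))
    (fun p => w p.1 * w p.2) (fun p => S p.1 p.2)
  have hww : ∑ p : Fin 3 × Fin 3, (w p.1 * w p.2) ^ 2 = (∑ a, w a ^ 2) ^ 2 := by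
    rw [Fintype.sum_prod_type, sq, Finset.sum_mul_sum]
    refine Finset.sum_congr rfl fun a _ => Finset.sum_congr rfl fun b _ => ?_
    ring
  have hSS : ∑ p : Fin 3 × Fin 3, S p.1 p.2 ^ 2 ≤ ∑ a, ∑ b, P a b ^ 2 := by
    rw [Fintype.sum_prod_type]
    have h1 : ∑ a, ∑ b, S a b ^ 2 ≤ ∑ a, ∑ b, (P a b ^ 2 + P b a ^ 2) / 2 :=
      Finset.sum_le_sum fun a _ => Finset.sum_le_sum fun b _ => by
        simp only [hS]
        nlinarith [sq_nonneg (P a b - P b a)]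
    have h2 : ∑ a, ∑ b, (P a b ^ 2 + P b a ^ 2) / 2 = ∑ a, ∑ b, P a b ^ 2 := by
      have hswap : ∑ a, ∑ b, P b a ^ 2 = ∑ a, ∑ b, P a b ^ 2 := Finset.sum_comm
      simp only [add_div, Finset.sum_add_distrib, ← Finset.sum_div]
      rw [hswap]
      ring
    exact h1.trans h2.le
  have hw0 : 0 ≤ ∑ a, w a ^ 2 := Finset.sum_nonneg fun a _ => sq_nonneg _
  have hP0 : 0 ≤ ∑ a, ∑ b, P a b ^ 2 :=
    Finset.sum_nonneg fun a _ => Finset.sum_nonneg fun b _ => sq_nonneg _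
  rw [hsum, hA, hG]
  have h2 : (∑ p : Fin 3 × Fin 3, w p.1 * w p.2 * S p.1 p.2) ^ 2 ≤
      ((∑ a, w a ^ 2) * Real.sqrt (∑ a, ∑ b, P a b ^ 2)) ^ 2 :=
    calc (∑ p : Fin 3 × Fin 3, w p.1 * w p.2 * S p.1 p.2) ^ 2
        ≤ (∑ p : Fin 3 × Fin 3, (w p.1 * w p.2) ^ 2) * ∑ p : Fin 3 × Fin 3, S p.1 p.2 ^ 2 := hcs
      _ ≤ (∑ a, w a ^ 2) ^ 2 * ∑ a, ∑ b, P a b ^ 2 := by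
          rw [hww]; exact mul_le_mul_of_nonneg_left hSS (sq_nonneg _)
      _ = ((∑ a, w a ^ 2) * Real.sqrt (∑ a, ∑ b, P a b ^ 2)) ^ 2 := by
          rw [mul_pow, Real.sq_sqrt hP0]
  exact abs_le_of_sq_le_sq h2 (mul_nonneg hw0 (Real.sqrt_nonneg _))

/-- **`(∂ₖ|ω|²)² ≤ 2|ω|² ∑ᵢⱼ(∂ₖWᵢⱼ)²` pointwise** (`|ω|² = ½∑Wᵢⱼ²`, `∂ₖ|ω|² = ∑ᵢⱼWᵢⱼ∂ₖWᵢⱼ`,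
Cauchy–Schwarz): the link between the two viscous integrals of the `Jₘ` balance and
`|∇(|ω|ᵐ)|²`, Gibbon 2012 §5 (a) ("`Δ(φᵐ) = m{(m−1)φ^{m−2}|∇φ|² + φ^{m−1}Δφ}`", (5.3)–(5.5)).
[cite: Gibbon2012JMP, §5 (5.3)–(5.5)] -/
theorem partialDeriv_torusVorticitySqAt_sq_le {v : UnitAddTorus d → EuclideanSpace ℝ d}
    (hv : Torus.IsSmooth v) (k : d) (x : UnitAddTorus d) :
    Torus.partialDeriv k (torusVorticitySqAt v) x ^ 2 ≤
      2 * torusVorticitySqAt v x *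
        ∑ i, ∑ j, Torus.partialDeriv k (torusVorticityTensor v i j) x ^ 2 := by
  -- `∂ₖ|ω|² = ∑ᵢⱼ Wᵢⱼ ∂ₖWᵢⱼ`
  have hW1 : ∀ i j, Torus.IsContDiff 1 (torusVorticityTensor v i j) :=
    fun i j => (isSmooth_W hv i j).isContDiff (by simp)
  have hsq : ∀ i j, Torus.IsContDiff 1
      (fun y => torusVorticityTensor v i j y * torusVorticityTensor v i j y) :=
    fun i j => (hW1 i j).mul (hW1 i j)
  have hrow : ∀ i, Torus.IsContDiff 1
      (fun y => ∑ j, torusVorticityTensor v i j y * torusVorticityTensor v i j y) := by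
    intro i
    have h : Torus.lift (fun y => ∑ j, torusVorticityTensor v i j y * torusVorticityTensor v i j y) =
        fun z => ∑ j, Torus.lift (fun y => torusVorticityTensor v i j y *
          torusVorticityTensor v i j y) z := rfl
    unfold Torus.IsContDiff
    rw [h]
    exact ContDiff.sum fun j _ => hsq i j
  have hfun : torusVorticitySqAt v = fun y => (2⁻¹ : ℝ) •
      ∑ i, ∑ j, torusVorticityTensor v i j y * torusVorticityTensor v i j y := by
    funext y
    simp only [torusVorticitySqAt, torusVorticityTensor, smul_eq_mul]
    congr 1
    exact Finset.sum_congr rfl fun i _ => Finset.sum_congr rfl fun j _ => by ring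
  have hder : Torus.partialDeriv k (torusVorticitySqAt v) x =
      ∑ i, ∑ j, torusVorticityTensor v i j x *
        Torus.partialDeriv k (torusVorticityTensor v i j) x := by
    rw [hfun, Torus.partialDeriv_smul (Torus.isContDiff_const _) ?_ k x]
    swap
    · have h : Torus.lift (fun y => ∑ i, ∑ j, torusVorticityTensor v i j y *
          torusVorticityTensor v i j y) = fun z => ∑ i, Torus.lift (fun y => ∑ j,
            torusVorticityTensor v i j y * torusVorticityTensor v i j y) z := rfl
      unfold Torus.IsContDiff
      rw [h]
      exact ContDiff.sum fun i _ => hrow i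
    have hc : Torus.partialDeriv k (fun _ : UnitAddTorus d => (2⁻¹ : ℝ)) x = 0 := by
      simp [Torus.partialDeriv, Torus.lineDeriv]
    rw [hc, zero_smul, add_zero, Torus.partialDeriv_finset_sum _ (fun i _ => hrow i), smul_eq_mul,
      Finset.mul_sum]
    refine Finset.sum_congr rfl fun i _ => ?_
    rw [Torus.partialDeriv_finset_sum _ (fun j _ => hsq i j), Finset.mul_sum]
    refine Finset.sum_congr rfl fun j _ => ?_
    rw [Torus.partialDeriv_mul (hW1 i j) (hW1 i j)]
    ring
  -- Cauchy–Schwarz over the pairs `(i, j)`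
  set W : d × d → ℝ := fun p => torusVorticityTensor v p.1 p.2 x with hWdef
  set D : d × d → ℝ := fun p => Torus.partialDeriv k (torusVorticityTensor v p.1 p.2) x with hDdef
  have hcs := Finset.sum_mul_sq_le_sq_mul_sq (Finset.univ : Finset (d × d)) W D
  have e1 : ∑ p : d × d, W p * D p = Torus.partialDeriv k (torusVorticitySqAt v) x := by
    rw [hder, Fintype.sum_prod_type]
  have e2 : ∑ p : d × d, W p ^ 2 = 2 * torusVorticitySqAt v x := by
    rw [Fintype.sum_prod_type]
    simp only [hWdef, torusVorticitySqAt, torusVorticityTensor]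
    ring
  have e3 : ∑ p : d × d, D p ^ 2 =
      ∑ i, ∑ j, Torus.partialDeriv k (torusVorticityTensor v i j) x ^ 2 := by
    rw [Fintype.sum_prod_type]
  rw [e1, e2, e3] at hcs
  exact hcs

/-- `σ` of a smooth field is smooth. [folklore] -/
private theorem isSmooth_σ {v : UnitAddTorus d → EuclideanSpace ℝ d}
    (hv : Torus.IsSmooth v) : Torus.IsSmooth (torusStretchingDensity v) := by
  have hD : ∀ i k, Torus.IsSmooth (fun y => Torus.partialDeriv i v y k) :=
    fun i k => (hv.partialDeriv i).apply k
  have h : ∀ i j k, Torus.IsSmooth (fun y => torusVorticityTensor v i j y *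
      (Torus.partialDeriv i v y k * Torus.partialDeriv k v y j)) :=
    fun i j k => (isSmooth_W hv i j).mul ((hD i k).mul (hD k j))
  have hl : Torus.lift (torusStretchingDensity v) = fun z => -∑ i, ∑ j, ∑ k, Torus.lift
      (fun y => torusVorticityTensor v i j y *
        (Torus.partialDeriv i v y k * Torus.partialDeriv k v y j)) z := by
    funext z
    simp only [Torus.lift_apply, torusStretchingDensity, Finset.mul_sum]
  unfold Torus.IsSmooth at h ⊢
  rw [hl]
  exact (ContDiff.sum fun i _ => ContDiff.sum fun j _ => ContDiff.sum fun k _ => h i j k).neg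

omit [Fintype d] [DecidableEq d] in
/-- `(xⁿ)ʳ = x^{n r}` for `x ≥ 0` (natural `n`, real `r`). [folklore] -/
private theorem pow_rpow_eq_rpow_mul {x : ℝ} (hx : 0 ≤ x) (n : ℕ) (r : ℝ) :
    (x ^ n) ^ r = x ^ ((n : ℝ) * r) := by
  rw [← Real.rpow_natCast, ← Real.rpow_mul hx]

omit [Fintype d] [DecidableEq d] in
/-- `(xⁿ)ʳ = xᵏ` when `n r = k` (`x ≥ 0`). [folklore] -/
private theorem pow_rpow_eq_pow {x : ℝ} (hx : 0 ≤ x) {n k : ℕ} {r : ℝ} (h : (n : ℝ) * r = k) :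
    (x ^ n) ^ r = x ^ k := by
  rw [pow_rpow_eq_rpow_mul hx, h, Real.rpow_natCast]

omit [Fintype d] [DecidableEq d] in
/-- `(xʳ)ⁿ = xᵏ` when `n r = k` (`x ≥ 0`, real `r`, natural `n`, `k`). [folklore] -/
private theorem pow_rpow_eq_pow' {x : ℝ} (hx : 0 ≤ x) {n k : ℕ} {r : ℝ} (h : (n : ℝ) * r = k) :
    (x ^ r) ^ n = x ^ k := by
  rw [← Real.rpow_natCast, ← Real.rpow_mul hx, mul_comm, h, Real.rpow_natCast]

/-! ### §2 The stretching term (Gibbon 2012, §5 (b), (5.6)–(5.8)) -/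

/-- **The Calderón–Zygmund step in moment form**: for every `n ≥ 1` there is `K ≥ 0` with
`∫ |∇v|^{2n} ≤ K ∫ |ω|^{2n}` for all smooth divergence-free `v` on `𝕋³`
(`|∇v| = (∑ⱼ‖∂ⱼv‖²)^{1/2}`, `|ω|² = torusVorticitySqAt v`) — the inequality
"`‖∇u‖_p ≤ c_p‖ω‖_p` for `p ∈ (1, ∞)` … based on a Riesz transform" used in (5.7), from the
tree's Bochner form `Torus.exists_gradLs_le_vorticityLs` at `s = 2n`.
[cite: Gibbon2012JMP, §5 (5.7); MajdaBertozziCUP2002, §11.1 eq. (11.9)] -/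
theorem exists_integral_gradSq_pow_le (n : ℕ) (hn : 1 ≤ n) :
    ∃ K : ℝ, 0 ≤ K ∧ ∀ v : UnitAddTorus (Fin 3) → EuclideanSpace ℝ (Fin 3), Torus.IsSmooth v →
      Torus.IsDivFree v →
      ∫ x, Real.sqrt (∑ j, ‖Torus.partialDeriv j v x‖ ^ 2) ^ (2 * n) ≤
        K * ∫ x, torusVorticitySqAt v x ^ n := by
  have hs : (1 : ℝ) < (2 * n : ℕ) := by
    have : (2 : ℝ) ≤ (2 * n : ℕ) := by exact_mod_cast (by omega : 2 ≤ 2 * n)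
    linarith
  obtain ⟨K, hK0, hK⟩ := Torus.exists_gradLs_le_vorticityLs hs
  refine ⟨K ^ (2 * n), pow_nonneg hK0 _, fun v hv hdiv => ?_⟩
  set G : UnitAddTorus (Fin 3) → ℝ := fun x => Real.sqrt (∑ j, ‖Torus.partialDeriv j v x‖ ^ 2)
    with hG
  set A : UnitAddTorus (Fin 3) → ℝ := fun x => torusVorticitySqAt v x with hA
  have hG0 : ∀ x, 0 ≤ G x := fun x => Real.sqrt_nonneg _
  have hA0 : ∀ x, 0 ≤ A x := fun x => torusVorticitySqAt_nonneg v x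
  have hs0 : (0 : ℝ) < (2 * n : ℕ) := by linarith
  have h := hK v hv hdiv
  -- convert the real powers to natural powers
  have e1 : (∫ x, G x ^ ((2 * n : ℕ) : ℝ)) = ∫ x, G x ^ (2 * n) :=
    integral_congr_ae (ae_of_all _ fun x => by simp only [Real.rpow_natCast])
  have e2 : (∫ x, Real.sqrt (A x) ^ ((2 * n : ℕ) : ℝ)) = ∫ x, A x ^ n :=
    integral_congr_ae (ae_of_all _ fun x => by
      simp only [Real.rpow_natCast, pow_mul, Real.sq_sqrt (hA0 x)])
  rw [e1, e2] at h
  have hI0 : 0 ≤ ∫ x, G x ^ (2 * n) := integral_nonneg fun x => pow_nonneg (hG0 x) _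
  have hJ0 : 0 ≤ ∫ x, A x ^ n := integral_nonneg fun x => pow_nonneg (hA0 x) _
  -- undo the `1/s`-th roots
  have hpos : 0 < (1 : ℝ) / (2 * n : ℕ) := by positivity
  have h2 : ((∫ x, G x ^ (2 * n)) ^ ((1 : ℝ) / (2 * n : ℕ))) ^ ((2 * n : ℕ) : ℝ) ≤
      (K * (∫ x, A x ^ n) ^ ((1 : ℝ) / (2 * n : ℕ))) ^ ((2 * n : ℕ) : ℝ) :=
    Real.rpow_le_rpow (Real.rpow_nonneg hI0 _) h hs0.le
  rw [← Real.rpow_mul hI0, Real.mul_rpow hK0 (Real.rpow_nonneg hJ0 _), ← Real.rpow_mul hJ0,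
    one_div_mul_cancel hs0.ne', Real.rpow_one, Real.rpow_one, Real.rpow_natCast] at h2
  exact h2

/-- **The stretching bound (5.6)–(5.8)**: for every `m ≥ 1` there is `K ≥ 0` such that for all
smooth divergence-free `v` on `𝕋³`,
`∫ |ω|^{2(m−1)} σ ≤ K (∫|ω|^{2m})^{1/2} (∫|ω|^{2(m+1)})^{1/2}` — Gibbon 2012, §5 (b):
"`∫|ω|^{2m}|∇u| ≤ (∫|∇u|^{2(m+1)})^{1/2(m+1)} (∫|ω|^{2(m+1)})^{m/2(m+1)} (∫|ω|^{2m})^{1/2} ≤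
cₘ J_{m+1}^{1/2} Jₘ^{1/2}`" (Hölder, then `‖∇u‖_p ≤ c_p‖ω‖_p`; here organised as Cauchy–Schwarz,
then Hölder with exponents `((m+1)/m, m+1)`, then `exists_integral_gradSq_pow_le`).
[cite: Gibbon2012JMP, §5 (5.6)–(5.8)] -/
theorem exists_integral_pow_mul_stretching_le (m : ℕ) (hm : 1 ≤ m) :
    ∃ K : ℝ, 0 ≤ K ∧ ∀ v : UnitAddTorus (Fin 3) → EuclideanSpace ℝ (Fin 3), Torus.IsSmooth v →
      Torus.IsDivFree v →
      ∫ x, torusVorticitySqAt v x ^ (m - 1) * torusStretchingDensity v x ≤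
        K * Real.sqrt (∫ x, torusVorticitySqAt v x ^ m) *
          Real.sqrt (∫ x, torusVorticitySqAt v x ^ (m + 1)) := by
  obtain ⟨K, hK0, hK⟩ := exists_integral_gradSq_pow_le (m + 1) (by omega)
  refine ⟨Real.sqrt (K ^ ((1 : ℝ) / (m + 1))), Real.sqrt_nonneg _, fun v hv hdiv => ?_⟩
  set G : UnitAddTorus (Fin 3) → ℝ := fun x => Real.sqrt (∑ j, ‖Torus.partialDeriv j v x‖ ^ 2)
    with hG
  set A : UnitAddTorus (Fin 3) → ℝ := fun x => torusVorticitySqAt v x with hA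
  have hG0 : ∀ x, 0 ≤ G x := fun x => Real.sqrt_nonneg _
  have hA0 : ∀ x, 0 ≤ A x := fun x => torusVorticitySqAt_nonneg v x
  have hAc : Continuous A := (isSmooth_Q hv).continuous
  have hGc : Continuous G := continuous_sqrt_gradSq hv
  have hσc : Continuous (torusStretchingDensity v) := (isSmooth_σ hv).continuous
  have hv1 : Torus.IsContDiff 1 v := hv.isContDiff (by simp)
  set Jm : ℝ := ∫ x, A x ^ m with hJm
  set Jp : ℝ := ∫ x, A x ^ (m + 1) with hJp
  have hJm0 : 0 ≤ Jm := integral_nonneg fun x => pow_nonneg (hA0 x) _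
  have hJp0 : 0 ≤ Jp := integral_nonneg fun x => pow_nonneg (hA0 x) _
  -- (i) `∫ A^{m-1} σ ≤ ∫ A^m G`
  have h1 : ∫ x, A x ^ (m - 1) * torusStretchingDensity v x ≤ ∫ x, A x ^ m * G x := by
    refine integral_mono (integrable_of_continuous ((hAc.pow _).mul hσc))
      (integrable_of_continuous ((hAc.pow _).mul hGc)) fun x => ?_
    have hσ := abs_torusStretchingDensity_le_mul_sqrt hv1 hdiv x
    have hpm : A x ^ m = A x ^ (m - 1) * A x := (pow_sub_one_mul (by omega) (A x)).symm
    calc A x ^ (m - 1) * torusStretchingDensity v x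
        ≤ A x ^ (m - 1) * |torusStretchingDensity v x| :=
          mul_le_mul_of_nonneg_left (le_abs_self _) (pow_nonneg (hA0 x) _)
      _ ≤ A x ^ (m - 1) * (A x * G x) := mul_le_mul_of_nonneg_left hσ (pow_nonneg (hA0 x) _)
      _ = A x ^ m * G x := by rw [hpm]; ring
  -- (ii) Cauchy–Schwarz: `∫ A^m G ≤ √(∫A^m) √(∫A^m G²)`
  have h2 : ∫ x, A x ^ m * G x ≤ Real.sqrt Jm * Real.sqrt (∫ x, A x ^ m * G x ^ 2) := by
    have hf0 : ∀ x, 0 ≤ Real.sqrt (A x ^ m) := fun x => Real.sqrt_nonneg _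
    have hfc : Continuous fun x => Real.sqrt (A x ^ m) := Real.continuous_sqrt.comp (hAc.pow m)
    have hgc : Continuous fun x => Real.sqrt (A x ^ m) * G x := hfc.mul hGc
    have hH := integral_mul_le_Lp_mul_Lq_of_nonneg (μ := volume) Real.HolderConjugate.two_two
      (f := fun x => Real.sqrt (A x ^ m)) (g := fun x => Real.sqrt (A x ^ m) * G x)
      (ae_of_all _ hf0) (ae_of_all _ fun x => mul_nonneg (hf0 x) (hG0 x))
      (memLp_of_continuous hfc 2) (memLp_of_continuous hgc 2)
    have e0 : (fun x => Real.sqrt (A x ^ m) * (Real.sqrt (A x ^ m) * G x)) =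
        fun x => A x ^ m * G x := by
      funext x
      rw [← mul_assoc, Real.mul_self_sqrt (pow_nonneg (hA0 x) _)]
    have e1 : (∫ x, Real.sqrt (A x ^ m) ^ (2 : ℝ)) = Jm :=
      integral_congr_ae (ae_of_all _ fun x => by
        dsimp only
        rw [Real.rpow_two, Real.sq_sqrt (pow_nonneg (hA0 x) _)])
    have e2 : (∫ x, (Real.sqrt (A x ^ m) * G x) ^ (2 : ℝ)) = ∫ x, A x ^ m * G x ^ 2 :=
      integral_congr_ae (ae_of_all _ fun x => by
        dsimp only
        rw [Real.rpow_two, mul_pow, Real.sq_sqrt (pow_nonneg (hA0 x) _)])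
    rw [e0, e1, e2] at hH
    simpa only [Real.sqrt_eq_rpow, one_div] using hH
  -- (iii) Hölder `((m+1)/m, m+1)`: `∫ A^m G² ≤ (∫A^{m+1})^{m/(m+1)} (∫G^{2m+2})^{1/(m+1)}`
  have hm0 : (0 : ℝ) < m := by exact_mod_cast hm
  have hm1 : (0 : ℝ) < m + 1 := by linarith
  have hpq : Real.HolderConjugate (((m : ℝ) + 1) / m) ((m : ℝ) + 1) :=
    { inv_add_inv_eq_inv := by
        rw [inv_one, inv_div, inv_eq_one_div, ← add_div, div_self hm1.ne']
      left_pos := by positivity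
      right_pos := hm1 }
  have h3 : ∫ x, A x ^ m * G x ^ 2 ≤
      Jp ^ ((m : ℝ) / (m + 1)) * (∫ x, G x ^ (2 * (m + 1))) ^ ((1 : ℝ) / (m + 1)) := by
    have hH := integral_mul_le_Lp_mul_Lq_of_nonneg (μ := volume) hpq
      (f := fun x => A x ^ m) (g := fun x => G x ^ 2)
      (ae_of_all _ fun x => pow_nonneg (hA0 x) _) (ae_of_all _ fun x => pow_nonneg (hG0 x) _)
      (memLp_of_continuous (hAc.pow m) _) (memLp_of_continuous (hGc.pow 2) _)
    have e1 : (∫ x, (A x ^ m) ^ (((m : ℝ) + 1) / m)) = Jp :=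
      integral_congr_ae (ae_of_all _ fun x => by
        dsimp only
        rw [pow_rpow_eq_pow (hA0 x) (k := m + 1) (by push_cast; field_simp)])
    have e2 : (∫ x, (G x ^ 2) ^ ((m : ℝ) + 1)) = ∫ x, G x ^ (2 * (m + 1)) :=
      integral_congr_ae (ae_of_all _ fun x => by
        dsimp only
        rw [pow_rpow_eq_pow (hG0 x) (k := 2 * (m + 1)) (by push_cast; ring)])
    have e3 : (1 : ℝ) / (((m : ℝ) + 1) / m) = (m : ℝ) / (m + 1) := by
      field_simp
    rw [e1, e2, e3] at hH
    exact hH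
  -- (iv) Calderón–Zygmund: `∫ G^{2m+2} ≤ K ∫ A^{m+1}`
  have h4 : ∫ x, G x ^ (2 * (m + 1)) ≤ K * Jp := hK v hv hdiv
  have hI0 : 0 ≤ ∫ x, G x ^ (2 * (m + 1)) := integral_nonneg fun x => pow_nonneg (hG0 x) _
  -- (v) assemble: `∫ A^m G² ≤ K^{1/(m+1)} Jp`
  set K' : ℝ := K ^ ((1 : ℝ) / (m + 1)) with hK'
  have hK'0 : 0 ≤ K' := Real.rpow_nonneg hK0 _
  have h5 : ∫ x, A x ^ m * G x ^ 2 ≤ K' * Jp := by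
    have h41 : (∫ x, G x ^ (2 * (m + 1))) ^ ((1 : ℝ) / (m + 1)) ≤ (K * Jp) ^ ((1 : ℝ) / (m + 1)) :=
      Real.rpow_le_rpow hI0 h4 (by positivity)
    have hsum1 : (m : ℝ) / (m + 1) + 1 / (m + 1) = 1 := by field_simp
    calc ∫ x, A x ^ m * G x ^ 2
        ≤ Jp ^ ((m : ℝ) / (m + 1)) * (∫ x, G x ^ (2 * (m + 1))) ^ ((1 : ℝ) / (m + 1)) := h3
      _ ≤ Jp ^ ((m : ℝ) / (m + 1)) * (K * Jp) ^ ((1 : ℝ) / (m + 1)) :=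
          mul_le_mul_of_nonneg_left h41 (Real.rpow_nonneg hJp0 _)
      _ = K' * (Jp ^ ((m : ℝ) / (m + 1)) * Jp ^ ((1 : ℝ) / (m + 1))) := by
          rw [Real.mul_rpow hK0 hJp0]; ring
      _ = K' * Jp := by
          rw [← Real.rpow_add' hJp0 (by rw [hsum1]; exact one_ne_zero), hsum1, Real.rpow_one]
  -- conclusion
  have h6 : Real.sqrt (∫ x, A x ^ m * G x ^ 2) ≤ Real.sqrt K' * Real.sqrt Jp := by
    rw [← Real.sqrt_mul hK'0]
    exact Real.sqrt_le_sqrt h5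
  calc ∫ x, A x ^ (m - 1) * torusStretchingDensity v x
      ≤ ∫ x, A x ^ m * G x := h1
    _ ≤ Real.sqrt Jm * Real.sqrt (∫ x, A x ^ m * G x ^ 2) := h2
    _ ≤ Real.sqrt Jm * (Real.sqrt K' * Real.sqrt Jp) :=
        mul_le_mul_of_nonneg_left h6 (Real.sqrt_nonneg _)
    _ = Real.sqrt K' * Real.sqrt Jm * Real.sqrt Jp := by ring

/-! ### §3 The viscous term and Sobolev (Gibbon 2012, §5 (a) and (d): (5.3)–(5.5), (5.13)) -/

omit [Fintype d] [DecidableEq d] in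
/-- `(a + b)⁶ ≤ 64 (a⁶ + b⁶)` for `a, b ≥ 0`. [folklore] -/
private theorem add_pow_six_le {a b : ℝ} (ha : 0 ≤ a) (hb : 0 ≤ b) :
    (a + b) ^ 6 ≤ 64 * (a ^ 6 + b ^ 6) := by
  have h1 : a + b ≤ 2 * max a b := by
    rcases le_total a b with h | h
    · rw [max_eq_right h]; linarith
    · rw [max_eq_left h]; linarith
  have h2 : (a + b) ^ 6 ≤ (2 * max a b) ^ 6 := pow_le_pow_left₀ (add_nonneg ha hb) h1 6
  have h3 : (max a b) ^ 6 ≤ a ^ 6 + b ^ 6 := by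
    rcases le_total a b with h | h
    · rw [max_eq_right h]; linarith [pow_nonneg ha 6]
    · rw [max_eq_left h]; linarith [pow_nonneg hb 6]
  calc (a + b) ^ 6 ≤ (2 * max a b) ^ 6 := h2
    _ = 64 * (max a b) ^ 6 := by ring
    _ ≤ 64 * (a ^ 6 + b ^ 6) := by linarith

/-- The regularised weight `(|ω|² + ε)^{m/2}` of a smooth field is smooth for `ε > 0` (Gibbon's
`Aₘ = |ω|ᵐ`, (5.5), made smooth at the zeros of `ω`). [folklore] -/
private theorem isSmooth_regWeight {v : UnitAddTorus d → EuclideanSpace ℝ d} (hv : Torus.IsSmooth v)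
    {ε : ℝ} (hε : 0 < ε) (r : ℝ) :
    Torus.IsSmooth (fun x => (torusVorticitySqAt v x + ε) ^ r) := by
  have hw : Torus.IsSmooth (fun x => torusVorticitySqAt v x + ε) :=
    (isSmooth_Q hv).add (Torus.isSmooth_const ε)
  have hφ : ContDiffOn ℝ ∞ (fun s : ℝ => s ^ r) (Ioi 0) := fun s hs =>
    (Real.contDiffAt_rpow_const_of_ne (p := r) (n := ∞) (ne_of_gt hs)).contDiffWithinAt
  exact Torus.IsSmooth.comp_of_contDiffOn hφ hw fun x =>
    add_pos_of_nonneg_of_pos (torusVorticitySqAt_nonneg v x) hε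

/-- **Gradient of the regularised weight**: for smooth `v`, `m ≥ 1`, `ε > 0`,
`∑ₖ (∂ₖ(|ω|² + ε)^{m/2})² ≤ (m²/2) (|ω|² + ε)^{m−1} ∑ₖᵢⱼ (∂ₖWᵢⱼ)²` pointwise — the bound
`|∇Aₘ|² ≤ (m²/2)|ω|^{2(m−1)}|∇ω|²`-type comparison between `|∇(|ω|ᵐ)|²` and the viscous integrand of
the `Jₘ` balance behind (5.3)–(5.5) of Gibbon 2012. [cite: Gibbon2012JMP, §5 (5.3)–(5.5)] -/
theorem sum_partialDeriv_regWeight_sq_le {v : UnitAddTorus d → EuclideanSpace ℝ d}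
    (hv : Torus.IsSmooth v) {m : ℕ} (hm : 1 ≤ m) {ε : ℝ} (hε : 0 < ε) (x : UnitAddTorus d) :
    ∑ k, Torus.partialDeriv k (fun y => (torusVorticitySqAt v y + ε) ^ ((m : ℝ) / 2)) x ^ 2 ≤
      (m : ℝ) ^ 2 / 2 * (torusVorticitySqAt v x + ε) ^ (m - 1) *
        ∑ k, ∑ i, ∑ j, Torus.partialDeriv k (torusVorticityTensor v i j) x ^ 2 := by
  set A : UnitAddTorus d → ℝ := fun y => torusVorticitySqAt v y with hA
  set w : UnitAddTorus d → ℝ := fun y => A y + ε with hw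
  have hA0 : ∀ y, 0 ≤ A y := fun y => torusVorticitySqAt_nonneg v y
  have hwpos : ∀ y, 0 < w y := fun y => add_pos_of_nonneg_of_pos (hA0 y) hε
  have hAs : Torus.IsSmooth A := isSmooth_Q hv
  have hws : Torus.IsSmooth w := hAs.add (Torus.isSmooth_const ε)
  have hw1 : Torus.IsContDiff 1 w := hws.isContDiff (by simp)
  have hA1 : Torus.IsContDiff 1 A := hAs.isContDiff (by simp)
  -- chain rule: `∂ₖ w^{m/2} = (m/2) w^{m/2-1} ∂ₖA`
  have hder : ∀ k, Torus.partialDeriv k (fun y => w y ^ ((m : ℝ) / 2)) x =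
      (m : ℝ) / 2 * w x ^ ((m : ℝ) / 2 - 1) * Torus.partialDeriv k A x := by
    intro k
    have hφ : DifferentiableAt ℝ (fun s : ℝ => s ^ ((m : ℝ) / 2)) (w x) :=
      (Real.hasDerivAt_rpow_const (Or.inl (hwpos x).ne')).differentiableAt
    rw [Torus.partialDeriv_comp_of_differentiableAt hφ hw1 k,
      (Real.hasDerivAt_rpow_const (Or.inl (hwpos x).ne')).deriv]
    have hwA : Torus.partialDeriv k w x = Torus.partialDeriv k A x := by
      have : w = A + fun _ => ε := by funext y; rfl
      rw [this, Torus.partialDeriv_add hA1 (Torus.isContDiff_const ε)]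
      simp [Torus.partialDeriv, Torus.lineDeriv]
    rw [hwA]
  -- the sum of squares
  have hsq : ∀ k, Torus.partialDeriv k (fun y => w y ^ ((m : ℝ) / 2)) x ^ 2 =
      (m : ℝ) ^ 2 / 4 * w x ^ ((m : ℝ) - 2) * Torus.partialDeriv k A x ^ 2 := by
    intro k
    rw [hder k]
    have e : (w x ^ ((m : ℝ) / 2 - 1)) ^ 2 = w x ^ ((m : ℝ) - 2) := by
      rw [← Real.rpow_natCast, ← Real.rpow_mul (hwpos x).le]
      congr 1
      push_cast
      ring
    calc ((m : ℝ) / 2 * w x ^ ((m : ℝ) / 2 - 1) * Torus.partialDeriv k A x) ^ 2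
        = (m : ℝ) ^ 2 / 4 * (w x ^ ((m : ℝ) / 2 - 1)) ^ 2 * Torus.partialDeriv k A x ^ 2 := by ring
      _ = (m : ℝ) ^ 2 / 4 * w x ^ ((m : ℝ) - 2) * Torus.partialDeriv k A x ^ 2 := by rw [e]
  have hpt : ∀ k, Torus.partialDeriv k A x ^ 2 ≤
      2 * A x * ∑ i, ∑ j, Torus.partialDeriv k (torusVorticityTensor v i j) x ^ 2 :=
    fun k => partialDeriv_torusVorticitySqAt_sq_le hv k x
  -- `w^{m-2} A ≤ w^{m-1}`
  have hwm : w x ^ ((m : ℝ) - 2) * A x ≤ w x ^ (m - 1) := by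
    have e : (w x ^ (m - 1) : ℝ) = w x ^ ((m : ℝ) - 2) * w x := by
      rw [← Real.rpow_natCast, Nat.cast_sub hm, Nat.cast_one,
        show (m : ℝ) - 1 = ((m : ℝ) - 2) + 1 by ring, Real.rpow_add (hwpos x), Real.rpow_one]
    rw [e]
    exact mul_le_mul_of_nonneg_left (le_add_of_nonneg_right hε.le) (Real.rpow_nonneg (hwpos x).le _)
  have hQ0 : 0 ≤ ∑ k, ∑ i, ∑ j, Torus.partialDeriv k (torusVorticityTensor v i j) x ^ 2 :=
    Finset.sum_nonneg fun k _ => Finset.sum_nonneg fun i _ => Finset.sum_nonneg fun j _ => sq_nonneg _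
  calc ∑ k, Torus.partialDeriv k (fun y => w y ^ ((m : ℝ) / 2)) x ^ 2
      = ∑ k, (m : ℝ) ^ 2 / 4 * w x ^ ((m : ℝ) - 2) * Torus.partialDeriv k A x ^ 2 :=
        Finset.sum_congr rfl fun k _ => hsq k
    _ ≤ ∑ k, (m : ℝ) ^ 2 / 4 * w x ^ ((m : ℝ) - 2) *
        (2 * A x * ∑ i, ∑ j, Torus.partialDeriv k (torusVorticityTensor v i j) x ^ 2) :=
        Finset.sum_le_sum fun k _ => mul_le_mul_of_nonneg_left (hpt k)
          (mul_nonneg (by positivity) (Real.rpow_nonneg (hwpos x).le _))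
    _ = (m : ℝ) ^ 2 / 2 * (w x ^ ((m : ℝ) - 2) * A x) *
        ∑ k, ∑ i, ∑ j, Torus.partialDeriv k (torusVorticityTensor v i j) x ^ 2 := by
        rw [Finset.mul_sum]
        refine Finset.sum_congr rfl fun k _ => ?_
        ring
    _ ≤ (m : ℝ) ^ 2 / 2 * w x ^ (m - 1) *
        ∑ k, ∑ i, ∑ j, Torus.partialDeriv k (torusVorticityTensor v i j) x ^ 2 :=
        mul_le_mul_of_nonneg_right (mul_le_mul_of_nonneg_left hwm (by positivity)) hQ0

omit [DecidableEq d] in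
/-- `(∫ g)² ≤ ∫ g²` on the probability torus (Cauchy–Schwarz / Jensen) for continuous `g ≥ 0`.
[folklore] -/
private theorem sq_integral_le_integral_sq {g : UnitAddTorus d → ℝ} (hg : Continuous g)
    (hg0 : ∀ x, 0 ≤ g x) : (∫ x, g x) ^ 2 ≤ ∫ x, g x ^ 2 := by
  have hH := integral_mul_le_Lp_mul_Lq_of_nonneg (μ := volume) Real.HolderConjugate.two_two
    (f := g) (g := fun _ => (1 : ℝ)) (ae_of_all _ hg0) (ae_of_all _ fun _ => zero_le_one)
    (memLp_of_continuous hg 2) (memLp_of_continuous continuous_const 2)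
  simp only [mul_one, integral_const, smul_eq_mul, Real.rpow_two] at hH
  have hI0 : 0 ≤ ∫ x, g x ^ 2 := integral_nonneg fun x => sq_nonneg _
  have h1 : ∫ x, g x ≤ (∫ x, g x ^ 2) ^ ((1 : ℝ) / 2) := by
    simpa using hH
  have h0 : 0 ≤ ∫ x, g x := integral_nonneg hg0
  calc (∫ x, g x) ^ 2 ≤ ((∫ x, g x ^ 2) ^ ((1 : ℝ) / 2)) ^ 2 := pow_le_pow_left₀ h0 h1 2
    _ = ∫ x, g x ^ 2 := by
        rw [← Real.rpow_natCast, ← Real.rpow_mul hI0]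
        norm_num

/-- **The viscous term controls `(∫|ω|^{6m})^{1/3}`** (Gibbon 2012, §5 (a) with (d): the
Laplacian term of the `Jₘ` balance is `≤ −(2/c̃_{1,m})∫|∇Aₘ|²`, `Aₘ = |ω|ᵐ` ((5.3)–(5.5)), and
`‖Aₘ‖_{2(m+1)/m} ≤ cₘ‖∇Aₘ‖₂^{3/2(m+1)}‖Aₘ‖₂^{(2m−1)/2(m+1)}` (5.13), whose source is the Sobolev
embedding `H¹(𝕋³) ⊂ L⁶` applied to `Aₘ`). Typed form, for every `m ≥ 1`: there are
`C₁, C₂ ≥ 0` such that for all smooth `v` on `𝕋³`,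
`(∫ |ω|^{6m})^{1/3} ≤ C₁ ∫ |ω|^{2(m−1)} ∑ₖᵢⱼ(∂ₖWᵢⱼ)² + C₂ ∫ |ω|^{2m}`
(the first integral is the viscous integrand of
`IsClassicalNSSolutionOn.hasDerivWithinAt_integral_torusVorticitySqAt_pow`; the second is the
inhomogeneous correction of the Sobolev–Poincaré inequality on the torus, which the print absorbs
into the regularisation `ϖ₀` of `Ωₘ`). Proof: Sobolev–Poincaré
(`Torus.exists_integral_abs_rpow_sub_average_le_gradient`, `r = 6`, `s = 2`) for the smooth
`g = (|ω|² + ε)^{m/2}`, `sum_partialDeriv_regWeight_sq_le`, `(∫g)² ≤ ∫g²`, and `ε → 0`.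
[cite: Gibbon2012JMP, §5 (5.3)–(5.5) and (5.13)] -/
theorem exists_integral_pow_three_mul_rpow_le (m : ℕ) (hm : 1 ≤ m) :
    ∃ C₁ C₂ : ℝ, 0 ≤ C₁ ∧ 0 ≤ C₂ ∧ ∀ v : UnitAddTorus (Fin 3) → EuclideanSpace ℝ (Fin 3),
      Torus.IsSmooth v →
      (∫ x, torusVorticitySqAt v x ^ (3 * m)) ^ ((1 : ℝ) / 3) ≤
        C₁ * (∫ x, torusVorticitySqAt v x ^ (m - 1) *
          ∑ k, ∑ i, ∑ j, Torus.partialDeriv k (torusVorticityTensor v i j) x ^ 2) +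
        C₂ * ∫ x, torusVorticitySqAt v x ^ m := by
  obtain ⟨C, hC0, hC⟩ := Torus.exists_integral_abs_rpow_sub_average_le_gradient (d := Fin 3)
    (by simp) (s := 2) (r := 6) (by norm_num) (by norm_num) (by norm_num) (by norm_num)
  refine ⟨4 * (C ^ 2 * ((m : ℝ) ^ 2 / 2)), 4, by positivity, by norm_num, fun v hv => ?_⟩
  set A : UnitAddTorus (Fin 3) → ℝ := fun y => torusVorticitySqAt v y with hA
  set Q : UnitAddTorus (Fin 3) → ℝ := fun y =>
    ∑ k, ∑ i, ∑ j, Torus.partialDeriv k (torusVorticityTensor v i j) y ^ 2 with hQ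
  have hA0 : ∀ y, 0 ≤ A y := fun y => torusVorticitySqAt_nonneg v y
  have hQ0 : ∀ y, 0 ≤ Q y := fun y =>
    Finset.sum_nonneg fun k _ => Finset.sum_nonneg fun i _ => Finset.sum_nonneg fun j _ => sq_nonneg _
  have hAc : Continuous A := (isSmooth_Q hv).continuous
  have hQc : Continuous Q :=
    continuous_finsetSum _ fun k _ => continuous_finsetSum _ fun i _ => continuous_finsetSum _
      fun j _ => (((isSmooth_W hv i j).partialDeriv k).continuous).pow 2
  -- the claim for every `ε > 0`, with `A + ε` in place of `A` on the right
  set RHS : ℝ → ℝ := fun ε => 4 * (C ^ 2 * ((m : ℝ) ^ 2 / 2)) * (∫ x, (A x + ε) ^ (m - 1) * Q x) +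
    4 * ∫ x, (A x + ε) ^ m with hRHS
  have hmain : ∀ ε : ℝ, 0 < ε → (∫ x, A x ^ (3 * m)) ^ ((1 : ℝ) / 3) ≤ RHS ε := by
    intro ε hε
    set g : UnitAddTorus (Fin 3) → ℝ := fun y => (A y + ε) ^ ((m : ℝ) / 2) with hg
    have hwpos : ∀ y, 0 < A y + ε := fun y => add_pos_of_nonneg_of_pos (hA0 y) hε
    have hg0 : ∀ y, 0 ≤ g y := fun y => Real.rpow_nonneg (hwpos y).le _
    have hgs : Torus.IsSmooth g := isSmooth_regWeight hv hε _
    have hgc : Continuous g := hgs.continuous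
    set gbar : ℝ := ∫ y, g y with hgbar
    have hgbar0 : 0 ≤ gbar := integral_nonneg hg0
    -- powers of `g`
    have hg2 : ∀ y, g y ^ 2 = (A y + ε) ^ m := fun y =>
      pow_rpow_eq_pow' (hwpos y).le (by push_cast; ring)
    have hg6 : ∀ y, g y ^ 6 = (A y + ε) ^ (3 * m) := fun y =>
      pow_rpow_eq_pow' (hwpos y).le (by push_cast; ring)
    -- Sobolev–Poincaré for `g`
    have hS := hC g hgs
    have e6 : (∫ y, |g y - ∫ z, g z| ^ (6 : ℝ)) = ∫ y, |g y - gbar| ^ 6 :=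
      integral_congr_ae (ae_of_all _ fun y => by
        dsimp only
        rw [show (6 : ℝ) = ((6 : ℕ) : ℝ) by norm_num, Real.rpow_natCast])
    have e2 : (∫ y, (∑ j, Torus.partialDeriv j g y ^ 2) ^ ((2 : ℝ) / 2)) =
        ∫ y, ∑ j, Torus.partialDeriv j g y ^ 2 :=
      integral_congr_ae (ae_of_all _ fun y => by
        dsimp only
        rw [show (2 : ℝ) / 2 = 1 by norm_num, Real.rpow_one])
    rw [e6, e2] at hS
    set X : ℝ := ∫ y, |g y - gbar| ^ 6 with hX
    set Dg : ℝ := ∫ y, ∑ j, Torus.partialDeriv j g y ^ 2 with hDg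
    have hX0 : 0 ≤ X := integral_nonneg fun y => pow_nonneg (abs_nonneg _) _
    have hDg0 : 0 ≤ Dg := integral_nonneg fun y => Finset.sum_nonneg fun j _ => sq_nonneg _
    -- `X^{1/3} ≤ C² Dg`
    have hX3 : X ^ ((1 : ℝ) / 3) ≤ C ^ 2 * Dg := by
      have h1 : X ^ ((1 : ℝ) / 6) ≤ C * Dg ^ ((1 : ℝ) / 2) := hS
      have h2 : (X ^ ((1 : ℝ) / 6)) ^ 2 ≤ (C * Dg ^ ((1 : ℝ) / 2)) ^ 2 :=
        pow_le_pow_left₀ (Real.rpow_nonneg hX0 _) h1 2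
      have e1 : (X ^ ((1 : ℝ) / 6)) ^ 2 = X ^ ((1 : ℝ) / 3) := by
        rw [← Real.rpow_natCast, ← Real.rpow_mul hX0]; norm_num
      have e3 : (C * Dg ^ ((1 : ℝ) / 2)) ^ 2 = C ^ 2 * Dg := by
        rw [mul_pow, ← Real.rpow_natCast (Dg ^ ((1 : ℝ) / 2)), ← Real.rpow_mul hDg0]
        norm_num
      rw [e1, e3] at h2
      exact h2
    -- `Dg ≤ (m²/2) ∫ (A+ε)^{m-1} Q`
    have hDg1 : Dg ≤ (m : ℝ) ^ 2 / 2 * ∫ y, (A y + ε) ^ (m - 1) * Q y := by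
      rw [hDg, ← integral_const_mul]
      refine integral_mono (integrable_of_continuous (continuous_finsetSum _ fun j _ =>
        ((hgs.partialDeriv j).continuous).pow 2))
        (integrable_of_continuous (continuous_const.mul
          (((hAc.add continuous_const).pow _).mul hQc))) fun y => ?_
      have := sum_partialDeriv_regWeight_sq_le hv hm hε y
      simpa only [hg, hA, hQ, mul_assoc] using this
    -- `gbar² ≤ ∫ g² = ∫ (A+ε)^m`
    have hgbar2 : gbar ^ 2 ≤ ∫ y, (A y + ε) ^ m := by
      have := sq_integral_le_integral_sq hgc hg0
      simpa only [hg2] using this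
    -- `∫ A^{3m} ≤ ∫ g⁶ ≤ 64 (X + gbar⁶)`
    have hI : ∫ y, A y ^ (3 * m) ≤ 64 * (X + gbar ^ 6) := by
      have hi1 : ∫ y, A y ^ (3 * m) ≤ ∫ y, g y ^ 6 := by
        refine integral_mono (integrable_of_continuous (hAc.pow _))
          (integrable_of_continuous (hgc.pow 6)) fun y => ?_
        dsimp only
        rw [hg6]
        exact pow_le_pow_left₀ (hA0 y) (le_add_of_nonneg_right hε.le) _
      have hi2 : ∫ y, g y ^ 6 ≤ ∫ y, 64 * (|g y - gbar| ^ 6 + gbar ^ 6) := by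
        refine integral_mono (integrable_of_continuous (hgc.pow 6))
          (integrable_of_continuous (continuous_const.mul
            (((continuous_abs.comp (hgc.sub continuous_const)).pow 6).add continuous_const)))
          fun y => ?_
        have h := add_pow_six_le (abs_nonneg (g y - gbar)) hgbar0
        have e : g y ≤ |g y - gbar| + gbar :=
          calc g y = (g y - gbar) + gbar := by ring
            _ ≤ |g y - gbar| + gbar := by gcongr; exact le_abs_self _
        exact (pow_le_pow_left₀ (hg0 y) e 6).trans h
      have hint1 : Integrable (fun y => |g y - gbar| ^ 6) volume :=
        integrable_of_continuous ((continuous_abs.comp (hgc.sub continuous_const)).pow 6)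
      have hint2 : Integrable (fun _ : UnitAddTorus (Fin 3) => gbar ^ 6) volume :=
        integrable_const _
      have hi3 : ∫ y, 64 * (|g y - gbar| ^ 6 + gbar ^ 6) = 64 * (X + gbar ^ 6) := by
        rw [integral_const_mul, integral_add hint1 hint2]
        simp [hX]
      exact hi1.trans (hi2.trans hi3.le)
    -- take cube roots
    have hI0 : 0 ≤ ∫ y, A y ^ (3 * m) := integral_nonneg fun y => pow_nonneg (hA0 y) _
    have h64 : (64 * (X + gbar ^ 6)) ^ ((1 : ℝ) / 3) = 4 * (X + gbar ^ 6) ^ ((1 : ℝ) / 3) := by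
      rw [Real.mul_rpow (by norm_num) (by positivity), show (64 : ℝ) = 4 ^ (3 : ℕ) by norm_num,
        pow_rpow_eq_pow (by norm_num) (by push_cast; norm_num : ((3 : ℕ) : ℝ) * (1 / 3) = (1 : ℕ)),
        pow_one]
    have hsplit : (X + gbar ^ 6) ^ ((1 : ℝ) / 3) ≤ X ^ ((1 : ℝ) / 3) + gbar ^ 2 := by
      have h := Real.rpow_add_le_add_rpow hX0 (pow_nonneg hgbar0 6) (by norm_num : (0 : ℝ) ≤ 1 / 3)
        (by norm_num)
      have e : (gbar ^ 6) ^ ((1 : ℝ) / 3) = gbar ^ 2 :=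
        pow_rpow_eq_pow hgbar0 (by push_cast; norm_num)
      rw [e] at h
      exact h
    calc (∫ y, A y ^ (3 * m)) ^ ((1 : ℝ) / 3)
        ≤ (64 * (X + gbar ^ 6)) ^ ((1 : ℝ) / 3) := Real.rpow_le_rpow hI0 hI (by norm_num)
      _ = 4 * (X + gbar ^ 6) ^ ((1 : ℝ) / 3) := h64
      _ ≤ 4 * (X ^ ((1 : ℝ) / 3) + gbar ^ 2) := by linarith
      _ ≤ 4 * (C ^ 2 * ((m : ℝ) ^ 2 / 2 * ∫ y, (A y + ε) ^ (m - 1) * Q y) +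
            ∫ y, (A y + ε) ^ m) := by
          have : C ^ 2 * Dg ≤ C ^ 2 * ((m : ℝ) ^ 2 / 2 * ∫ y, (A y + ε) ^ (m - 1) * Q y) :=
            mul_le_mul_of_nonneg_left hDg1 (sq_nonneg C)
          linarith
      _ = RHS ε := by simp only [hRHS]; ring
  -- `ε → 0⁺`: the right side is continuous in `ε`
  have hcont : Continuous RHS := by
    have h1 : Continuous fun ε : ℝ => ∫ x, (A x + ε) ^ (m - 1) * Q x := by
      have hF : Continuous (Function.uncurry fun (ε : ℝ) (x : UnitAddTorus (Fin 3)) =>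
          (A x + ε) ^ (m - 1) * Q x) :=
        ((hAc.comp continuous_snd).add continuous_fst).pow _ |>.mul (hQc.comp continuous_snd)
      have := continuous_parametric_integral_of_continuous (μ := volume) hF isCompact_univ
      simpa only [Measure.restrict_univ] using this
    have h2 : Continuous fun ε : ℝ => ∫ x, (A x + ε) ^ m := by
      have hF : Continuous (Function.uncurry fun (ε : ℝ) (x : UnitAddTorus (Fin 3)) =>
          (A x + ε) ^ m) :=
        ((hAc.comp continuous_snd).add continuous_fst).pow _
      have := continuous_parametric_integral_of_continuous (μ := volume) hF isCompact_univ
      simpa only [Measure.restrict_univ] using this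
    simp only [hRHS]
    exact ((continuous_const.mul h1).add (continuous_const.mul h2))
  have hlim : Tendsto RHS (𝓝[>] 0) (𝓝 (RHS 0)) :=
    (hcont.tendsto 0).mono_left nhdsWithin_le_nhds
  have hev : ∀ᶠ ε in 𝓝[>] (0 : ℝ), (∫ x, A x ^ (3 * m)) ^ ((1 : ℝ) / 3) ≤ RHS ε :=
    eventually_nhdsWithin_of_forall fun ε hε => hmain ε hε
  have hfin := ge_of_tendsto hlim hev
  simpa only [hRHS, add_zero] using hfin

/-- **Interpolation `J_{m+1} ≤ Jₘ^{(2m−1)/2m} J_{3m}^{1/2m}`** (`‖A‖_{m+1} ≤ ‖A‖ₘ^θ‖A‖_{3m}^{1−θ}`,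
`A = |ω|²`; the `L^p`-interpolation half of Gibbon's Gagliardo–Nirenberg step (5.12)–(5.13),
`J_{m+1} ≤ cₘ (∫|∇(ωᵐ)|²)^{3/2m} Jₘ^{(2m−1)/2m}`, the other half being the Sobolev bound
`exists_integral_pow_three_mul_rpow_le`): Hölder with exponents `(2m/(2m−1), 2m)` applied to
`|ω|^{2(m+1)} = |ω|^{2m−1}·|ω|³`. [cite: Gibbon2012JMP, §5 (5.12)–(5.13)] -/
theorem integral_pow_succ_le_interpolation {m : ℕ} (hm : 1 ≤ m)
    {v : UnitAddTorus (Fin 3) → EuclideanSpace ℝ (Fin 3)} (hv : Torus.IsSmooth v) :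
    ∫ x, torusVorticitySqAt v x ^ (m + 1) ≤
      (∫ x, torusVorticitySqAt v x ^ m) ^ ((2 * (m : ℝ) - 1) / (2 * m)) *
        (∫ x, torusVorticitySqAt v x ^ (3 * m)) ^ ((1 : ℝ) / (2 * m)) := by
  set A : UnitAddTorus (Fin 3) → ℝ := fun y => torusVorticitySqAt v y with hA
  have hA0 : ∀ y, 0 ≤ A y := fun y => torusVorticitySqAt_nonneg v y
  have hAc : Continuous A := (isSmooth_Q hv).continuous
  have hm0 : (0 : ℝ) < m := by exact_mod_cast hm
  have h2m1 : (0 : ℝ) < 2 * m - 1 := by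
    have : (1 : ℝ) ≤ m := by exact_mod_cast hm
    linarith
  have hpq : Real.HolderConjugate (2 * (m : ℝ) / (2 * m - 1)) (2 * (m : ℝ)) :=
    { inv_add_inv_eq_inv := by
        rw [inv_one, inv_div, inv_eq_one_div, ← add_div, sub_add_cancel, div_self (by positivity)]
      left_pos := by positivity
      right_pos := by positivity }
  set f : UnitAddTorus (Fin 3) → ℝ := fun y => A y ^ ((2 * (m : ℝ) - 1) / 2) with hf
  set g : UnitAddTorus (Fin 3) → ℝ := fun y => A y ^ ((3 : ℝ) / 2) with hg
  have hf0 : ∀ y, 0 ≤ f y := fun y => Real.rpow_nonneg (hA0 y) _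
  have hg0 : ∀ y, 0 ≤ g y := fun y => Real.rpow_nonneg (hA0 y) _
  have hfc : Continuous f := hAc.rpow_const fun y => Or.inr (by positivity)
  have hgc : Continuous g := hAc.rpow_const fun y => Or.inr (by positivity)
  have hH := integral_mul_le_Lp_mul_Lq_of_nonneg (μ := volume) hpq (f := f) (g := g)
    (ae_of_all _ hf0) (ae_of_all _ hg0) (memLp_of_continuous hfc _) (memLp_of_continuous hgc _)
  have efg : (fun y => f y * g y) = fun y => A y ^ (m + 1) := by
    funext y
    simp only [hf, hg]
    rw [← Real.rpow_add' (hA0 y) (by positivity),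
      show (2 * (m : ℝ) - 1) / 2 + 3 / 2 = ((m + 1 : ℕ) : ℝ) by push_cast; ring, Real.rpow_natCast]
  have ef : (fun y => f y ^ (2 * (m : ℝ) / (2 * m - 1))) = fun y => A y ^ m := by
    funext y
    simp only [hf]
    rw [← Real.rpow_mul (hA0 y),
      show (2 * (m : ℝ) - 1) / 2 * (2 * m / (2 * m - 1)) = ((m : ℕ) : ℝ) by
        field_simp, Real.rpow_natCast]
  have eg : (fun y => g y ^ (2 * (m : ℝ))) = fun y => A y ^ (3 * m) := by
    funext y
    simp only [hg]
    rw [← Real.rpow_mul (hA0 y), show (3 : ℝ) / 2 * (2 * m) = ((3 * m : ℕ) : ℝ) by push_cast; ring,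
      Real.rpow_natCast]
  have e1 : (1 : ℝ) / (2 * (m : ℝ) / (2 * m - 1)) = (2 * (m : ℝ) - 1) / (2 * m) := by
    field_simp
  rw [show (fun y => f y * g y) = fun y => f y * g y from rfl] at hH
  simp only [efg, ef, eg, e1] at hH
  exact hH

/-- `J_{m+1}^{2m/3} ≤ Jₘ^{(2m−1)/3} J_{3m}^{1/3}` — `integral_pow_succ_le_interpolation` raised to
the power `2m/3`, the form in which it enters the ladder. [cite: Gibbon2012JMP, §5 (5.12)–(5.13)] -/
theorem integral_pow_succ_rpow_le_interpolation {m : ℕ} (hm : 1 ≤ m)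
    {v : UnitAddTorus (Fin 3) → EuclideanSpace ℝ (Fin 3)} (hv : Torus.IsSmooth v) :
    (∫ x, torusVorticitySqAt v x ^ (m + 1)) ^ (2 * (m : ℝ) / 3) ≤
      (∫ x, torusVorticitySqAt v x ^ m) ^ ((2 * (m : ℝ) - 1) / 3) *
        (∫ x, torusVorticitySqAt v x ^ (3 * m)) ^ ((1 : ℝ) / 3) := by
  have h := integral_pow_succ_le_interpolation hm hv
  have hm0 : (0 : ℝ) < m := by exact_mod_cast hm
  have hJ0 : ∀ n : ℕ, 0 ≤ ∫ x, torusVorticitySqAt v x ^ n := fun n =>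
    integral_nonneg fun x => pow_nonneg (torusVorticitySqAt_nonneg v x) _
  have h2 := Real.rpow_le_rpow (hJ0 (m + 1)) h (by positivity : (0 : ℝ) ≤ 2 * (m : ℝ) / 3)
  rw [Real.mul_rpow (Real.rpow_nonneg (hJ0 _) _) (Real.rpow_nonneg (hJ0 _) _),
    ← Real.rpow_mul (hJ0 _), ← Real.rpow_mul (hJ0 _)] at h2
  have e1 : (2 * (m : ℝ) - 1) / (2 * m) * (2 * m / 3) = (2 * (m : ℝ) - 1) / 3 := by
    field_simp
  have e2 : (1 : ℝ) / (2 * m) * (2 * m / 3) = (1 : ℝ) / 3 := by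
    field_simp
  rw [e1, e2] at h2
  exact h2

end VorticityMomentLadder

/-! ### §4 The ladder along classical solutions (Gibbon 2012, §5 (5.9), (5.13)) -/

open VorticityMomentLadder in
/-- **Gibbon's `Jₘ` ladder along classical solutions on `𝕋³` (`J`-form of (5.9) with (5.13)).**
For every `m ≥ 1` there are constants `c₁ > 0`, `c₂, c₃ ≥ 0` (depending only on `m`) such that
along every classical solution of the UNFORCED Navier–Stokes system (`ν ≥ 0`) on `𝕋³ × [a, b]`,
at every `t ∈ [a, b]`, every one-sided derivative value `R` of `s ↦ Jₘ(s) = ∫ |ω(s)|^{2m}` within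
`[a, b]` satisfies

`R ≤ −ν c₁ (∫|ω(t)|^{6m})^{1/3} + ν c₂ Jₘ(t) + c₃ Jₘ(t)^{1/2} J_{m+1}(t)^{1/2}`

— Gibbon 2012, §5: (5.9) `(1/2m)J̇ₘ ≤ −(ν/c̃_{1,m})∫|∇(ωᵐ)|² + cₘ J_{m+1}^{1/2}Jₘ^{1/2}`, with the
Sobolev half of (5.13) (`‖ωᵐ‖₆² ≲ ∫|∇(ωᵐ)|² + ∫|ω|^{2m}` on the torus; the printed argument
hides the inhomogeneous Sobolev correction `ν c₂ Jₘ` in the regularisation `ϖ₀` of `Ωₘ`).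
Proof: the exact balance `IsClassicalNSSolutionOn.hasDerivWithinAt_integral_torusVorticitySqAt_pow`
(Gibbon 2010 App. A), its second viscous integral dropped (nonpositive contribution),
`exists_integral_pow_three_mul_rpow_le` for the first, and the stretching bound
`exists_integral_pow_mul_stretching_le`. A priori inequality along smooth solutions; not a
regularity statement. [cite: Gibbon2012JMP, Thm 2 proof, §5 (5.9) and (5.13)] -/
theorem exists_vorticityMoment_ladder (m : ℕ) (hm : 1 ≤ m) :
    ∃ c₁ c₂ c₃ : ℝ, 0 < c₁ ∧ 0 ≤ c₂ ∧ 0 ≤ c₃ ∧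
      ∀ {a b ν : ℝ} {u : ℝ → UnitAddTorus (Fin 3) → EuclideanSpace ℝ (Fin 3)}
        {p : ℝ → UnitAddTorus (Fin 3) → ℝ},
        Torus.IsClassicalNSSolutionOn (Icc a b) ν 0 u p → a < b → 0 ≤ ν →
        ∀ {t : ℝ}, t ∈ Icc a b → ∀ {R : ℝ},
          HasDerivWithinAt (fun s => ∫ x, torusVorticitySqAt (u s) x ^ m) R (Icc a b) t →
          R ≤ -(ν * c₁ * (∫ x, torusVorticitySqAt (u t) x ^ (3 * m)) ^ ((1 : ℝ) / 3)) +
              ν * c₂ * (∫ x, torusVorticitySqAt (u t) x ^ m) +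
              c₃ * Real.sqrt (∫ x, torusVorticitySqAt (u t) x ^ m) *
                Real.sqrt (∫ x, torusVorticitySqAt (u t) x ^ (m + 1)) := by
  obtain ⟨C₁, C₂, hC₁, hC₂, hvisc⟩ := exists_integral_pow_three_mul_rpow_le m hm
  obtain ⟨K, hK0, hstr⟩ := exists_integral_pow_mul_stretching_le m hm
  -- `c₁ = m/(C₁+1)`, `c₂ = m C₂/(C₁+1)`, `c₃ = 2m K`
  have hm0 : (0 : ℝ) < m := by exact_mod_cast hm
  have hC₁1 : 0 < C₁ + 1 := by linarith
  refine ⟨(m : ℝ) / (C₁ + 1), (m : ℝ) * C₂ / (C₁ + 1), 2 * m * K, by positivity, by positivity,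
    by positivity, ?_⟩
  intro a b ν u p h hab hν t ht R hR
  have hut : Torus.IsSmooth (u t) := h.smooth_velocity.isSmooth_slice ht
  have hdiv : Torus.IsDivFree (u t) := h.divFree t ht
  set A : UnitAddTorus (Fin 3) → ℝ := fun y => torusVorticitySqAt (u t) y with hA
  set Q : UnitAddTorus (Fin 3) → ℝ := fun y =>
    ∑ k, ∑ i, ∑ j, Torus.partialDeriv k (torusVorticityTensor (u t) i j) y ^ 2 with hQ
  have hA0 : ∀ y, 0 ≤ A y := fun y => torusVorticitySqAt_nonneg (u t) y
  have hQ0 : ∀ y, 0 ≤ Q y := fun y =>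
    Finset.sum_nonneg fun k _ => Finset.sum_nonneg fun i _ => Finset.sum_nonneg fun j _ => sq_nonneg _
  -- the exact balance and uniqueness of the one-sided derivative
  have hD := h.hasDerivWithinAt_integral_torusVorticitySqAt_pow hab m ht
  have hU : UniqueDiffWithinAt ℝ (Icc a b) t := uniqueDiffOn_Icc hab t ht
  have hReq := (hR.derivWithin hU).symm.trans (hD.derivWithin hU)
  have hforce : (∫ x, torusVorticitySqAt (u t) x ^ (m - 1) * ∑ i, ∑ j,
      torusVorticityTensor (u t) i j x *
        (Torus.partialDeriv i ((0 : ℝ → UnitAddTorus (Fin 3) → EuclideanSpace ℝ (Fin 3)) t) x j -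
          Torus.partialDeriv j ((0 : ℝ → UnitAddTorus (Fin 3) → EuclideanSpace ℝ (Fin 3)) t) x i))
      = 0 := by
    have h0 : ∀ i (x : UnitAddTorus (Fin 3)),
        Torus.partialDeriv i (0 : UnitAddTorus (Fin 3) → EuclideanSpace ℝ (Fin 3)) x = 0 := by
      intro i x
      simp [Torus.partialDeriv, Torus.lineDeriv]
    simp [h0]
  rw [hforce, mul_zero, add_zero] at hReq
  -- the three estimates
  have hS := hstr (u t) hut hdiv
  have hV := hvisc (u t) hut
  have hV2 : 0 ≤ ∫ x, torusVorticitySqAt (u t) x ^ (m - 2) *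
      ∑ k, Torus.partialDeriv k (torusVorticitySqAt (u t)) x ^ 2 :=
    integral_nonneg fun x => mul_nonneg (pow_nonneg (hA0 x) _)
      (Finset.sum_nonneg fun k _ => sq_nonneg _)
  have hV1 : 0 ≤ ∫ x, torusVorticitySqAt (u t) x ^ (m - 1) * Q x :=
    integral_nonneg fun x => mul_nonneg (pow_nonneg (hA0 x) _) (hQ0 x)
  set J3 : ℝ := (∫ x, torusVorticitySqAt (u t) x ^ (3 * m)) ^ ((1 : ℝ) / 3) with hJ3
  set Jm : ℝ := ∫ x, torusVorticitySqAt (u t) x ^ m with hJm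
  set V1 : ℝ := ∫ x, torusVorticitySqAt (u t) x ^ (m - 1) * Q x with hV1def
  have hJm0 : 0 ≤ Jm := integral_nonneg fun x => pow_nonneg (hA0 x) _
  have hm1 : (0 : ℝ) ≤ (m : ℝ) - 1 := by
    have : (1 : ℝ) ≤ m := by exact_mod_cast hm
    linarith
  -- `-ν m V1 ≤ -(ν m/(C₁+1)) J3 + (ν m C₂/(C₁+1)) Jm` from `J3 ≤ C₁ V1 + C₂ Jm ≤ (C₁+1) V1 + C₂ Jm`
  have hkey : -(ν * ((m : ℝ) * V1)) ≤
      -(ν * ((m : ℝ) / (C₁ + 1)) * J3) + ν * ((m : ℝ) * C₂ / (C₁ + 1)) * Jm := by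
    have h1 : J3 ≤ (C₁ + 1) * V1 + C₂ * Jm := by
      have : C₁ * V1 ≤ (C₁ + 1) * V1 := by nlinarith
      linarith [hV]
    have h2 : J3 / (C₁ + 1) ≤ V1 + C₂ / (C₁ + 1) * Jm := by
      rw [div_le_iff₀ hC₁1]
      have : (V1 + C₂ / (C₁ + 1) * Jm) * (C₁ + 1) = (C₁ + 1) * V1 + C₂ * Jm := by
        field_simp
      rw [this]
      exact h1
    have h3 : ν * (m : ℝ) * (J3 / (C₁ + 1)) ≤ ν * (m : ℝ) * (V1 + C₂ / (C₁ + 1) * Jm) :=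
      mul_le_mul_of_nonneg_left h2 (by positivity)
    have e : ν * ((m : ℝ) / (C₁ + 1)) * J3 = ν * (m : ℝ) * (J3 / (C₁ + 1)) := by ring
    have e' : ν * ((m : ℝ) * C₂ / (C₁ + 1)) * Jm = ν * (m : ℝ) * (C₂ / (C₁ + 1) * Jm) := by ring
    rw [e, e']
    nlinarith
  rw [hReq]
  have hstretch : 2 * (m : ℝ) * ∫ x, torusVorticitySqAt (u t) x ^ (m - 1) *
      torusStretchingDensity (u t) x ≤ 2 * m * K * Real.sqrt Jm *
        Real.sqrt (∫ x, torusVorticitySqAt (u t) x ^ (m + 1)) := by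
    have := mul_le_mul_of_nonneg_left hS (by positivity : (0 : ℝ) ≤ 2 * m)
    simpa only [mul_assoc] using this
  nlinarith [hkey, hstretch, hV2, mul_nonneg hν (mul_nonneg (mul_nonneg hm0.le hm1) hV2)]

open VorticityMomentLadder in
/-- **Two-rung form of the ladder** (the shape of Gibbon's Theorem 2 in the `J`-variables: the
dissipation at rung `m` is bounded below by the NEXT rung, (5.9) with (5.13) inserted,
`(1/2m)J̇ₘ ≤ −(ν/cₘ) J_{m+1}^{2m/3} Jₘ^{−(2m−1)/3} + cₘ J_{m+1}^{1/2} Jₘ^{1/2}` up to the torus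
correction `ν c₂ Jₘ`). For every `m ≥ 1` there are `c₁ > 0`, `c₂, c₃ ≥ 0` such that along every
classical solution of the unforced system (`ν ≥ 0`) on `𝕋³ × [a, b]`, at every `t ∈ [a, b]` with
`Jₘ(t) > 0`, every one-sided derivative value `R` of `Jₘ` within `[a, b]` satisfies
`R ≤ −ν c₁ J_{m+1}^{2m/3} / Jₘ^{(2m−1)/3} + ν c₂ Jₘ + c₃ Jₘ^{1/2} J_{m+1}^{1/2}`.
[cite: Gibbon2012JMP, Thm 2 proof, §5 (5.9), (5.13)] -/
theorem exists_vorticityMoment_ladder_twoRung (m : ℕ) (hm : 1 ≤ m) :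
    ∃ c₁ c₂ c₃ : ℝ, 0 < c₁ ∧ 0 ≤ c₂ ∧ 0 ≤ c₃ ∧
      ∀ {a b ν : ℝ} {u : ℝ → UnitAddTorus (Fin 3) → EuclideanSpace ℝ (Fin 3)}
        {p : ℝ → UnitAddTorus (Fin 3) → ℝ},
        Torus.IsClassicalNSSolutionOn (Icc a b) ν 0 u p → a < b → 0 ≤ ν →
        ∀ {t : ℝ}, t ∈ Icc a b → 0 < ∫ x, torusVorticitySqAt (u t) x ^ m → ∀ {R : ℝ},
          HasDerivWithinAt (fun s => ∫ x, torusVorticitySqAt (u s) x ^ m) R (Icc a b) t →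
          R ≤ -(ν * c₁ * ((∫ x, torusVorticitySqAt (u t) x ^ (m + 1)) ^ (2 * (m : ℝ) / 3) /
                (∫ x, torusVorticitySqAt (u t) x ^ m) ^ ((2 * (m : ℝ) - 1) / 3))) +
              ν * c₂ * (∫ x, torusVorticitySqAt (u t) x ^ m) +
              c₃ * Real.sqrt (∫ x, torusVorticitySqAt (u t) x ^ m) *
                Real.sqrt (∫ x, torusVorticitySqAt (u t) x ^ (m + 1)) := by
  obtain ⟨c₁, c₂, c₃, hc₁, hc₂, hc₃, hlad⟩ := exists_vorticityMoment_ladder m hm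
  refine ⟨c₁, c₂, c₃, hc₁, hc₂, hc₃, ?_⟩
  intro a b ν u p h hab hν t ht hJpos R hR
  have h1 := hlad h hab hν ht hR
  have hut : Torus.IsSmooth (u t) := h.smooth_velocity.isSmooth_slice ht
  have hint := integral_pow_succ_rpow_le_interpolation hm hut
  set Jm : ℝ := ∫ x, torusVorticitySqAt (u t) x ^ m with hJm
  set Jp : ℝ := ∫ x, torusVorticitySqAt (u t) x ^ (m + 1) with hJp
  set J3 : ℝ := (∫ x, torusVorticitySqAt (u t) x ^ (3 * m)) ^ ((1 : ℝ) / 3) with hJ3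
  have hden : 0 < Jm ^ ((2 * (m : ℝ) - 1) / 3) := Real.rpow_pos_of_pos hJpos _
  have h2 : Jp ^ (2 * (m : ℝ) / 3) / Jm ^ ((2 * (m : ℝ) - 1) / 3) ≤ J3 := by
    rw [div_le_iff₀ hden]
    calc Jp ^ (2 * (m : ℝ) / 3) ≤ Jm ^ ((2 * (m : ℝ) - 1) / 3) * J3 := hint
      _ = J3 * Jm ^ ((2 * (m : ℝ) - 1) / 3) := mul_comm _ _
  have h3 : ν * c₁ * (Jp ^ (2 * (m : ℝ) / 3) / Jm ^ ((2 * (m : ℝ) - 1) / 3)) ≤ ν * c₁ * J3 :=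
    mul_le_mul_of_nonneg_left h2 (mul_nonneg hν hc₁.le)
  linarith

/-! ### §5 Gibbon's scaled frequencies `Ωₘ`, exponents `αₘ`, and `Dₘ` (Gibbon 2012, §1.2) -/

section Defs

variable {d : Type*} [Fintype d] [DecidableEq d]

/-- **Gibbon's vorticity frequencies `Ωₘ`, regularised** (Gibbon 2012, §1.2 (1.2):
"`Ωₘ(t) = (L⁻³∫|ω|^{2m} dV)^{1/2m} + ϖ₀`, … The additive frequency `ϖ₀ = νL⁻²` is present for
technical reasons"; the PROOF of Theorem 2 (§5, (5.16)) uses instead the power-mean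
regularisation `Ω_{m+1} = (L⁻³J_{m+1} + ϖ₀^{2(m+1)})^{1/2(m+1)}`, under which its step
(5.17)→(5.18) is valid — this is the convention typed here; the two agree up to a factor `2`:
`(J + ϖ₀^{2m})^{1/2m} ≤ J^{1/2m} + ϖ₀ ≤ 2(J + ϖ₀^{2m})^{1/2m}`). On the unit torus `𝕋^d`
(`L = 1`, `ϖ₀ = ν`): `Ωₘ(v) := (∫ |ω|^{2m} + ν^{2m})^{1/(2m)}`, `|ω|² = torusVorticitySqAt v`.
[cite: Gibbon2012JMP, §1.2 eq. (1.2) and §5 eq. (5.16)] -/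
def gibbonOmega (ν : ℝ) (m : ℕ) (v : UnitAddTorus d → EuclideanSpace ℝ d) : ℝ :=
  ((∫ x, torusVorticitySqAt v x ^ m) + ν ^ (2 * m)) ^ ((1 : ℝ) / (2 * m))

omit [Fintype d] [DecidableEq d] in
/-- **Gibbon's scaling exponents `αₘ = 2m/(4m−3)`** (Gibbon 2012, §1.2 (1.3): under the
Navier–Stokes scaling `Ωₘ^{αₘ}` rescales like a frequency; `α₁ = 2`, `α_∞ = 1/2`).
[cite: Gibbon2012JMP, §1.2 eq. (1.3)] -/
def gibbonAlpha (m : ℕ) : ℝ := 2 * m / (4 * m - 3)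

/-- **Gibbon's dimensionless moments `Dₘ = (ϖ₀⁻¹Ωₘ)^{αₘ}`** (Gibbon 2012, §1.2 (1.4)); on the
unit torus `ϖ₀ = ν`, so `Dₘ(v) = (Ωₘ(v)/ν)^{αₘ}` (`D₁` "is the square of the `H₁`-norm" up to the
regularisation). [cite: Gibbon2012JMP, §1.2 eq. (1.4)] -/
def gibbonD (ν : ℝ) (m : ℕ) (v : UnitAddTorus d → EuclideanSpace ℝ d) : ℝ :=
  (gibbonOmega ν m v / ν) ^ gibbonAlpha m

end Defs

namespace VorticityMomentLadder

variable {d : Type*} [Fintype d] [DecidableEq d]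

/-! #### Elementary properties of `Ωₘ`, `αₘ`, `Dₘ` -/

/-- `∫|ω|^{2m} ≥ 0`. [folklore] -/
private theorem integral_pow_nonneg (v : UnitAddTorus d → EuclideanSpace ℝ d) (n : ℕ) :
    0 ≤ ∫ x, torusVorticitySqAt v x ^ n :=
  integral_nonneg fun x => pow_nonneg (torusVorticitySqAt_nonneg v x) _

/-- `Ωₘ^{2m} = Jₘ + ν^{2m}` (`m ≥ 1`, `ν ≥ 0`): the defining relation of the regularised
frequency. [cite: Gibbon2012JMP, §5 eq. (5.16)] -/
theorem gibbonOmega_pow {ν : ℝ} (hν : 0 ≤ ν) {m : ℕ} (hm : 1 ≤ m)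
    (v : UnitAddTorus d → EuclideanSpace ℝ d) :
    gibbonOmega ν m v ^ (2 * m) = (∫ x, torusVorticitySqAt v x ^ m) + ν ^ (2 * m) := by
  have h0 : 0 ≤ (∫ x, torusVorticitySqAt v x ^ m) + ν ^ (2 * m) :=
    add_nonneg (integral_pow_nonneg v m) (pow_nonneg hν _)
  unfold gibbonOmega
  rw [← Real.rpow_natCast, ← Real.rpow_mul h0]
  have : (1 : ℝ) / (2 * m) * ((2 * m : ℕ) : ℝ) = 1 := by
    have hm0 : (0 : ℝ) < m := by exact_mod_cast hm
    push_cast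
    field_simp
  rw [this, Real.rpow_one]

/-- `Ωₘ ≥ ν > 0`: "Clearly the `Ωₘ(t)` are ordered … `ϖ₀ ≤ Ω₁(t) ≤ …`" (Gibbon 2012, (1.2)–(1.3);
here only the lower bound by the regularising frequency is needed). [cite: Gibbon2012JMP, §1.2 after eq. (1.2)] -/
theorem le_gibbonOmega {ν : ℝ} (hν : 0 < ν) {m : ℕ} (hm : 1 ≤ m)
    (v : UnitAddTorus d → EuclideanSpace ℝ d) : ν ≤ gibbonOmega ν m v := by
  have hJ := integral_pow_nonneg v m
  have hΩ0 : 0 ≤ gibbonOmega ν m v := by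
    unfold gibbonOmega
    exact Real.rpow_nonneg (add_nonneg hJ (pow_nonneg hν.le _)) _
  have h : ν ^ (2 * m) ≤ gibbonOmega ν m v ^ (2 * m) := by
    rw [gibbonOmega_pow hν.le hm]
    exact le_add_of_nonneg_left hJ
  exact (pow_le_pow_iff_left₀ hν.le hΩ0 (by omega : 2 * m ≠ 0)).1 h

/-- `Ωₘ > 0` for `ν > 0`. [cite: Gibbon2012JMP, §1.2 after eq. (1.2)] -/
theorem gibbonOmega_pos {ν : ℝ} (hν : 0 < ν) {m : ℕ} (hm : 1 ≤ m)
    (v : UnitAddTorus d → EuclideanSpace ℝ d) : 0 < gibbonOmega ν m v :=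
  hν.trans_le (le_gibbonOmega hν hm v)

/-- `Jₘ ≤ Ωₘ^{2m}`. [cite: Gibbon2012JMP, §5 eq. (5.16)] -/
theorem integral_pow_le_gibbonOmega_pow {ν : ℝ} (hν : 0 ≤ ν) {m : ℕ} (hm : 1 ≤ m)
    (v : UnitAddTorus d → EuclideanSpace ℝ d) :
    ∫ x, torusVorticitySqAt v x ^ m ≤ gibbonOmega ν m v ^ (2 * m) := by
  rw [gibbonOmega_pow hν hm]
  exact le_add_of_nonneg_right (pow_nonneg hν _)

/-- `√Jₘ ≤ Ωₘᵐ`. [cite: Gibbon2012JMP, §5 eq. (5.16)] -/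
theorem sqrt_integral_pow_le_gibbonOmega_pow {ν : ℝ} (hν : 0 < ν) {m : ℕ} (hm : 1 ≤ m)
    (v : UnitAddTorus d → EuclideanSpace ℝ d) :
    Real.sqrt (∫ x, torusVorticitySqAt v x ^ m) ≤ gibbonOmega ν m v ^ m := by
  rw [Real.sqrt_le_left (pow_nonneg (gibbonOmega_pos hν hm v).le _), ← pow_mul,
    mul_comm]
  exact integral_pow_le_gibbonOmega_pow hν.le hm v

omit [Fintype d] [DecidableEq d] in
/-- `αₘ > 0` for `m ≥ 1`. [cite: Gibbon2012JMP, §1.2 eq. (1.3)] -/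
theorem gibbonAlpha_pos {m : ℕ} (hm : 1 ≤ m) : 0 < gibbonAlpha m := by
  unfold gibbonAlpha
  have : (1 : ℝ) ≤ m := by exact_mod_cast hm
  exact div_pos (by positivity) (by linarith)

/-- `Dₘ ≥ 1` (`Ωₘ ≥ ϖ₀`). [cite: Gibbon2012JMP, §1.2 eqs. (1.2)–(1.4)] -/
theorem one_le_gibbonD {ν : ℝ} (hν : 0 < ν) {m : ℕ} (hm : 1 ≤ m)
    (v : UnitAddTorus d → EuclideanSpace ℝ d) : 1 ≤ gibbonD ν m v := by
  unfold gibbonD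
  exact Real.one_le_rpow ((one_le_div hν).2 (le_gibbonOmega hν hm v)) (gibbonAlpha_pos hm).le

/-- `Dₘ > 0`. [cite: Gibbon2012JMP, §1.2 eq. (1.4)] -/
theorem gibbonD_pos {ν : ℝ} (hν : 0 < ν) {m : ℕ} (hm : 1 ≤ m)
    (v : UnitAddTorus d → EuclideanSpace ℝ d) : 0 < gibbonD ν m v :=
  zero_lt_one.trans_le (one_le_gibbonD hν hm v)

/-- `Dₘ² = (Ωₘ/ν)^{2αₘ}`. [cite: Gibbon2012JMP, §1.2 eq. (1.4)] -/
theorem gibbonD_sq {ν : ℝ} (hν : 0 < ν) {m : ℕ} (hm : 1 ≤ m)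
    (v : UnitAddTorus d → EuclideanSpace ℝ d) :
    gibbonD ν m v ^ 2 = (gibbonOmega ν m v / ν) ^ (2 * gibbonAlpha m) := by
  unfold gibbonD
  rw [← Real.rpow_natCast, ← Real.rpow_mul (div_pos (gibbonOmega_pos hν hm v) hν).le, mul_comm]
  norm_num

end VorticityMomentLadder

section Rho

/-- **Gibbon's ladder exponents `ρₘ = ⅔ m(4m+1)`** (Gibbon 2012, Thm 2; `ρₘ = βₘ/α_{m+1}` with
`βₘ = (4/3)m(m+1)`, §5 (5.14), (5.20)). [cite: Gibbon2012JMP, Thm 2 and §5 eqs. (5.14), (5.20)] -/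
def gibbonRho (m : ℕ) : ℝ := 2 * m * (4 * m + 1) / 3

end Rho

namespace VorticityMomentLadder

variable {d : Type*} [Fintype d] [DecidableEq d]

omit [Fintype d] [DecidableEq d] in
/-- `(x + y)ᵖ ≤ 2ᵖ (xᵖ + yᵖ)` for `x, y, p ≥ 0`. [folklore] -/
private theorem add_rpow_le_two_rpow_mul {x y p : ℝ} (hx : 0 ≤ x) (hy : 0 ≤ y) (hp : 0 ≤ p) :
    (x + y) ^ p ≤ (2 : ℝ) ^ p * (x ^ p + y ^ p) := by
  have h1 : x + y ≤ 2 * max x y := by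
    rcases le_total x y with h | h
    · rw [max_eq_right h]; linarith
    · rw [max_eq_left h]; linarith
  have h2 : (x + y) ^ p ≤ (2 * max x y) ^ p := Real.rpow_le_rpow (add_nonneg hx hy) h1 hp
  have h3 : (max x y) ^ p ≤ x ^ p + y ^ p := by
    rcases le_total x y with h | h
    · rw [max_eq_right h]; linarith [Real.rpow_nonneg hx p]
    · rw [max_eq_left h]; linarith [Real.rpow_nonneg hy p]
  calc (x + y) ^ p ≤ (2 * max x y) ^ p := h2
    _ = (2 : ℝ) ^ p * (max x y) ^ p := Real.mul_rpow (by norm_num) (le_max_of_le_left hx)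
    _ ≤ (2 : ℝ) ^ p * (x ^ p + y ^ p) :=
        mul_le_mul_of_nonneg_left h3 (Real.rpow_nonneg (by norm_num) _)

/-! #### The one-sided derivatives of `Ωₘ` and `Dₘ` along a solution -/

/-- **Chain rule for `Ωₘ`**: along a classical solution on `𝕋^d × [a, b]` (`ν > 0`, `m ≥ 1`),
if `Jₘ = ∫|ω|^{2m}` has one-sided derivative `R` within `[a, b]` at `t`, then
`Ωₘ = (Jₘ + ν^{2m})^{1/2m}` has one-sided derivative `(1/2m) Ωₘ^{1−2m} R` there
(`2m Ωₘ^{2m−1} Ω̇ₘ = J̇ₘ`, Gibbon 2012 §5 / Gibbon 2013 (2.2) "`2mL³Ωₘ^{2m−1}Ω̇ₘ = d/dt ∫|ω|^{2m}`").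
[cite: Gibbon2013IUTAM, §2 eq. (2.2)] -/
theorem hasDerivWithinAt_gibbonOmega {ν : ℝ} (hν : 0 < ν) {m : ℕ} (hm : 1 ≤ m)
    {a b : ℝ} {u : ℝ → UnitAddTorus d → EuclideanSpace ℝ d} {t : ℝ} {R : ℝ}
    (hR : HasDerivWithinAt (fun s => ∫ x, torusVorticitySqAt (u s) x ^ m) R (Icc a b) t) :
    HasDerivWithinAt (fun s => gibbonOmega ν m (u s))
      ((1 : ℝ) / (2 * m) * gibbonOmega ν m (u t) ^ ((1 : ℝ) - 2 * m) * R) (Icc a b) t := by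
  have hm0 : (0 : ℝ) < m := by exact_mod_cast hm
  have hJ0 : ∀ s, 0 ≤ ∫ x, torusVorticitySqAt (u s) x ^ m := fun s => integral_pow_nonneg (u s) m
  have hpos : 0 < (∫ x, torusVorticitySqAt (u t) x ^ m) + ν ^ (2 * m) :=
    add_pos_of_nonneg_of_pos (hJ0 t) (pow_pos hν _)
  have h1 : HasDerivWithinAt (fun s => (∫ x, torusVorticitySqAt (u s) x ^ m) + ν ^ (2 * m)) R
      (Icc a b) t := hR.add_const _
  have h2 := h1.rpow_const (p := (1 : ℝ) / (2 * m)) (Or.inl hpos.ne')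
  have e : ((∫ x, torusVorticitySqAt (u t) x ^ m) + ν ^ (2 * m)) ^ ((1 : ℝ) / (2 * m) - 1) =
      gibbonOmega ν m (u t) ^ ((1 : ℝ) - 2 * m) := by
    unfold gibbonOmega
    rw [← Real.rpow_mul hpos.le]
    congr 1
    field_simp
  refine (h2.congr_deriv ?_)
  rw [e]
  unfold gibbonOmega
  ring

/-- **Chain rule for `Dₘ`**: with `Dₘ = (Ωₘ/ν)^{αₘ}`, if `Ωₘ` has one-sided derivative `R` within
`[a, b]` at `t` then `Dₘ` has one-sided derivative `αₘ Dₘ R / Ωₘ` ("`Ḋₘ = αₘ Dₘ Ω̇ₘ/Ωₘ`", the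
conversion (5.18)→(5.20) of Gibbon 2012). [cite: Gibbon2012JMP, §5 eqs. (5.18)–(5.20)] -/
theorem hasDerivWithinAt_gibbonD {ν : ℝ} (hν : 0 < ν) {m : ℕ} (hm : 1 ≤ m)
    {a b : ℝ} {u : ℝ → UnitAddTorus d → EuclideanSpace ℝ d} {t : ℝ} {R : ℝ}
    (hR : HasDerivWithinAt (fun s => gibbonOmega ν m (u s)) R (Icc a b) t) :
    HasDerivWithinAt (fun s => gibbonD ν m (u s))
      (gibbonAlpha m * gibbonD ν m (u t) / gibbonOmega ν m (u t) * R) (Icc a b) t := by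
  have hΩ := gibbonOmega_pos hν hm (u t)
  have hq : 0 < gibbonOmega ν m (u t) / ν := div_pos hΩ hν
  have h1 : HasDerivWithinAt (fun s => gibbonOmega ν m (u s) / ν) (R / ν) (Icc a b) t :=
    hR.div_const ν
  have h2 := h1.rpow_const (p := gibbonAlpha m) (Or.inl hq.ne')
  refine h2.congr_deriv ?_
  unfold gibbonD
  rw [Real.rpow_sub_one hq.ne']
  field_simp

end VorticityMomentLadder

/-! ### §6 The ladder in Gibbon's variables: `Ω̇ₘ` (5.17)–(5.18) and THEOREM 2 (5.20) -/

open VorticityMomentLadder in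
/-- **The `Ωₘ` ladder (Gibbon 2012, §5 (5.17)–(5.18))**: "Converting the `Jₘ` into `Ωₘ` and
using the fact that `Ωₘ ≥ ϖ₀`,
`Ω̇ₘ ≤ Ωₘ{−(ϖ₀/c_{4,m})(Ω_{m+1}/Ωₘ)^{4m(m+1)/3} + c_{5,m}(Ω_{m+1}/Ωₘ)^{m+1}Ωₘ + c_{6,m}ϖ₀}` (5.17);
using a Hölder [Young] inequality on the central term …
`Ω̇ₘ ≤ ϖ₀Ωₘ{−(1/c_{1,m})(Ω_{m+1}/Ωₘ)^{βₘ} + c_{2,m}(ϖ₀⁻¹Ωₘ)^{2αₘ} + c_{3,m}}` (5.18)",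
`βₘ = (4/3)m(m+1)`. Typed on the unit torus (`ϖ₀ = ν > 0`) for classical solutions of the
unforced system and natural `m ≥ 1`: there are `k₁ > 0`, `k₂, k₃ ≥ 0` (depending only on `m`)
such that every one-sided derivative value `R` of `s ↦ Ωₘ(u(s))` within `[a, b]` at `t` obeys
`R ≤ ν Ωₘ (−k₁ (Ω_{m+1}/Ωₘ)^{βₘ} + k₂ (Ωₘ/ν)^{2αₘ} + k₃)`. Proof: `exists_vorticityMoment_ladder`
through `2mΩₘ^{2m−1}Ω̇ₘ = J̇ₘ` (`hasDerivWithinAt_gibbonOmega`), the interpolation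
`integral_pow_succ_rpow_le_interpolation` written in the regularised variables
(`Ω_{m+1}^{βₘ} ≤ 2^{2m/3} Ωₘ^{2m(2m−1)/3}((∫|ω|^{6m})^{1/3} + ν^{2m})`), `Jₘ ≤ Ωₘ^{2m}`, `ν ≤ Ωₘ`,
and Young's inequality with exponents `(4m/3, 4m/(4m−3))`.
[cite: Gibbon2012JMP, §5 eqs. (5.17)–(5.18)] -/
theorem exists_gibbonOmega_ladder (m : ℕ) (hm : 1 ≤ m) :
    ∃ k₁ k₂ k₃ : ℝ, 0 < k₁ ∧ 0 ≤ k₂ ∧ 0 ≤ k₃ ∧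
      ∀ {a b ν : ℝ} {u : ℝ → UnitAddTorus (Fin 3) → EuclideanSpace ℝ (Fin 3)}
        {p : ℝ → UnitAddTorus (Fin 3) → ℝ},
        Torus.IsClassicalNSSolutionOn (Icc a b) ν 0 u p → a < b → 0 < ν →
        ∀ {t : ℝ}, t ∈ Icc a b → ∀ {R : ℝ},
          HasDerivWithinAt (fun s => gibbonOmega ν m (u s)) R (Icc a b) t →
          R ≤ ν * gibbonOmega ν m (u t) *
            (-(k₁ * (gibbonOmega ν (m + 1) (u t) / gibbonOmega ν m (u t)) ^
                (4 * (m : ℝ) * (m + 1) / 3)) +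
              k₂ * (gibbonOmega ν m (u t) / ν) ^ (2 * gibbonAlpha m) + k₃) := by
  obtain ⟨c₁, c₂, c₃, hc₁, hc₂, hc₃, hlad⟩ := exists_vorticityMoment_ladder m hm
  have hm0 : (0 : ℝ) < m := by exact_mod_cast hm
  have hm1 : (1 : ℝ) ≤ m := by exact_mod_cast hm
  -- exponents
  set pe : ℝ := 2 * (m : ℝ) / 3 with hpe
  set qe : ℝ := (2 * (m : ℝ) - 1) / 3 with hqe
  set β : ℝ := 4 * (m : ℝ) * (m + 1) / 3 with hβ
  set θ : ℝ := 3 / (4 * (m : ℝ)) with hθ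
  set P : ℝ := 4 * (m : ℝ) / 3 with hP
  set Q : ℝ := 4 * (m : ℝ) / (4 * m - 3) with hQ
  have hpe0 : 0 ≤ pe := by positivity
  have hqe0 : 0 ≤ qe := by rw [hqe]; linarith
  have hβ0 : 0 < β := by positivity
  have hθ0 : 0 < θ := by positivity
  have h4m3 : (0 : ℝ) < 4 * m - 3 := by linarith
  have hP0 : 0 < P := by positivity
  have hQ0 : 0 < Q := by positivity
  have hPQ : P.HolderConjugate Q :=
    { inv_add_inv_eq_inv := by
        rw [hP, hQ, inv_one, inv_div, inv_div, ← add_div]; field_simp; ring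
      left_pos := hP0
      right_pos := hQ0 }
  have hθP : θ * P = 1 := by rw [hθ, hP]; field_simp
  have hθQ : θ * Q = Q - 1 := by rw [hθ, hQ]; field_simp; ring
  have hQα : Q = 2 * gibbonAlpha m := by rw [hQ, gibbonAlpha]; ring
  have hβθ : β * θ = (m : ℝ) + 1 := by rw [hβ, hθ]; field_simp
  -- constants
  set k₁' : ℝ := c₁ * (2 : ℝ) ^ (-pe) / (2 * m) with hk₁'
  set k₅ : ℝ := c₃ / (2 * m) with hk₅
  set k₆ : ℝ := (c₁ + c₂) / (2 * m) with hk₆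
  have hk₁'0 : 0 < k₁' := by positivity
  have hk₅0 : 0 ≤ k₅ := by positivity
  have hk₆0 : 0 ≤ k₆ := by positivity
  set k₂ : ℝ := k₅ ^ Q * (P * k₁' / 2) ^ (-(Q - 1)) / Q with hk₂
  have hk₂0 : 0 ≤ k₂ := by positivity
  refine ⟨k₁' / 2, k₂, k₆, by positivity, hk₂0, hk₆0, ?_⟩
  intro a b ν u p h hab hν t ht R hR
  -- Young's inequality in the form used for the central term of (5.17)
  have young : ∀ {Y Ω : ℝ}, 0 ≤ Y → 0 < Ω →
      k₅ * Y ^ θ * Ω ≤ ν * k₁' / 2 * Y + k₂ * (ν * (Ω / ν) ^ Q) := by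
    intro Y Ω hY hΩ
    set x : ℝ := P * ν * k₁' / 2 with hx
    have hx0 : 0 < x := by positivity
    set a' : ℝ := x ^ θ * Y ^ θ with ha'
    set b' : ℝ := k₅ * Ω * x ^ (-θ) with hb'
    have ha'0 : 0 ≤ a' := by positivity
    have hb'0 : 0 ≤ b' := by positivity
    have hY' := Real.young_inequality_of_nonneg ha'0 hb'0 hPQ
    have eab : a' * b' = k₅ * Y ^ θ * Ω := by
      rw [ha', hb', Real.rpow_neg hx0.le]
      field_simp
    have eaP : a' ^ P / P = ν * k₁' / 2 * Y := by
      rw [ha', Real.mul_rpow (Real.rpow_nonneg hx0.le _) (Real.rpow_nonneg hY _),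
        ← Real.rpow_mul hx0.le, ← Real.rpow_mul hY, hθP, Real.rpow_one, Real.rpow_one, hx]
      field_simp
    have ebQ : b' ^ Q / Q = k₂ * (ν * (Ω / ν) ^ Q) := by
      rw [hb', Real.mul_rpow (mul_nonneg hk₅0 hΩ.le) (Real.rpow_nonneg hx0.le _),
        Real.mul_rpow hk₅0 hΩ.le, ← Real.rpow_mul hx0.le, neg_mul, hθQ, hk₂, hx,
        Real.div_rpow hΩ.le hν.le]
      have hνQ : ν ^ Q = ν * ν ^ (Q - 1) := by
        rw [Real.rpow_sub_one hν.ne']; field_simp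
      have e1 : (P * ν * k₁' / 2) ^ (-(Q - 1)) = (P * k₁' / 2) ^ (-(Q - 1)) * ν ^ (-(Q - 1)) := by
        rw [show P * ν * k₁' / 2 = (P * k₁' / 2) * ν by ring,
          Real.mul_rpow (by positivity) hν.le]
      rw [e1, hνQ, Real.rpow_neg hν.le (Q - 1)]
      have hνQ1 : 0 < ν ^ (Q - 1) := Real.rpow_pos_of_pos hν _
      field_simp
    rw [eab, eaP, ebQ] at hY'
    exact hY'
  -- the objects at time `t`
  have hut : Torus.IsSmooth (u t) := h.smooth_velocity.isSmooth_slice ht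
  set Ω : ℝ := gibbonOmega ν m (u t) with hΩdef
  set Ωp : ℝ := gibbonOmega ν (m + 1) (u t) with hΩpdef
  set J : ℝ := ∫ x, torusVorticitySqAt (u t) x ^ m with hJdef
  set Jp : ℝ := ∫ x, torusVorticitySqAt (u t) x ^ (m + 1) with hJpdef
  set J3 : ℝ := (∫ x, torusVorticitySqAt (u t) x ^ (3 * m)) ^ ((1 : ℝ) / 3) with hJ3def
  have hΩ : 0 < Ω := gibbonOmega_pos hν hm (u t)
  have hΩp : 0 < Ωp := gibbonOmega_pos hν (by omega) (u t)
  have hνΩ : ν ≤ Ω := le_gibbonOmega hν hm (u t)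
  have hJ0 : 0 ≤ J := integral_pow_nonneg (u t) m
  have hJp0 : 0 ≤ Jp := integral_pow_nonneg (u t) (m + 1)
  have hJ30 : 0 ≤ J3 := Real.rpow_nonneg (integral_pow_nonneg (u t) (3 * m)) _
  have hJΩ : J ≤ Ω ^ (2 * m) := integral_pow_le_gibbonOmega_pow hν.le hm (u t)
  have hΩppow : Ωp ^ (2 * (m + 1)) = Jp + ν ^ (2 * (m + 1)) := gibbonOmega_pow hν.le (by omega) (u t)
  -- the `J`-derivative and the chain rule
  have hD := h.hasDerivWithinAt_integral_torusVorticitySqAt_pow hab m ht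
  set V : ℝ := (2 * m * (∫ x, torusVorticitySqAt (u t) x ^ (m - 1) * torusStretchingDensity (u t) x) -
        ν * (m * (∫ x, torusVorticitySqAt (u t) x ^ (m - 1) * ∑ k, ∑ i, ∑ j,
              Torus.partialDeriv k (torusVorticityTensor (u t) i j) x ^ 2) +
            m * (m - 1) * ∫ x, torusVorticitySqAt (u t) x ^ (m - 2) *
              ∑ k, Torus.partialDeriv k (torusVorticitySqAt (u t)) x ^ 2) +
        m * ∫ x, torusVorticitySqAt (u t) x ^ (m - 1) * ∑ i, ∑ j, torusVorticityTensor (u t) i j x *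
          (Torus.partialDeriv i ((0 : ℝ → UnitAddTorus (Fin 3) → EuclideanSpace ℝ (Fin 3)) t) x j -
            Torus.partialDeriv j ((0 : ℝ → UnitAddTorus (Fin 3) → EuclideanSpace ℝ (Fin 3)) t) x i))
    with hVdef
  have hVlad : V ≤ -(ν * c₁ * J3) + ν * c₂ * J + c₃ * Real.sqrt J * Real.sqrt Jp :=
    hlad h hab hν.le ht hD
  have hΩ' := hasDerivWithinAt_gibbonOmega hν hm hD
  have hU : UniqueDiffWithinAt ℝ (Icc a b) t := uniqueDiffOn_Icc hab t ht
  have hReq : R = 1 / (2 * m) * Ω ^ ((1 : ℝ) - 2 * m) * V :=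
    (hR.derivWithin hU).symm.trans (hΩ'.derivWithin hU)
  set cf : ℝ := 1 / (2 * m) * Ω ^ ((1 : ℝ) - 2 * m) with hcfdef
  have hcf0 : 0 < cf := by positivity
  -- `Ω^{1-2m} Ω^{2m} = Ω`, `Ω^{1-2m} Ω^m = Ω^{1-m}`
  have eΩ1 : Ω ^ ((1 : ℝ) - 2 * m) * Ω ^ (2 * m) = Ω := by
    rw [← Real.rpow_natCast Ω (2 * m), ← Real.rpow_add hΩ]
    push_cast
    simp
  have eΩ2 : Ω ^ ((1 : ℝ) - 2 * m) * Ω ^ m = Ω ^ ((1 : ℝ) - m) := by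
    rw [← Real.rpow_natCast Ω m, ← Real.rpow_add hΩ]
    congr 1
    ring
  -- Step A: `Ωp^β ≤ 2^pe Ω^{2m qe} (J3 + ν^{2m})`
  have hA : Ωp ^ β ≤ (2 : ℝ) ^ pe * Ω ^ (2 * (m : ℝ) * qe) * (J3 + ν ^ (2 * m)) := by
    have e1 : Ωp ^ β = (Jp + ν ^ (2 * (m + 1))) ^ pe := by
      rw [← hΩppow, pow_rpow_eq_rpow_mul hΩp.le]
      congr 1
      rw [hβ, hpe]; push_cast; ring
    have h2 : (Jp + ν ^ (2 * (m + 1))) ^ pe ≤ (2 : ℝ) ^ pe * (Jp ^ pe + (ν ^ (2 * (m + 1))) ^ pe) :=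
      add_rpow_le_two_rpow_mul hJp0 (pow_nonneg hν.le _) hpe0
    have h3 : Jp ^ pe ≤ Ω ^ (2 * (m : ℝ) * qe) * J3 := by
      have hint := integral_pow_succ_rpow_le_interpolation hm hut
      have e2 : (2 * (m : ℝ) - 1) / 3 = qe := by rw [hqe]
      have e3 : 2 * (m : ℝ) / 3 = pe := by rw [hpe]
      rw [e2, e3] at hint
      have h4 : J ^ qe ≤ Ω ^ (2 * (m : ℝ) * qe) := by
        calc J ^ qe ≤ (Ω ^ (2 * m)) ^ qe := Real.rpow_le_rpow hJ0 hJΩ hqe0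
          _ = Ω ^ (2 * (m : ℝ) * qe) := by
              rw [pow_rpow_eq_rpow_mul hΩ.le]; push_cast; ring_nf
      calc Jp ^ pe ≤ J ^ qe * J3 := hint
        _ ≤ Ω ^ (2 * (m : ℝ) * qe) * J3 := mul_le_mul_of_nonneg_right h4 hJ30
    have h5 : (ν ^ (2 * (m + 1))) ^ pe ≤ Ω ^ (2 * (m : ℝ) * qe) * ν ^ (2 * m) := by
      have e4 : (ν ^ (2 * (m + 1))) ^ pe = ν ^ (2 * (m : ℝ) * qe) * ν ^ (2 * m) := by
        rw [pow_rpow_eq_rpow_mul hν.le, ← Real.rpow_natCast ν (2 * m), ← Real.rpow_add hν]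
        congr 1
        rw [hpe, hqe]; push_cast; ring
      rw [e4]
      exact mul_le_mul_of_nonneg_right (Real.rpow_le_rpow hν.le hνΩ (by positivity))
        (pow_nonneg hν.le _)
    calc Ωp ^ β = (Jp + ν ^ (2 * (m + 1))) ^ pe := e1
      _ ≤ (2 : ℝ) ^ pe * (Jp ^ pe + (ν ^ (2 * (m + 1))) ^ pe) := h2
      _ ≤ (2 : ℝ) ^ pe * (Ω ^ (2 * (m : ℝ) * qe) * J3 + Ω ^ (2 * (m : ℝ) * qe) * ν ^ (2 * m)) := by
          gcongr
      _ = (2 : ℝ) ^ pe * Ω ^ (2 * (m : ℝ) * qe) * (J3 + ν ^ (2 * m)) := by ring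
  -- Step B: the dissipative term
  have hB : cf * -(ν * c₁ * J3) ≤ -(ν * k₁' * (Ωp ^ β * Ω ^ (1 - β))) + ν * (c₁ / (2 * m)) * Ω := by
    -- `2^{-pe} Ωp^β Ω^{1-β} ≤ Ω^{1-2m} (J3 + ν^{2m})`
    have e5 : Ω ^ (2 * (m : ℝ) * qe) * Ω ^ (1 - β) = Ω ^ ((1 : ℝ) - 2 * m) := by
      rw [← Real.rpow_add hΩ]
      congr 1
      rw [hqe, hβ]; ring
    have h6 : (2 : ℝ) ^ (-pe) * (Ωp ^ β * Ω ^ (1 - β)) ≤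
        Ω ^ ((1 : ℝ) - 2 * m) * (J3 + ν ^ (2 * m)) := by
      have h7 := mul_le_mul_of_nonneg_right hA (Real.rpow_nonneg hΩ.le (1 - β))
      have h8 : (2 : ℝ) ^ (-pe) * ((2 : ℝ) ^ pe * Ω ^ (2 * (m : ℝ) * qe) * (J3 + ν ^ (2 * m)) *
          Ω ^ (1 - β)) = Ω ^ ((1 : ℝ) - 2 * m) * (J3 + ν ^ (2 * m)) := by
        rw [← e5, Real.rpow_neg (by norm_num : (0 : ℝ) ≤ 2)]
        have : (2 : ℝ) ^ pe ≠ 0 := (Real.rpow_pos_of_pos (by norm_num) _).ne'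
        field_simp
      calc (2 : ℝ) ^ (-pe) * (Ωp ^ β * Ω ^ (1 - β))
          = (2 : ℝ) ^ (-pe) * (Ωp ^ β * Ω ^ (1 - β)) := rfl
        _ ≤ (2 : ℝ) ^ (-pe) * ((2 : ℝ) ^ pe * Ω ^ (2 * (m : ℝ) * qe) * (J3 + ν ^ (2 * m)) *
              Ω ^ (1 - β)) :=
            mul_le_mul_of_nonneg_left h7 (Real.rpow_nonneg (by norm_num) _)
        _ = Ω ^ ((1 : ℝ) - 2 * m) * (J3 + ν ^ (2 * m)) := h8
    -- `Ω^{1-2m} ν^{2m} ≤ Ω`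
    have h9 : Ω ^ ((1 : ℝ) - 2 * m) * ν ^ (2 * m) ≤ Ω := by
      calc Ω ^ ((1 : ℝ) - 2 * m) * ν ^ (2 * m) ≤ Ω ^ ((1 : ℝ) - 2 * m) * Ω ^ (2 * m) :=
            mul_le_mul_of_nonneg_left (pow_le_pow_left₀ hν.le hνΩ _) (Real.rpow_nonneg hΩ.le _)
        _ = Ω := eΩ1
    have h10 : ν * k₁' * (Ωp ^ β * Ω ^ (1 - β)) =
        ν * (c₁ / (2 * m)) * ((2 : ℝ) ^ (-pe) * (Ωp ^ β * Ω ^ (1 - β))) := by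
      rw [hk₁']; ring
    rw [h10, hcfdef]
    have h11 : ν * (c₁ / (2 * m)) * ((2 : ℝ) ^ (-pe) * (Ωp ^ β * Ω ^ (1 - β))) ≤
        ν * (c₁ / (2 * m)) * (Ω ^ ((1 : ℝ) - 2 * m) * (J3 + ν ^ (2 * m))) :=
      mul_le_mul_of_nonneg_left h6 (by positivity)
    have h12 : ν * (c₁ / (2 * m)) * (Ω ^ ((1 : ℝ) - 2 * m) * ν ^ (2 * m)) ≤
        ν * (c₁ / (2 * m)) * Ω := mul_le_mul_of_nonneg_left h9 (by positivity)
    have e13 : ν * (c₁ / (2 * m)) * (Ω ^ ((1 : ℝ) - 2 * m) * (J3 + ν ^ (2 * m))) =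
        -(1 / (2 * m) * Ω ^ ((1 : ℝ) - 2 * m) * -(ν * c₁ * J3)) +
          ν * (c₁ / (2 * m)) * (Ω ^ ((1 : ℝ) - 2 * m) * ν ^ (2 * m)) := by ring
    rw [e13] at h11
    linarith
  -- Step C: the `c₂` term
  have hC : cf * (ν * c₂ * J) ≤ ν * (c₂ / (2 * m)) * Ω := by
    rw [hcfdef]
    have : Ω ^ ((1 : ℝ) - 2 * m) * J ≤ Ω := by
      calc Ω ^ ((1 : ℝ) - 2 * m) * J ≤ Ω ^ ((1 : ℝ) - 2 * m) * Ω ^ (2 * m) :=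
            mul_le_mul_of_nonneg_left hJΩ (Real.rpow_nonneg hΩ.le _)
        _ = Ω := eΩ1
    have h' := mul_le_mul_of_nonneg_left this (by positivity : 0 ≤ ν * c₂ / (2 * m))
    calc 1 / (2 * m) * Ω ^ ((1 : ℝ) - 2 * m) * (ν * c₂ * J)
        = ν * c₂ / (2 * m) * (Ω ^ ((1 : ℝ) - 2 * m) * J) := by ring
      _ ≤ ν * c₂ / (2 * m) * Ω := h'
      _ = ν * (c₂ / (2 * m)) * Ω := by ring
  -- Step D: the stretching term
  have hDst : cf * (c₃ * Real.sqrt J * Real.sqrt Jp) ≤ k₅ * (Ωp ^ ((m : ℝ) + 1) * Ω ^ ((1 : ℝ) - m)) := by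
    have h1 : Real.sqrt J ≤ Ω ^ m := sqrt_integral_pow_le_gibbonOmega_pow hν hm (u t)
    have h2 : Real.sqrt Jp ≤ Ωp ^ (m + 1) := sqrt_integral_pow_le_gibbonOmega_pow hν (by omega) (u t)
    have h3 : Real.sqrt J * Real.sqrt Jp ≤ Ω ^ m * Ωp ^ (m + 1) :=
      mul_le_mul h1 h2 (Real.sqrt_nonneg _) (pow_nonneg hΩ.le _)
    have h4 := mul_le_mul_of_nonneg_left h3 (by positivity : 0 ≤ cf * c₃)
    have e : cf * c₃ * (Ω ^ m * Ωp ^ (m + 1)) = k₅ * (Ωp ^ ((m : ℝ) + 1) * Ω ^ ((1 : ℝ) - m)) := by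
      rw [hcfdef, hk₅, ← eΩ2, ← Real.rpow_natCast Ωp (m + 1)]
      push_cast
      ring
    calc cf * (c₃ * Real.sqrt J * Real.sqrt Jp) = cf * c₃ * (Real.sqrt J * Real.sqrt Jp) := by ring
      _ ≤ cf * c₃ * (Ω ^ m * Ωp ^ (m + 1)) := h4
      _ = k₅ * (Ωp ^ ((m : ℝ) + 1) * Ω ^ ((1 : ℝ) - m)) := e
  -- (5.17): assemble
  set Y : ℝ := (Ωp / Ω) ^ β with hYdef
  have hY0 : 0 ≤ Y := Real.rpow_nonneg (div_pos hΩp hΩ).le _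
  have eY1 : Ωp ^ β * Ω ^ (1 - β) = Y * Ω := by
    rw [hYdef, Real.div_rpow hΩp.le hΩ.le, Real.rpow_sub hΩ, Real.rpow_one]
    field_simp
  have eY2 : Ωp ^ ((m : ℝ) + 1) * Ω ^ ((1 : ℝ) - m) = Y ^ θ * Ω * Ω := by
    rw [hYdef, ← Real.rpow_mul (div_pos hΩp hΩ).le, hβθ, Real.div_rpow hΩp.le hΩ.le,
      Real.rpow_sub hΩ, Real.rpow_one, Real.rpow_natCast]
    have : Ω ^ ((m : ℝ) + 1) = Ω ^ (m : ℝ) * Ω := by rw [Real.rpow_add hΩ, Real.rpow_one]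
    rw [this, Real.rpow_natCast]
    field_simp
  have h517 : R ≤ Ω * (-(ν * k₁' * Y) + k₅ * Y ^ θ * Ω + ν * k₆) := by
    have e : R = cf * V := by rw [hReq, hcfdef]
    have h1 : cf * V ≤ cf * (-(ν * c₁ * J3) + ν * c₂ * J + c₃ * Real.sqrt J * Real.sqrt Jp) :=
      mul_le_mul_of_nonneg_left hVlad hcf0.le
    have e2 : cf * (-(ν * c₁ * J3) + ν * c₂ * J + c₃ * Real.sqrt J * Real.sqrt Jp) =
        cf * -(ν * c₁ * J3) + cf * (ν * c₂ * J) + cf * (c₃ * Real.sqrt J * Real.sqrt Jp) := by ring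
    rw [e]
    refine h1.trans ?_
    rw [e2]
    have e3 : Ω * (-(ν * k₁' * Y) + k₅ * Y ^ θ * Ω + ν * k₆) =
        (-(ν * k₁' * (Y * Ω)) + ν * (c₁ / (2 * m)) * Ω) + ν * (c₂ / (2 * m)) * Ω +
          k₅ * (Y ^ θ * Ω * Ω) := by rw [hk₆]; ring
    rw [e3, ← eY1, ← eY2]
    exact add_le_add (add_le_add hB hC) hDst
  -- (5.18): Young on the central term
  have hyoung := young hY0 hΩ
  have e4 : (Ω / ν) ^ Q = (Ω / ν) ^ (2 * gibbonAlpha m) := by rw [hQα]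
  rw [e4] at hyoung
  calc R ≤ Ω * (-(ν * k₁' * Y) + k₅ * Y ^ θ * Ω + ν * k₆) := h517
    _ ≤ Ω * (-(ν * k₁' * Y) + (ν * k₁' / 2 * Y + k₂ * (ν * (Ω / ν) ^ (2 * gibbonAlpha m))) +
          ν * k₆) := by
        gcongr
    _ = ν * Ω * (-(k₁' / 2 * Y) + k₂ * (Ω / ν) ^ (2 * gibbonAlpha m) + k₆) := by ring

open VorticityMomentLadder in
/-- **The identity (5.19): `(Ω_{m+1}/Ωₘ)^{βₘ} = (D_{m+1}/Dₘ)^{ρₘ} Dₘ²`** ("having used the fact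
that `(1/α_{m+1} − 1/αₘ)βₘ = 2` and `ρₘ = βₘ/α_{m+1}`", Gibbon 2012 (5.19)–(5.20)); here
`βₘ = 4m(m+1)/3`, `ν > 0`, `m ≥ 1`. [cite: Gibbon2012JMP, §5 eqs. (5.19)–(5.20)] -/
theorem gibbonOmega_ratio_rpow_eq {ν : ℝ} (hν : 0 < ν) {m : ℕ} (hm : 1 ≤ m)
    (v : UnitAddTorus (Fin 3) → EuclideanSpace ℝ (Fin 3)) :
    (gibbonOmega ν (m + 1) v / gibbonOmega ν m v) ^ (4 * (m : ℝ) * (m + 1) / 3) =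
      (gibbonD ν (m + 1) v / gibbonD ν m v) ^ gibbonRho m * gibbonD ν m v ^ 2 := by
  have hm1 : (1 : ℝ) ≤ m := by exact_mod_cast hm
  have hΩ := gibbonOmega_pos hν hm v
  have hΩp := gibbonOmega_pos hν (by omega : 1 ≤ m + 1) v
  have hx : 0 < gibbonOmega ν m v / ν := div_pos hΩ hν
  have hy : 0 < gibbonOmega ν (m + 1) v / ν := div_pos hΩp hν
  have hD := gibbonD_pos hν hm v
  have hDp := gibbonD_pos hν (by omega : 1 ≤ m + 1) v
  set β : ℝ := 4 * (m : ℝ) * (m + 1) / 3 with hβ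
  -- exponent bookkeeping
  have h4m3 : (4 : ℝ) * m - 3 ≠ 0 := by
    have : (0 : ℝ) < 4 * m - 3 := by linarith
    exact this.ne'
  have h4m1 : (4 : ℝ) * (m + 1) - 3 ≠ 0 := by
    have : (0 : ℝ) < 4 * (m + 1) - 3 := by linarith
    exact this.ne'
  have e1 : gibbonAlpha (m + 1) * gibbonRho m = β := by
    simp only [gibbonAlpha, gibbonRho, hβ]
    push_cast
    rw [div_mul_div_comm, div_eq_div_iff (mul_ne_zero h4m1 (by norm_num)) (by norm_num)]
    ring
  have e2 : 2 * gibbonAlpha m - gibbonAlpha m * gibbonRho m = -β := by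
    simp only [gibbonAlpha, gibbonRho, hβ]
    have h3 : (3 : ℝ) ≠ 0 := by norm_num
    rw [mul_div_assoc', div_mul_div_comm, div_sub_div _ _ h4m3 (mul_ne_zero h4m3 h3),
      div_eq_iff (mul_ne_zero h4m3 (mul_ne_zero h4m3 h3))]
    ring
  set x : ℝ := gibbonOmega ν m v / ν with hxdef
  set y : ℝ := gibbonOmega ν (m + 1) v / ν with hydef
  have eq1 : gibbonOmega ν (m + 1) v / gibbonOmega ν m v = y / x := by
    rw [hxdef, hydef]; field_simp
  symm
  calc (gibbonD ν (m + 1) v / gibbonD ν m v) ^ gibbonRho m * gibbonD ν m v ^ 2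
      = (y ^ gibbonAlpha (m + 1)) ^ gibbonRho m / (x ^ gibbonAlpha m) ^ gibbonRho m *
          (x ^ gibbonAlpha m) ^ 2 := by
        unfold gibbonD
        rw [Real.div_rpow (Real.rpow_nonneg hy.le _) (Real.rpow_nonneg hx.le _)]
    _ = y ^ β / x ^ (gibbonAlpha m * gibbonRho m) * x ^ (2 * gibbonAlpha m) := by
        rw [← Real.rpow_mul hy.le, ← Real.rpow_mul hx.le, e1, ← Real.rpow_natCast,
          ← Real.rpow_mul hx.le, mul_comm (gibbonAlpha m) ((2 : ℕ) : ℝ)]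
        norm_num
    _ = y ^ β * (x ^ (2 * gibbonAlpha m) / x ^ (gibbonAlpha m * gibbonRho m)) := by ring
    _ = y ^ β * x ^ (-β) := by rw [← Real.rpow_sub hx, e2]
    _ = y ^ β / x ^ β := by rw [Real.rpow_neg hx.le, div_eq_mul_inv]
    _ = (y / x) ^ β := by rw [Real.div_rpow hy.le hx.le]
    _ = (gibbonOmega ν (m + 1) v / gibbonOmega ν m v) ^ (4 * (m : ℝ) * (m + 1) / 3) := by
        rw [eq1]

open VorticityMomentLadder in
/-- **THEOREM 2 of Gibbon 2012 (the `Dₘ` ladder), unforced case, on `𝕋³`.** "For `1 ≤ m < ∞`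
on `[0, T*]` the `Dₘ(t)` formally satisfy the set of inequalities
`Ḋₘ ≤ Dₘ³ {−ϖ_{1,m} (D_{m+1}/Dₘ)^{ρₘ} + ϖ_{2,m}}`, where `ρₘ = ⅔ m(4m+1)`"
(`ϖ_{1,m} = ϖ₀αₘ c_{1,m}⁻¹`, `ϖ_{2,m} = ϖ₀αₘ c_{2,m}`, `ϖ₀ = νL⁻²`; Gibbon 2013 IUTAM Thm 2;
Gibbon et al. 2014 Nonlinearity (2.7) with `Gr = 0`). Typed: for every natural `m ≥ 1` there are
`c₁ > 0`, `c₂ ≥ 0` (depending only on `m`) such that along every classical solution of the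
UNFORCED Navier–Stokes system with `ν > 0` on `𝕋³ × [a, b]` (`Dₘ = gibbonD ν m`, unit torus:
`ϖ₀ = ν`), at every `t ∈ [a, b]`, every one-sided derivative value `R` of `s ↦ Dₘ(u(s))` within
`[a, b]` satisfies `R ≤ Dₘ³ (−ν c₁ (D_{m+1}/Dₘ)^{ρₘ} + ν c₂)`. Proof = §5 of the paper:
`exists_gibbonOmega_ladder` ((5.18)), `Ḋₘ = αₘDₘΩ̇ₘ/Ωₘ`, `(ν⁻¹Ωₘ)^{2αₘ} = Dₘ²`, `Dₘ ≥ 1`, and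
the identity (5.19) `gibbonOmega_ratio_rpow_eq`. DEVIATIONS: classical solutions on a compact
time window instead of the maximal interval `[0, T*)` of a strong solution; `Ωₘ` regularised as in
the proof ((5.16)), not additively as in (1.2); natural `m`. An a priori differential inequality;
not a regularity statement. [cite: Gibbon2012JMP, Thm 2] -/
theorem exists_gibbonD_ladder (m : ℕ) (hm : 1 ≤ m) :
    ∃ c₁ c₂ : ℝ, 0 < c₁ ∧ 0 ≤ c₂ ∧
      ∀ {a b ν : ℝ} {u : ℝ → UnitAddTorus (Fin 3) → EuclideanSpace ℝ (Fin 3)}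
        {p : ℝ → UnitAddTorus (Fin 3) → ℝ},
        Torus.IsClassicalNSSolutionOn (Icc a b) ν 0 u p → a < b → 0 < ν →
        ∀ {t : ℝ}, t ∈ Icc a b → ∀ {R : ℝ},
          HasDerivWithinAt (fun s => gibbonD ν m (u s)) R (Icc a b) t →
          R ≤ gibbonD ν m (u t) ^ 3 *
            (-(ν * c₁ * (gibbonD ν (m + 1) (u t) / gibbonD ν m (u t)) ^ gibbonRho m) + ν * c₂) := by
  obtain ⟨k₁, k₂, k₃, hk₁, hk₂, hk₃, hΩlad⟩ := exists_gibbonOmega_ladder m hm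
  have hα := gibbonAlpha_pos hm
  refine ⟨gibbonAlpha m * k₁, gibbonAlpha m * (k₂ + k₃), by positivity, by positivity, ?_⟩
  intro a b ν u p h hab hν t ht R hR
  set Ω : ℝ := gibbonOmega ν m (u t) with hΩdef
  set Ωp : ℝ := gibbonOmega ν (m + 1) (u t) with hΩpdef
  set D : ℝ := gibbonD ν m (u t) with hDdef
  set Dp : ℝ := gibbonD ν (m + 1) (u t) with hDpdef
  have hΩ : 0 < Ω := gibbonOmega_pos hν hm (u t)
  have hD : 0 < D := gibbonD_pos hν hm (u t)
  have hD1 : 1 ≤ D := one_le_gibbonD hν hm (u t)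
  -- the `Ω`-derivative and the chain rule for `D`
  have hJ' := h.hasDerivWithinAt_integral_torusVorticitySqAt_pow hab m ht
  have hΩ' := hasDerivWithinAt_gibbonOmega hν hm hJ'
  set RΩ : ℝ := (1 : ℝ) / (2 * m) * gibbonOmega ν m (u t) ^ ((1 : ℝ) - 2 * m) *
    ((2 * m * (∫ x, torusVorticitySqAt (u t) x ^ (m - 1) * torusStretchingDensity (u t) x) -
        ν * (m * (∫ x, torusVorticitySqAt (u t) x ^ (m - 1) * ∑ k, ∑ i, ∑ j,
              Torus.partialDeriv k (torusVorticityTensor (u t) i j) x ^ 2) +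
            m * (m - 1) * ∫ x, torusVorticitySqAt (u t) x ^ (m - 2) *
              ∑ k, Torus.partialDeriv k (torusVorticitySqAt (u t)) x ^ 2) +
        m * ∫ x, torusVorticitySqAt (u t) x ^ (m - 1) * ∑ i, ∑ j, torusVorticityTensor (u t) i j x *
          (Torus.partialDeriv i ((0 : ℝ → UnitAddTorus (Fin 3) → EuclideanSpace ℝ (Fin 3)) t) x j -
            Torus.partialDeriv j ((0 : ℝ → UnitAddTorus (Fin 3) → EuclideanSpace ℝ (Fin 3)) t) x i)))
    with hRΩdef
  have hRΩ : RΩ ≤ ν * Ω * (-(k₁ * (Ωp / Ω) ^ (4 * (m : ℝ) * (m + 1) / 3)) +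
      k₂ * (Ω / ν) ^ (2 * gibbonAlpha m) + k₃) := hΩlad h hab hν ht hΩ'
  have hD' := hasDerivWithinAt_gibbonD hν hm hΩ'
  have hU : UniqueDiffWithinAt ℝ (Icc a b) t := uniqueDiffOn_Icc hab t ht
  have hReq : R = gibbonAlpha m * D / Ω * RΩ := (hR.derivWithin hU).symm.trans (hD'.derivWithin hU)
  -- substitute
  have hfac : 0 ≤ gibbonAlpha m * D / Ω := by positivity
  have h1 : R ≤ gibbonAlpha m * D / Ω * (ν * Ω * (-(k₁ * (Ωp / Ω) ^ (4 * (m : ℝ) * (m + 1) / 3)) +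
      k₂ * (Ω / ν) ^ (2 * gibbonAlpha m) + k₃)) := by
    rw [hReq]; exact mul_le_mul_of_nonneg_left hRΩ hfac
  have e2 : (Ω / ν) ^ (2 * gibbonAlpha m) = D ^ 2 := (gibbonD_sq hν hm (u t)).symm
  have e3 : (Ωp / Ω) ^ (4 * (m : ℝ) * (m + 1) / 3) = (Dp / D) ^ gibbonRho m * D ^ 2 :=
    gibbonOmega_ratio_rpow_eq hν hm (u t)
  rw [e2, e3] at h1
  have e4 : gibbonAlpha m * D / Ω * (ν * Ω * (-(k₁ * ((Dp / D) ^ gibbonRho m * D ^ 2)) +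
      k₂ * D ^ 2 + k₃)) = ν * gibbonAlpha m * D * (-(k₁ * (Dp / D) ^ gibbonRho m * D ^ 2) +
        k₂ * D ^ 2 + k₃) := by
    field_simp
  rw [e4] at h1
  -- `k₃ ≤ k₃ D²` since `D ≥ 1`
  have hk3 : k₃ ≤ k₃ * D ^ 2 := by
    have : 1 ≤ D ^ 2 := one_le_pow₀ hD1
    nlinarith
  have hY0 : 0 ≤ (Dp / D) ^ gibbonRho m :=
    Real.rpow_nonneg (div_pos (gibbonD_pos hν (by omega) (u t)) hD).le _
  calc R ≤ ν * gibbonAlpha m * D * (-(k₁ * (Dp / D) ^ gibbonRho m * D ^ 2) + k₂ * D ^ 2 + k₃) := h1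
    _ ≤ ν * gibbonAlpha m * D * (-(k₁ * (Dp / D) ^ gibbonRho m * D ^ 2) + k₂ * D ^ 2 +
          k₃ * D ^ 2) := by gcongr
    _ = D ^ 3 * (-(ν * (gibbonAlpha m * k₁) * (Dp / D) ^ gibbonRho m) +
          ν * (gibbonAlpha m * (k₂ + k₃))) := by ring

open VorticityMomentLadder in
/-- **The ratio criterion (Gibbon 2012, after Thm 2; Gibbon 2013 IUTAM (4.3)–(4.4)):** "solutions
come under control pointwise in `t` provided `D_{m+1}(t) ≥ c_{ρₘ} Dₘ(t)`,
`c_{ρₘ} = [c_{1,m}c_{2,m}]^{1/ρₘ}` … if this holds then the `Dₘ` must decay in time." Typed: for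
every `m ≥ 1` there is a threshold `C ≥ 0` (depending only on `m`) such that along every
classical solution of the unforced system (`ν > 0`) on `𝕋³ × [a, b]`, at every `t ∈ [a, b]` with
`C · Dₘ(t) ≤ D_{m+1}(t)`, every one-sided derivative value of `Dₘ` within `[a, b]` at `t` is
`≤ 0`. [cite: Gibbon2013IUTAM, §4 eqs. (4.3)–(4.4)] -/
theorem exists_gibbonD_deriv_nonpos_of_ratio_ge (m : ℕ) (hm : 1 ≤ m) :
    ∃ C : ℝ, 0 ≤ C ∧
      ∀ {a b ν : ℝ} {u : ℝ → UnitAddTorus (Fin 3) → EuclideanSpace ℝ (Fin 3)}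
        {p : ℝ → UnitAddTorus (Fin 3) → ℝ},
        Torus.IsClassicalNSSolutionOn (Icc a b) ν 0 u p → a < b → 0 < ν →
        ∀ {t : ℝ}, t ∈ Icc a b →
          C * gibbonD ν m (u t) ≤ gibbonD ν (m + 1) (u t) → ∀ {R : ℝ},
          HasDerivWithinAt (fun s => gibbonD ν m (u s)) R (Icc a b) t → R ≤ 0 := by
  obtain ⟨c₁, c₂, hc₁, hc₂, hlad⟩ := exists_gibbonD_ladder m hm
  have hρ : 0 < gibbonRho m := by
    unfold gibbonRho
    have : (1 : ℝ) ≤ m := by exact_mod_cast hm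
    positivity
  -- threshold `C = (c₂/c₁)^{1/ρ}`
  refine ⟨(c₂ / c₁) ^ (1 / gibbonRho m), Real.rpow_nonneg (div_nonneg hc₂ hc₁.le) _, ?_⟩
  intro a b ν u p h hab hν t ht hcrit R hR
  have h1 := hlad h hab hν ht hR
  set D : ℝ := gibbonD ν m (u t) with hDdef
  set Dp : ℝ := gibbonD ν (m + 1) (u t) with hDpdef
  have hD : 0 < D := gibbonD_pos hν hm (u t)
  have hratio : (c₂ / c₁) ^ (1 / gibbonRho m) ≤ Dp / D := by
    rw [le_div_iff₀ hD]; exact hcrit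
  have h2 : c₂ / c₁ ≤ (Dp / D) ^ gibbonRho m := by
    have h3 := Real.rpow_le_rpow (Real.rpow_nonneg (div_nonneg hc₂ hc₁.le) _) hratio hρ.le
    rw [← Real.rpow_mul (div_nonneg hc₂ hc₁.le), one_div_mul_cancel hρ.ne', Real.rpow_one] at h3
    exact h3
  have h4 : ν * c₂ ≤ ν * c₁ * (Dp / D) ^ gibbonRho m := by
    have : c₂ ≤ c₁ * (Dp / D) ^ gibbonRho m := by
      rw [div_le_iff₀ hc₁] at h2; linarith [h2]
    nlinarith [hν.le]
  have h5 : -(ν * c₁ * (Dp / D) ^ gibbonRho m) + ν * c₂ ≤ 0 := by linarith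
  calc R ≤ D ^ 3 * (-(ν * c₁ * (Dp / D) ^ gibbonRho m) + ν * c₂) := h1
    _ ≤ 0 := mul_nonpos_of_nonneg_of_nonpos (pow_nonneg hD.le 3) h5

/-! ### §7 The stretching-only ladder (Euler included): Gibbon 2013, Prop. 1 -/

open VorticityMomentLadder in
/-- **The stretching-only `Jₘ` ladder (`ν ≥ 0`, Euler included)** — the `J`-form of Gibbon 2013
IUTAM (2.1)/(P1): "`2mL³Ωₘ^{2m−1}Ω̇ₘ = d/dt∫|ω|^{2m} ≤ 2m∫|ω|^{2m}|∇u| ≤ … ≤ 2mL³c_{1,m}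
Ω_{m+1}^{m+1}Ωₘᵐ`, where we have used `‖∇u‖_p ≤ c_p‖ω‖_p`". For every `m ≥ 1` there is `K ≥ 0`
such that along every classical solution of the unforced Navier–Stokes/Euler system (`ν ≥ 0`) on
`𝕋³ × [a, b]`, every one-sided derivative value `R` of `Jₘ = ∫|ω|^{2m}` within `[a, b]` at
`t ∈ [a, b]` satisfies `R ≤ K Jₘ(t)^{1/2} J_{m+1}(t)^{1/2}` (the viscous term is dropped:
`IsClassicalNSSolutionOn.deriv_integral_torusVorticitySqAt_pow_le`, then
`exists_integral_pow_mul_stretching_le`). [cite: Gibbon2013IUTAM, Prop. 1 proof (P1)] -/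
theorem exists_vorticityMoment_stretching_ladder (m : ℕ) (hm : 1 ≤ m) :
    ∃ K : ℝ, 0 ≤ K ∧
      ∀ {a b ν : ℝ} {u : ℝ → UnitAddTorus (Fin 3) → EuclideanSpace ℝ (Fin 3)}
        {p : ℝ → UnitAddTorus (Fin 3) → ℝ},
        Torus.IsClassicalNSSolutionOn (Icc a b) ν 0 u p → a < b → 0 ≤ ν →
        ∀ {t : ℝ}, t ∈ Icc a b → ∀ {R : ℝ},
          HasDerivWithinAt (fun s => ∫ x, torusVorticitySqAt (u s) x ^ m) R (Icc a b) t →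
          R ≤ K * Real.sqrt (∫ x, torusVorticitySqAt (u t) x ^ m) *
            Real.sqrt (∫ x, torusVorticitySqAt (u t) x ^ (m + 1)) := by
  obtain ⟨K, hK0, hstr⟩ := exists_integral_pow_mul_stretching_le m hm
  refine ⟨2 * m * K, by positivity, ?_⟩
  intro a b ν u p h hab hν t ht R hR
  have hut : Torus.IsSmooth (u t) := h.smooth_velocity.isSmooth_slice ht
  have h1 := h.deriv_integral_torusVorticitySqAt_pow_le hν hab hm ht hR
  have h2 := mul_le_mul_of_nonneg_left (hstr (u t) hut (h.divFree t ht))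
    (by positivity : (0 : ℝ) ≤ 2 * m)
  calc R ≤ 2 * m * ∫ x, torusVorticitySqAt (u t) x ^ (m - 1) * torusStretchingDensity (u t) x := h1
    _ ≤ 2 * m * (K * Real.sqrt (∫ x, torusVorticitySqAt (u t) x ^ m) *
          Real.sqrt (∫ x, torusVorticitySqAt (u t) x ^ (m + 1))) := h2
    _ = 2 * m * K * Real.sqrt (∫ x, torusVorticitySqAt (u t) x ^ m) *
          Real.sqrt (∫ x, torusVorticitySqAt (u t) x ^ (m + 1)) := by ring

open VorticityMomentLadder in
/-- **Gibbon 2013, Prop. 1 in `Ωₘ`-form (P2): `Ω̇ₘ ≤ c_{1,m} (Ω_{m+1}/Ωₘ)^{m+1} Ωₘ²`,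
`1 ≤ m < ∞`**, for the UNREGULARISED frequencies `Ωₘ = (L⁻³∫|ω|^{2m})^{1/2m}` of a solution of
the Euler OR Navier–Stokes equations (the viscous term only helps; "Note that the case `m = ∞` is
excluded"). Typed on the unit torus for classical solutions of the unforced system with `ν ≥ 0`, at
times with `∫|ω(t)|^{2m} > 0` (so that `Ωₘ` is differentiable): every one-sided derivative value
`R` of `s ↦ (∫|ω(s)|^{2m})^{1/(2m)}` within `[a, b]` at `t` satisfies
`R ≤ K ((∫|ω|^{2m+2})^{1/(2m+2)} / (∫|ω|^{2m})^{1/(2m)})^{m+1} ((∫|ω|^{2m})^{1/(2m)})²`. Its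
`Dₘ`-form (P3)–(P4) (`Ḋₘ ≤ cₘϖ₀(D_{m+1}/Dₘ)^{(4m+1)/2}Dₘ³`, any reference frequency `ϖ₀`) is the
same inequality after the change of variables `Dₘ = (ϖ₀⁻¹Ωₘ)^{αₘ}`; only the `Ωₘ`-form (P2) is
typed. DISCLOSURE (referee F87.1): the print states the `Dₘ`-form with exponent `ξₘ = 4m+1`
(Prop. 1, (P3)) and uses `βₘ = m(m+1)` in (P4), for which `(1/α_{m+1} − 1/αₘ)βₘ = 3/2`, not the
printed `2`; the change of variables actually yields the exponent `(m+1)/α_{m+1} = (4m+1)/2`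
quoted above (with the `βₘ = 4m(m+1)/3` of Gibbon 2012, §5, the identity (P4) does give `2`) — the
value `(4m+1)/2` written here is this corrected algebra, not the printed `ξₘ`.
[cite: Gibbon2013IUTAM, Prop. 1 and eqs. (P1)–(P2)] -/
theorem exists_vorticityFrequency_stretching_ladder (m : ℕ) (hm : 1 ≤ m) :
    ∃ K : ℝ, 0 ≤ K ∧
      ∀ {a b ν : ℝ} {u : ℝ → UnitAddTorus (Fin 3) → EuclideanSpace ℝ (Fin 3)}
        {p : ℝ → UnitAddTorus (Fin 3) → ℝ},
        Torus.IsClassicalNSSolutionOn (Icc a b) ν 0 u p → a < b → 0 ≤ ν →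
        ∀ {t : ℝ}, t ∈ Icc a b → 0 < ∫ x, torusVorticitySqAt (u t) x ^ m → ∀ {R : ℝ},
          HasDerivWithinAt (fun s => (∫ x, torusVorticitySqAt (u s) x ^ m) ^ ((1 : ℝ) / (2 * m)))
            R (Icc a b) t →
          R ≤ K * ((∫ x, torusVorticitySqAt (u t) x ^ (m + 1)) ^ ((1 : ℝ) / (2 * (m + 1))) /
              (∫ x, torusVorticitySqAt (u t) x ^ m) ^ ((1 : ℝ) / (2 * m))) ^ (m + 1) *
            ((∫ x, torusVorticitySqAt (u t) x ^ m) ^ ((1 : ℝ) / (2 * m))) ^ 2 := by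
  obtain ⟨K, hK0, hlad⟩ := exists_vorticityMoment_stretching_ladder m hm
  have hm0 : (0 : ℝ) < m := by exact_mod_cast hm
  refine ⟨K / (2 * m), by positivity, ?_⟩
  intro a b ν u p h hab hν t ht hJ R hR
  set J : ℝ := ∫ x, torusVorticitySqAt (u t) x ^ m with hJdef
  set Jp : ℝ := ∫ x, torusVorticitySqAt (u t) x ^ (m + 1) with hJpdef
  have hJp0 : 0 ≤ Jp := integral_pow_nonneg (u t) (m + 1)
  -- the `J`-derivative and the chain rule for `J^{1/2m}`
  have hD := h.hasDerivWithinAt_integral_torusVorticitySqAt_pow hab m ht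
  set V : ℝ := (2 * m * (∫ x, torusVorticitySqAt (u t) x ^ (m - 1) * torusStretchingDensity (u t) x) -
        ν * (m * (∫ x, torusVorticitySqAt (u t) x ^ (m - 1) * ∑ k, ∑ i, ∑ j,
              Torus.partialDeriv k (torusVorticityTensor (u t) i j) x ^ 2) +
            m * (m - 1) * ∫ x, torusVorticitySqAt (u t) x ^ (m - 2) *
              ∑ k, Torus.partialDeriv k (torusVorticitySqAt (u t)) x ^ 2) +
        m * ∫ x, torusVorticitySqAt (u t) x ^ (m - 1) * ∑ i, ∑ j, torusVorticityTensor (u t) i j x *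
          (Torus.partialDeriv i ((0 : ℝ → UnitAddTorus (Fin 3) → EuclideanSpace ℝ (Fin 3)) t) x j -
            Torus.partialDeriv j ((0 : ℝ → UnitAddTorus (Fin 3) → EuclideanSpace ℝ (Fin 3)) t) x i))
    with hVdef
  have hV : V ≤ K * Real.sqrt J * Real.sqrt Jp := hlad h hab hν ht hD
  have hpow := hD.rpow_const (p := (1 : ℝ) / (2 * m)) (Or.inl hJ.ne')
  have hU : UniqueDiffWithinAt ℝ (Icc a b) t := uniqueDiffOn_Icc hab t ht
  have hReq : R = V * ((1 : ℝ) / (2 * m)) * J ^ ((1 : ℝ) / (2 * m) - 1) :=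
    (hR.derivWithin hU).symm.trans (hpow.derivWithin hU)
  -- notation `Ω = J^{1/2m}`, `Ωp = Jp^{1/(2m+2)}`
  set Ω : ℝ := J ^ ((1 : ℝ) / (2 * m)) with hΩdef
  set Ωp : ℝ := Jp ^ ((1 : ℝ) / (2 * (m + 1))) with hΩpdef
  have hΩ : 0 < Ω := Real.rpow_pos_of_pos hJ _
  have hΩp0 : 0 ≤ Ωp := Real.rpow_nonneg hJp0 _
  have hfac : 0 ≤ ((1 : ℝ) / (2 * m)) * J ^ ((1 : ℝ) / (2 * m) - 1) := by positivity
  -- `√J = Ω^m`, `√Jp = Ωp^{m+1}`, `J^{1/2m - 1} = Ω^{1-2m}`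
  have eJ : Real.sqrt J = Ω ^ m := by
    rw [hΩdef, Real.sqrt_eq_rpow, ← Real.rpow_natCast, ← Real.rpow_mul hJ.le]
    congr 1; field_simp
  have eJp : Real.sqrt Jp = Ωp ^ (m + 1) := by
    rw [hΩpdef, Real.sqrt_eq_rpow, ← Real.rpow_natCast, ← Real.rpow_mul hJp0]
    congr 1; push_cast; field_simp
  have eJ2 : J ^ ((1 : ℝ) / (2 * m) - 1) = Ω ^ ((1 : ℝ) - 2 * m) := by
    rw [hΩdef, ← Real.rpow_mul hJ.le]
    congr 1; field_simp
  have h1 : R ≤ (K * Real.sqrt J * Real.sqrt Jp) * (((1 : ℝ) / (2 * m)) * J ^ ((1 : ℝ) / (2 * m) - 1)) := by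
    rw [hReq, mul_assoc]
    exact mul_le_mul_of_nonneg_right hV hfac
  rw [eJ, eJp, eJ2] at h1
  -- `Ω^m Ωp^{m+1} Ω^{1-2m} = (Ωp/Ω)^{m+1} Ω²`
  have e3 : K * Ω ^ m * Ωp ^ (m + 1) * ((1 : ℝ) / (2 * m) * Ω ^ ((1 : ℝ) - 2 * m)) =
      K / (2 * m) * (Ωp / Ω) ^ (m + 1) * Ω ^ 2 := by
    have e4 : Ω ^ m * Ω ^ ((1 : ℝ) - 2 * m) = Ω ^ ((1 : ℝ) - m) := by
      rw [← Real.rpow_natCast Ω m, ← Real.rpow_add hΩ]; congr 1; ring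
    have e6 : Ω ^ ((1 : ℝ) - m) = Ω ^ 2 / Ω ^ (m + 1) := by
      rw [eq_div_iff (pow_ne_zero _ hΩ.ne'), ← Real.rpow_natCast Ω 2,
        ← Real.rpow_natCast Ω (m + 1), ← Real.rpow_add hΩ]
      congr 1; push_cast; ring
    have e5 : (Ωp / Ω) ^ (m + 1) * Ω ^ 2 = Ωp ^ (m + 1) * Ω ^ ((1 : ℝ) - m) := by
      rw [div_pow, e6, div_mul_eq_mul_div, mul_div_assoc]
    calc K * Ω ^ m * Ωp ^ (m + 1) * ((1 : ℝ) / (2 * m) * Ω ^ ((1 : ℝ) - 2 * m))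
        = K / (2 * m) * (Ωp ^ (m + 1) * (Ω ^ m * Ω ^ ((1 : ℝ) - 2 * m))) := by ring
      _ = K / (2 * m) * (Ωp ^ (m + 1) * Ω ^ ((1 : ℝ) - m)) := by rw [e4]
      _ = K / (2 * m) * ((Ωp / Ω) ^ (m + 1) * Ω ^ 2) := by rw [← e5]
      _ = K / (2 * m) * (Ωp / Ω) ^ (m + 1) * Ω ^ 2 := by ring
  rw [e3] at h1
  exact h1

/-! ### §8 Integrating the `Dₘ` ladder in time: Gibbon 2012, Theorem 3 -/

namespace VorticityMomentLadder

/-- Along a classical solution (`ν > 0`), `s ↦ Dₘ(u(s))` is differentiable within `[a, b]` at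
every instant: the `Jₘ` balance, then `hasDerivWithinAt_gibbonOmega`, `hasDerivWithinAt_gibbonD`.
[cite: Gibbon2012JMP, §5 eqs. (5.17)–(5.20)] -/
theorem hasDerivWithinAt_gibbonD_derivWithin {a b ν : ℝ}
    {u : ℝ → UnitAddTorus (Fin 3) → EuclideanSpace ℝ (Fin 3)} {p : ℝ → UnitAddTorus (Fin 3) → ℝ}
    (h : Torus.IsClassicalNSSolutionOn (Icc a b) ν 0 u p) (hab : a < b) (hν : 0 < ν) {m : ℕ}
    (hm : 1 ≤ m) {t : ℝ} (ht : t ∈ Icc a b) :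
    HasDerivWithinAt (fun s => gibbonD ν m (u s))
      (derivWithin (fun s => gibbonD ν m (u s)) (Icc a b) t) (Icc a b) t :=
  (hasDerivWithinAt_gibbonD hν hm (hasDerivWithinAt_gibbonOmega hν hm
    (h.hasDerivWithinAt_integral_torusVorticitySqAt_pow hab m ht))).differentiableWithinAt
    |>.hasDerivWithinAt

/-- Along a classical solution (`ν > 0`), `s ↦ Dₘ(u(s))` is continuous on `[a, b]`.
[cite: Gibbon2012JMP, §5 eqs. (5.17)–(5.20)] -/
theorem continuousOn_gibbonD {a b ν : ℝ}
    {u : ℝ → UnitAddTorus (Fin 3) → EuclideanSpace ℝ (Fin 3)} {p : ℝ → UnitAddTorus (Fin 3) → ℝ}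
    (h : Torus.IsClassicalNSSolutionOn (Icc a b) ν 0 u p) (hab : a < b) (hν : 0 < ν) {m : ℕ}
    (hm : 1 ≤ m) : ContinuousOn (fun s => gibbonD ν m (u s)) (Icc a b) :=
  fun _ ht => (hasDerivWithinAt_gibbonD_derivWithin h hab hν hm ht).continuousWithinAt

/-- `(1 + z)^p ≤ 2^{p−1}(1 + z^p)` for `z ≥ 0`, `p ≥ 1` (power mean), the elementary step
`(1 + Zₘ)^{ρₘ} ≤ 2^{ρₘ−1}(1 + Zₘ^{ρₘ})` of the printed proof. [folklore] -/
private theorem one_add_rpow_le {z p : ℝ} (hz : 0 ≤ z) (hp : 1 ≤ p) :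
    (1 + z) ^ p ≤ (2 : ℝ) ^ (p - 1) * (1 + z ^ p) := by
  have h := NNReal.coe_le_coe.2 (NNReal.rpow_add_le_mul_rpow_add_rpow 1 ⟨z, hz⟩ hp)
  push_cast [NNReal.coe_rpow] at h
  rw [Real.one_rpow] at h
  exact h

end VorticityMomentLadder

open VorticityMomentLadder in
/-- **Gibbon 2012, THEOREM 3 (a time-integral criterion, "an alternative to the Beale–Kato–Majda
theorem").** "For any value of `1 ≤ m < ∞`, if the integral condition
`∫₀ᵗ ln((1 + Zₘ)/c_{4,m}) dτ ≥ 0`, `Zₘ = D_{m+1}/Dₘ`, is satisfied, with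
`c_{4,m} = [2^{ρₘ−1}(1 + c_{1,m}c_{2,m})]^{1/ρₘ}`, then `Dₘ(t) ≤ Dₘ(0)`." Typed on the unit torus
for classical solutions of the unforced system with `ν > 0` on a window `[a, b]` (initial instant
`a`): for every natural `m ≥ 1` there is a constant `C > 0` (here
`C = [2^{ρₘ−1}(1 + c₂/c₁)]^{1/ρₘ}` with `c₁, c₂` the constants of `exists_gibbonD_ladder`) such
that `0 ≤ ∫ₐᵗ log((1 + D_{m+1}/Dₘ)/C) dτ` implies `Dₘ(t) ≤ Dₘ(a)`. The proof is the printed one: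
divide the ladder (Theorem 2) by `Dₘ³` and integrate (`G = Dₘ⁻²` has one-sided derivative
`≥ 2νc₁Zₘ^{ρₘ} − 2νc₂`; `intervalIntegral.integral_le_sub_of_hasDeriv_right_of_le`), use
`(1 + Zₘ)^{ρₘ} ≤ 2^{ρₘ−1}(1 + Zₘ^{ρₘ})`, and Jensen's inequality for `exp`
(`ConvexOn.map_set_average_le`) with `F = ρₘ ln(1 + Zₘ)`.
[cite: Gibbon2012JMP, §2.1, Theorem 3 with its proof (arXiv:1108.4651, p. 5)] -/
theorem exists_gibbonD_le_initial_of_log_integral_nonneg (m : ℕ) (hm : 1 ≤ m) :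
    ∃ C : ℝ, 0 < C ∧
      ∀ {a b ν : ℝ} {u : ℝ → UnitAddTorus (Fin 3) → EuclideanSpace ℝ (Fin 3)}
        {p : ℝ → UnitAddTorus (Fin 3) → ℝ},
        Torus.IsClassicalNSSolutionOn (Icc a b) ν 0 u p → a < b → 0 < ν →
        ∀ {t : ℝ}, t ∈ Icc a b →
          0 ≤ ∫ τ in a..t,
              Real.log ((1 + gibbonD ν (m + 1) (u τ) / gibbonD ν m (u τ)) / C) →
          gibbonD ν m (u t) ≤ gibbonD ν m (u a) := by
  obtain ⟨c₁, c₂, hc₁, hc₂, hlad⟩ := exists_gibbonD_ladder m hm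
  have hm1 : (1 : ℝ) ≤ m := by exact_mod_cast hm
  have hρ1 : 1 ≤ gibbonRho m := by
    unfold gibbonRho; nlinarith
  set ρ : ℝ := gibbonRho m with hρdef
  have hρ0 : 0 < ρ := by linarith
  -- the threshold `c₄ = [2^{ρ−1}(1 + c₂/c₁)]^{1/ρ}`
  set B : ℝ := (2 : ℝ) ^ (ρ - 1) * (1 + c₂ / c₁) with hBdef
  have hB : 0 < B := by positivity
  set C : ℝ := B ^ (1 / ρ) with hCdef
  have hC : 0 < C := Real.rpow_pos_of_pos hB _
  have hCρ : C ^ ρ = B := by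
    rw [hCdef, ← Real.rpow_mul hB.le, one_div_mul_cancel hρ0.ne', Real.rpow_one]
  refine ⟨C, hC, ?_⟩
  intro a b ν u p h hab hν t ht hint
  rcases eq_or_lt_of_le ht.1 with hta | hta
  · rw [hta]
  have hta0 : 0 < t - a := sub_pos.2 hta
  -- notation along the solution: `D = Dₘ`, `Dp = D_{m+1}`, `Z = Dp/D`, `D'` the one-sided slope
  set D : ℝ → ℝ := fun s => gibbonD ν m (u s) with hDdef
  set Dp : ℝ → ℝ := fun s => gibbonD ν (m + 1) (u s) with hDpdef
  set D' : ℝ → ℝ := fun s => derivWithin D (Icc a b) s with hD'def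
  have hDpos : ∀ s, 0 < D s := fun s => gibbonD_pos hν hm (u s)
  have hDppos : ∀ s, 0 < Dp s := fun s => gibbonD_pos hν (Nat.le_succ_of_le hm) (u s)
  have hDder : ∀ s ∈ Icc a b, HasDerivWithinAt D (D' s) (Icc a b) s := fun s hs =>
    hasDerivWithinAt_gibbonD_derivWithin h hab hν hm hs
  have hDcont : ContinuousOn D (Icc a b) := continuousOn_gibbonD h hab hν hm
  have hDpcont : ContinuousOn Dp (Icc a b) := continuousOn_gibbonD h hab hν (Nat.le_succ_of_le hm)
  set Z : ℝ → ℝ := fun s => Dp s / D s with hZdef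
  have hZnn : ∀ s, 0 ≤ Z s := fun s => div_nonneg (hDppos s).le (hDpos s).le
  have h1Z : ∀ s, 0 < 1 + Z s := fun s => by linarith [hZnn s]
  have hZcont : ContinuousOn Z (Icc a b) := hDpcont.div hDcont fun s _ => (hDpos s).ne'
  have hZρcont : ContinuousOn (fun s => Z s ^ ρ) (Icc a b) :=
    hZcont.rpow_const fun s _ => Or.inr hρ0.le
  -- THEOREM 2 at every instant of `[a, b]`
  have hT2 : ∀ s ∈ Icc a b, D' s ≤ D s ^ 3 * (-(ν * c₁ * Z s ^ ρ) + ν * c₂) :=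
    fun s hs => hlad h hab hν hs (hDder s hs)
  -- `G = Dₘ⁻²`, its one-sided derivative `G'`, and the lower bound `φ ≤ G'`
  set G : ℝ → ℝ := fun s => (D s * D s)⁻¹ with hGdef
  set G' : ℝ → ℝ := fun s => -(D' s * D s + D s * D' s) / (D s * D s) ^ 2 with hG'def
  have hGder : ∀ s ∈ Icc a b, HasDerivWithinAt G (G' s) (Icc a b) s := fun s hs =>
    ((hDder s hs).mul (hDder s hs)).inv (mul_pos (hDpos s) (hDpos s)).ne'
  have hGcont : ContinuousOn G (Icc a b) := fun s hs => (hGder s hs).continuousWithinAt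
  set φ : ℝ → ℝ := fun s => 2 * ν * c₁ * Z s ^ ρ - 2 * ν * c₂ with hφdef
  have hφG : ∀ s ∈ Icc a b, φ s ≤ G' s := by
    intro s hs
    have hDs := hDpos s
    have h1 : D' s / D s ^ 3 ≤ -(ν * c₁ * Z s ^ ρ) + ν * c₂ := by
      rw [div_le_iff₀ (pow_pos hDs 3)]
      linarith [hT2 s hs]
    have h2 : G' s = -2 * (D' s / D s ^ 3) := by
      have e : D' s / D s ^ 3 * (D s * D s) ^ 2 = D' s * D s := by
        rw [div_mul_eq_mul_div, div_eq_iff (pow_ne_zero 3 hDs.ne')]; ring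
      simp only [hG'def]
      rw [div_eq_iff (pow_ne_zero 2 (mul_pos hDs hDs).ne'), mul_assoc, e]; ring
    rw [h2]
    show 2 * ν * c₁ * Z s ^ ρ - 2 * ν * c₂ ≤ -2 * (D' s / D s ^ 3)
    linarith
  have hφcont : ContinuousOn φ (Icc a b) :=
    (continuousOn_const.mul hZρcont).sub continuousOn_const
  -- (a) FTC on `[a, t]`: `∫ₐᵗ φ ≤ G(t) − G(a)`
  have htI : Icc a t ⊆ Icc a b := Icc_subset_Icc_right ht.2
  have hFTC : (∫ y in a..t, φ y) ≤ G t - G a :=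
    intervalIntegral.integral_le_sub_of_hasDeriv_right_of_le ht.1 (hGcont.mono htI)
      (fun x hx => ((hGder x ⟨hx.1.le, hx.2.le.trans ht.2⟩).hasDerivAt
          (Icc_mem_nhds hx.1 (hx.2.trans_le ht.2))).hasDerivWithinAt)
      (hφcont.mono htI).integrableOn_Icc (fun x hx => hφG x ⟨hx.1.le, hx.2.le.trans ht.2⟩)
  -- (b) Jensen: `0 ≤ ∫ₐᵗ φ`
  have hpos : 0 ≤ ∫ y in a..t, φ y := by
    have hint' : 0 ≤ ∫ s in Ioc a t, Real.log ((1 + Z s) / C) := by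
      rw [intervalIntegral.integral_of_le ht.1] at hint; exact hint
    rw [intervalIntegral.integral_of_le ht.1]
    have hvol : volume.real (Ioc a t) = t - a := Real.volume_real_Ioc_of_le ht.1
    have hμ0 : volume (Ioc a t) ≠ 0 := by
      rw [Real.volume_Ioc]; exact (ENNReal.ofReal_pos.2 hta0).ne'
    have hμT : volume (Ioc a t) ≠ ⊤ := by rw [Real.volume_Ioc]; exact ENNReal.ofReal_ne_top
    have hioc : ∀ {g : ℝ → ℝ}, ContinuousOn g (Icc a b) → IntegrableOn g (Ioc a t) :=
      fun hg => ((hg.mono htI).integrableOn_Icc).mono_set Ioc_subset_Icc_self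
    have hlogcont : ContinuousOn (fun s => Real.log (1 + Z s)) (Icc a b) :=
      (continuousOn_const.add hZcont).log fun s _ => (h1Z s).ne'
    have hpowcont : ContinuousOn (fun s => (1 + Z s) ^ ρ) (Icc a b) :=
      (continuousOn_const.add hZcont).rpow_const fun s _ => Or.inr hρ0.le
    set f : ℝ → ℝ := fun s => Real.log (1 + Z s) * ρ with hfdef
    have hfcont : ContinuousOn f (Icc a b) := hlogcont.mul continuousOn_const
    have hexpf : ∀ s, Real.exp (f s) = (1 + Z s) ^ ρ := fun s =>
      (Real.rpow_def_of_pos (h1Z s) ρ).symm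
    have hexpint : IntegrableOn (Real.exp ∘ f) (Ioc a t) :=
      (hioc hpowcont).congr_fun (fun s _ => (hexpf s).symm) measurableSet_Ioc
    -- Jensen's inequality for `exp` over `Ioc a t`
    have hJ : Real.exp (⨍ s in Ioc a t, f s) ≤ ⨍ s in Ioc a t, Real.exp (f s) :=
      convexOn_exp.map_set_average_le Real.continuous_exp.continuousOn isClosed_univ hμ0 hμT
        (Eventually.of_forall fun _ => mem_univ _) (hioc hfcont) hexpint
    rw [setAverage_eq, setAverage_eq, hvol, smul_eq_mul, smul_eq_mul] at hJ
    -- the hypothesis: `(t − a) log C ≤ ∫ log(1 + Z)`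
    have hlogC : (t - a) * Real.log C ≤ ∫ s in Ioc a t, Real.log (1 + Z s) := by
      have hsplit : ∫ s in Ioc a t, Real.log ((1 + Z s) / C) =
          (∫ s in Ioc a t, Real.log (1 + Z s)) - (t - a) * Real.log C := by
        rw [setIntegral_congr_fun measurableSet_Ioc
          (fun s _ => Real.log_div (h1Z s).ne' hC.ne' :
            EqOn (fun s => Real.log ((1 + Z s) / C))
              (fun s => Real.log (1 + Z s) - Real.log C) (Ioc a t)),
          integral_sub (hioc hlogcont) (integrableOn_const (hs := hμT)), setIntegral_const, hvol,
          smul_eq_mul]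
      linarith [hsplit ▸ hint']
    have hf_int : ∫ s in Ioc a t, f s = (∫ s in Ioc a t, Real.log (1 + Z s)) * ρ :=
      integral_mul_const ρ _
    have hexp_int : ∫ s in Ioc a t, Real.exp (f s) = ∫ s in Ioc a t, (1 + Z s) ^ ρ :=
      setIntegral_congr_fun measurableSet_Ioc fun s _ => hexpf s
    have hstep1 : Real.log C * ρ ≤ (t - a)⁻¹ * ∫ s in Ioc a t, f s := by
      rw [hf_int, le_inv_mul_iff₀ hta0]
      calc (t - a) * (Real.log C * ρ) = (t - a) * Real.log C * ρ := by ring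
        _ ≤ (∫ s in Ioc a t, Real.log (1 + Z s)) * ρ :=
          mul_le_mul_of_nonneg_right hlogC hρ0.le
    have hstep2 : C ^ ρ ≤ (t - a)⁻¹ * ∫ s in Ioc a t, (1 + Z s) ^ ρ := by
      rw [← hexp_int]
      calc C ^ ρ = Real.exp (Real.log C * ρ) := Real.rpow_def_of_pos hC ρ
        _ ≤ Real.exp ((t - a)⁻¹ * ∫ s in Ioc a t, f s) := Real.exp_le_exp.2 hstep1
        _ ≤ (t - a)⁻¹ * ∫ s in Ioc a t, Real.exp (f s) := hJ
    have hstep3 : (t - a) * C ^ ρ ≤ ∫ s in Ioc a t, (1 + Z s) ^ ρ := by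
      rwa [le_inv_mul_iff₀ hta0] at hstep2
    -- pointwise: `(2νc₁/2^{ρ−1})((1 + Z)^ρ − C^ρ) ≤ φ`
    have h2p : 0 < (2 : ℝ) ^ (ρ - 1) := by positivity
    have hψle : ∀ s ∈ Ioc a t,
        2 * ν * c₁ / (2 : ℝ) ^ (ρ - 1) * ((1 + Z s) ^ ρ - C ^ ρ) ≤ φ s := by
      intro s _
      have hkey : (1 + Z s) ^ ρ / (2 : ℝ) ^ (ρ - 1) ≤ 1 + Z s ^ ρ := by
        rw [div_le_iff₀ h2p, mul_comm]
        exact one_add_rpow_le (hZnn s) hρ1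
      have hνc : 0 ≤ 2 * ν * c₁ := by positivity
      have hk2 := mul_le_mul_of_nonneg_left hkey hνc
      have e1 : 2 * ν * c₁ / (2 : ℝ) ^ (ρ - 1) * ((1 + Z s) ^ ρ - C ^ ρ) =
          2 * ν * c₁ * ((1 + Z s) ^ ρ / (2 : ℝ) ^ (ρ - 1)) -
            2 * ν * (c₁ * (C ^ ρ / (2 : ℝ) ^ (ρ - 1))) := by ring
      have e2 : c₁ * (C ^ ρ / (2 : ℝ) ^ (ρ - 1)) = c₁ + c₂ := by
        rw [hCρ, hBdef, mul_comm ((2 : ℝ) ^ (ρ - 1)) _, mul_div_cancel_right₀ _ h2p.ne', mul_add,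
          mul_one, mul_div_cancel₀ _ hc₁.ne']
      rw [e1, e2]
      show _ ≤ 2 * ν * c₁ * Z s ^ ρ - 2 * ν * c₂
      linarith
    have hψint : IntegrableOn
        (fun s => 2 * ν * c₁ / (2 : ℝ) ^ (ρ - 1) * ((1 + Z s) ^ ρ - C ^ ρ)) (Ioc a t) :=
      ((hioc hpowcont).sub (integrableOn_const (hs := hμT))).const_mul _
    have hmono := setIntegral_mono_on hψint (hioc hφcont) measurableSet_Ioc hψle
    have hψval : ∫ s in Ioc a t, 2 * ν * c₁ / (2 : ℝ) ^ (ρ - 1) * ((1 + Z s) ^ ρ - C ^ ρ) =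
        2 * ν * c₁ / (2 : ℝ) ^ (ρ - 1) *
          ((∫ s in Ioc a t, (1 + Z s) ^ ρ) - (t - a) * C ^ ρ) := by
      rw [integral_const_mul, integral_sub (hioc hpowcont) (integrableOn_const (hs := hμT)),
        setIntegral_const, hvol, smul_eq_mul]
    have hnn : 0 ≤ 2 * ν * c₁ / (2 : ℝ) ^ (ρ - 1) *
        ((∫ s in Ioc a t, (1 + Z s) ^ ρ) - (t - a) * C ^ ρ) :=
      mul_nonneg (by positivity) (by linarith [hstep3])
    linarith [hmono, hψval]
  -- (c) conclusion: `Dₘ(a)⁻² ≤ Dₘ(t)⁻²`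
  have hG : G a ≤ G t := by linarith [hFTC, hpos]
  have h2 : D t * D t ≤ D a * D a :=
    (inv_le_inv₀ (mul_pos (hDpos a) (hDpos a)) (mul_pos (hDpos t) (hDpos t))).1 hG
  exact (mul_self_le_mul_self_iff (hDpos t).le (hDpos a).le).2 h2

/-! ### §9 The first rung `Dₘ/D₁ ≤ (D_{m+1}/Dₘ)^{(m−1)(4m+1)}` and regime III
(Gibbon–Donzis–Gupta–Kerr–Pandit–Vincenzi 2014, §2.3) -/

namespace VorticityMomentLadder

/-- Lyapunov interpolation `Jₘ ≤ J₁^{1/m} J_{m+1}^{(m−1)/m}` (`m ≥ 2`): Hölder with exponents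
`(m, m/(m−1))` applied to `|ω|^{2m} = |ω|^{2/m}·|ω|^{2(m²−1)/m}`. [folklore] -/
private theorem integral_pow_le_interpolation_one_succ {m : ℕ} (hm : 2 ≤ m)
    {v : UnitAddTorus (Fin 3) → EuclideanSpace ℝ (Fin 3)} (hv : Torus.IsSmooth v) :
    ∫ x, torusVorticitySqAt v x ^ m ≤
      (∫ x, torusVorticitySqAt v x ^ 1) ^ ((1 : ℝ) / m) *
        (∫ x, torusVorticitySqAt v x ^ (m + 1)) ^ (((m : ℝ) - 1) / m) := by
  set A : UnitAddTorus (Fin 3) → ℝ := fun y => torusVorticitySqAt v y with hA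
  have hA0 : ∀ y, 0 ≤ A y := fun y => torusVorticitySqAt_nonneg v y
  have hAc : Continuous A := (isSmooth_Q hv).continuous
  have hm2 : (2 : ℝ) ≤ m := by exact_mod_cast hm
  have hm0 : (0 : ℝ) < m := by linarith
  have hm1 : (0 : ℝ) < m - 1 := by linarith
  have hpq : Real.HolderConjugate (m : ℝ) ((m : ℝ) / (m - 1)) :=
    { inv_add_inv_eq_inv := by
        rw [inv_one, inv_div, inv_eq_one_div, ← add_div, div_eq_iff hm0.ne']; ring
      left_pos := hm0
      right_pos := div_pos hm0 hm1 }
  have he0 : (0 : ℝ) ≤ ((m : ℝ) + 1) * (m - 1) / m := by positivity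
  set f : UnitAddTorus (Fin 3) → ℝ := fun y => A y ^ ((1 : ℝ) / m) with hf
  set g : UnitAddTorus (Fin 3) → ℝ := fun y => A y ^ (((m : ℝ) + 1) * (m - 1) / m) with hg
  have hf0 : ∀ y, 0 ≤ f y := fun y => Real.rpow_nonneg (hA0 y) _
  have hg0 : ∀ y, 0 ≤ g y := fun y => Real.rpow_nonneg (hA0 y) _
  have hfc : Continuous f := hAc.rpow_const fun y => Or.inr (by positivity)
  have hgc : Continuous g := hAc.rpow_const fun y => Or.inr he0
  have hH := integral_mul_le_Lp_mul_Lq_of_nonneg (μ := volume) hpq (f := f) (g := g)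
    (ae_of_all _ hf0) (ae_of_all _ hg0) (memLp_of_continuous hfc _) (memLp_of_continuous hgc _)
  have e0 : (1 : ℝ) / m + ((m : ℝ) + 1) * (m - 1) / m = ((m : ℕ) : ℝ) := by
    rw [← add_div, div_eq_iff hm0.ne']; ring
  have efg : (fun y => f y * g y) = fun y => A y ^ m := by
    funext y
    simp only [hf, hg]
    rw [← Real.rpow_add_of_nonneg (hA0 y) (by positivity) he0, e0, Real.rpow_natCast]
  have ef : (fun y => f y ^ (m : ℝ)) = fun y => A y ^ 1 := by
    funext y
    simp only [hf]
    rw [← Real.rpow_mul (hA0 y), one_div_mul_cancel hm0.ne', ← Nat.cast_one, Real.rpow_natCast]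
  have e1 : ((m : ℝ) + 1) * (m - 1) / m * ((m : ℝ) / (m - 1)) = ((m + 1 : ℕ) : ℝ) := by
    rw [div_mul_div_comm, div_eq_iff (mul_ne_zero hm0.ne' hm1.ne')]; push_cast; ring
  have eg : (fun y => g y ^ ((m : ℝ) / (m - 1))) = fun y => A y ^ (m + 1) := by
    funext y
    simp only [hg]
    rw [← Real.rpow_mul (hA0 y), e1, Real.rpow_natCast]
  have e2 : (1 : ℝ) / ((m : ℝ) / (m - 1)) = ((m : ℝ) - 1) / m := one_div_div _ _
  rw [show (fun y => f y * g y) = fun y => f y * g y from rfl] at hH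
  simp only [efg, ef, eg, e2] at hH
  exact hH

/-- Two-term Hölder: `aᶿb^{1−θ} + cᶿd^{1−θ} ≤ (a + c)ᶿ(b + d)^{1−θ}` (`a, b ≥ 0`, `c, d > 0`,
`0 ≤ θ ≤ 1`), by the weighted AM–GM inequality. [folklore] -/
private theorem rpow_mul_rpow_add_le {a b c e θ : ℝ} (ha : 0 ≤ a) (hb : 0 ≤ b) (hc : 0 < c)
    (he : 0 < e) (hθ : 0 ≤ θ) (hθ1 : θ ≤ 1) :
    a ^ θ * b ^ (1 - θ) + c ^ θ * e ^ (1 - θ) ≤ (a + c) ^ θ * (b + e) ^ (1 - θ) := by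
  have hac : 0 < a + c := by linarith
  have hbe : 0 < b + e := by linarith
  set P : ℝ := (a + c) ^ θ with hP
  set Q : ℝ := (b + e) ^ (1 - θ) with hQ
  have hP0 : 0 < P := Real.rpow_pos_of_pos hac _
  have hQ0 : 0 < Q := Real.rpow_pos_of_pos hbe _
  have hPQ : 0 < P * Q := mul_pos hP0 hQ0
  have hθ' : 0 ≤ 1 - θ := by linarith
  have key : ∀ {x y : ℝ}, 0 ≤ x → 0 ≤ y →
      x ^ θ * y ^ (1 - θ) = P * Q * ((x / (a + c)) ^ θ * (y / (b + e)) ^ (1 - θ)) := by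
    intro x y hx hy
    rw [Real.div_rpow hx hac.le, Real.div_rpow hy hbe.le, div_mul_div_comm,
      mul_div_cancel₀ _ hPQ.ne']
  have h1 := Real.geom_mean_le_arith_mean2_weighted hθ hθ' (div_nonneg ha hac.le)
    (div_nonneg hb hbe.le) (by ring)
  have h2 := Real.geom_mean_le_arith_mean2_weighted hθ hθ' (div_nonneg hc.le hac.le)
    (div_nonneg he.le hbe.le) (by ring)
  have h3 : a / (a + c) + c / (a + c) = 1 := by rw [← add_div, div_self hac.ne']
  have h4 : b / (b + e) + e / (b + e) = 1 := by rw [← add_div, div_self hbe.ne']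
  have hsum : θ * (a / (a + c)) + (1 - θ) * (b / (b + e)) +
      (θ * (c / (a + c)) + (1 - θ) * (e / (b + e))) = 1 := by
    linear_combination θ * h3 + (1 - θ) * h4
  rw [key ha hb, key hc.le he.le, ← mul_add]
  calc P * Q * ((a / (a + c)) ^ θ * (b / (b + e)) ^ (1 - θ) +
          (c / (a + c)) ^ θ * (e / (b + e)) ^ (1 - θ))
      ≤ P * Q * 1 := by
        refine mul_le_mul_of_nonneg_left ?_ hPQ.le
        linarith [h1, h2, hsum]
    _ = (a + c) ^ θ * (b + e) ^ (1 - θ) := by rw [mul_one]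

/-- The regularised frequencies interpolate like Lebesgue norms:
`Ωₘ^{2m} ≤ (Ω₁²)^{1/m} (Ω_{m+1}^{2m+2})^{(m−1)/m}` (`m ≥ 2`), i.e.
`Ωₘ ≤ Ω₁^{1/m²} Ω_{m+1}^{1−1/m²}` — Lyapunov interpolation for `Jₘ` plus the two-term Hölder
inequality for the regularising constants `ν^{2m} = (ν²)^{1/m}(ν^{2m+2})^{(m−1)/m}`.
[cite: GibbonEtAl2014Nonlinearity, §2.3, "for `m > 1` it is easily proved that
`Dₘ/D₁ ≤ (D_{m+1}/Dₘ)^{(m−1)(4m+1)}`"] -/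
theorem gibbonOmega_pow_interpolation {ν : ℝ} (hν : 0 < ν) {m : ℕ} (hm : 2 ≤ m)
    {v : UnitAddTorus (Fin 3) → EuclideanSpace ℝ (Fin 3)} (hv : Torus.IsSmooth v) :
    gibbonOmega ν m v ^ (2 * m) ≤
      (gibbonOmega ν 1 v ^ (2 * 1)) ^ ((1 : ℝ) / m) *
        (gibbonOmega ν (m + 1) v ^ (2 * (m + 1))) ^ (((m : ℝ) - 1) / m) := by
  have hm1 : 1 ≤ m := le_trans (by norm_num) hm
  have hm2 : (2 : ℝ) ≤ m := by exact_mod_cast hm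
  have hm0 : (0 : ℝ) < m := by linarith
  rw [gibbonOmega_pow hν.le hm1, gibbonOmega_pow hν.le le_rfl, gibbonOmega_pow hν.le (by omega)]
  have hI := integral_pow_le_interpolation_one_succ hm hv
  have hθ : (0 : ℝ) ≤ 1 / m := by positivity
  have hθ1 : (1 : ℝ) / m ≤ 1 := (div_le_one hm0).2 (by linarith)
  have eθ : ((m : ℝ) - 1) / m = 1 - 1 / m := by
    rw [sub_div, div_self hm0.ne']
  have hν2 : ν ^ (2 * m) = (ν ^ (2 * 1)) ^ ((1 : ℝ) / m) * (ν ^ (2 * (m + 1))) ^ (1 - (1 : ℝ) / m) := by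
    rw [pow_rpow_eq_rpow_mul hν.le, pow_rpow_eq_rpow_mul hν.le, ← Real.rpow_add hν,
      ← Real.rpow_natCast ν (2 * m)]
    congr 1
    push_cast
    field_simp
    first | done | ring
  rw [eθ] at hI ⊢
  calc (∫ x, torusVorticitySqAt v x ^ m) + ν ^ (2 * m)
      ≤ (∫ x, torusVorticitySqAt v x ^ 1) ^ ((1 : ℝ) / m) *
          (∫ x, torusVorticitySqAt v x ^ (m + 1)) ^ (1 - (1 : ℝ) / m) +
        (ν ^ (2 * 1)) ^ ((1 : ℝ) / m) * (ν ^ (2 * (m + 1))) ^ (1 - (1 : ℝ) / m) := by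
        rw [← hν2]; exact add_le_add hI le_rfl
    _ ≤ _ := rpow_mul_rpow_add_le (integral_pow_nonneg v 1) (integral_pow_nonneg v (m + 1))
          (pow_pos hν _) (pow_pos hν _) hθ hθ1

/-- **`Dₘ/D₁ ≤ (D_{m+1}/Dₘ)^{(m−1)(4m+1)}` for `m > 1`** (Gibbon et al. 2014, §2.3: "for `m > 1`
it is easily proved that …"): in the variables `Ωₘ` it is `Ωₘ^{m²} ≤ Ω₁ Ω_{m+1}^{m²−1}`, the
interpolation `gibbonOmega_pow_interpolation`, because `αₘ·m(4m−3) = 2m²`, `α₁ = 2` and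
`α_{m+1}(m−1)(4m+1) = 2(m²−1)`. [cite: GibbonEtAl2014Nonlinearity, §2.3, the display
`Dₘ/D₁ ≤ (D_{m+1}/Dₘ)^{(m−1)(4m+1)}`] -/
theorem gibbonD_div_first_le_ratio_pow {ν : ℝ} (hν : 0 < ν) {m : ℕ} (hm : 2 ≤ m)
    {v : UnitAddTorus (Fin 3) → EuclideanSpace ℝ (Fin 3)} (hv : Torus.IsSmooth v) :
    gibbonD ν m v / gibbonD ν 1 v ≤ (gibbonD ν (m + 1) v / gibbonD ν m v) ^ ((m - 1) * (4 * m + 1)) := by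
  obtain ⟨n, rfl⟩ : ∃ n, m = n + 1 := ⟨m - 1, by omega⟩
  have hn1 : 1 ≤ n := by omega
  have hm1 : 1 ≤ n + 1 := by omega
  have hn1' : (1 : ℝ) ≤ n := by exact_mod_cast hn1
  simp only [Nat.add_sub_cancel]
  -- names
  set X₁ : ℝ := gibbonOmega ν 1 v with hX₁
  set X : ℝ := gibbonOmega ν (n + 1) v with hX
  set Xp : ℝ := gibbonOmega ν (n + 1 + 1) v with hXp
  have hX₁0 : 0 < X₁ := gibbonOmega_pos hν le_rfl v
  have hX0 : 0 < X := gibbonOmega_pos hν hm1 v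
  have hXp0 : 0 < Xp := gibbonOmega_pos hν (by omega) v
  have hD1 : 0 < gibbonD ν 1 v := gibbonD_pos hν le_rfl v
  have hD : 0 < gibbonD ν (n + 1) v := gibbonD_pos hν hm1 v
  have hDp : 0 < gibbonD ν (n + 1 + 1) v := gibbonD_pos hν (by omega) v
  -- Step 1: `X^{2m·m} ≤ X₁² · Xp^{2(m+1)(m−1)}` from the interpolation raised to the power `m`
  have hI := gibbonOmega_pow_interpolation hν hm hv
  have hm0 : (0 : ℝ) < (n + 1 : ℕ) := by positivity
  have hI2 : X ^ (2 * (n + 1) * (n + 1)) ≤ X₁ ^ (2 * 1) * Xp ^ (2 * (n + 1 + 1) * n) := by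
    have h := pow_le_pow_left₀ (pow_nonneg hX0.le _) hI (n + 1)
    rw [← pow_mul, mul_pow,
      pow_rpow_eq_pow' (pow_nonneg hX₁0.le _) (k := 1) (by rw [mul_one_div, div_self hm0.ne', Nat.cast_one]),
      pow_one, pow_rpow_eq_pow' (pow_nonneg hXp0.le _) (k := n)
        (by rw [mul_div_assoc', div_eq_iff hm0.ne']; push_cast; ring), ← pow_mul] at h
    exact h
  -- Step 2: translate to `D`'s: `D^{N+1} = (X/ν)^{2m²}`, `D₁ = (X₁/ν)²`, `Dp^N = (Xp/ν)^{2(m+1)(m−1)}`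
  have h43 : (4 : ℝ) * (n + 1 : ℕ) - 3 ≠ 0 := by push_cast; nlinarith
  have h41 : (4 : ℝ) * (n + 1 + 1 : ℕ) - 3 ≠ 0 := by push_cast; nlinarith
  have eα : (4 * (n : ℝ) + 1) * gibbonAlpha (n + 1) = 2 * (n + 1) := by
    unfold gibbonAlpha; rw [mul_div_assoc', div_eq_iff h43]; push_cast; ring
  have eαp : (4 * (n : ℝ) + 5) * gibbonAlpha (n + 1 + 1) = 2 * (n + 2) := by
    unfold gibbonAlpha; rw [mul_div_assoc', div_eq_iff h41]; push_cast; ring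
  have eNα : ((n * (4 * (n + 1) + 1) + 1 : ℕ) : ℝ) * gibbonAlpha (n + 1) =
      ((2 * (n + 1) * (n + 1) : ℕ) : ℝ) := by
    rw [show ((n * (4 * (n + 1) + 1) + 1 : ℕ) : ℝ) = ((n : ℝ) + 1) * (4 * n + 1) by push_cast; ring,
      mul_assoc, eα]
    push_cast; ring
  have eNαp : ((n * (4 * (n + 1) + 1) : ℕ) : ℝ) * gibbonAlpha (n + 1 + 1) =
      ((2 * (n + 1 + 1) * n : ℕ) : ℝ) := by
    rw [show ((n * (4 * (n + 1) + 1) : ℕ) : ℝ) = (n : ℝ) * (4 * n + 5) by push_cast; ring,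
      mul_assoc, eαp]
    push_cast; ring
  have eD : gibbonD ν (n + 1) v ^ (n * (4 * (n + 1) + 1) + 1) = (X / ν) ^ (2 * (n + 1) * (n + 1)) := by
    unfold gibbonD
    exact pow_rpow_eq_pow' (div_pos hX0 hν).le eNα
  have eD1 : gibbonD ν 1 v = (X₁ / ν) ^ (2 * 1) := by
    unfold gibbonD gibbonAlpha
    rw [← Real.rpow_natCast]
    congr 1
    push_cast; norm_num
  have eDp : gibbonD ν (n + 1 + 1) v ^ (n * (4 * (n + 1) + 1)) = (Xp / ν) ^ (2 * (n + 1 + 1) * n) := by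
    unfold gibbonD
    exact pow_rpow_eq_pow' (div_pos hXp0 hν).le eNαp
  -- Step 3: conclude
  rw [div_pow, div_le_div_iff₀ hD1 (pow_pos hD _)]
  calc gibbonD ν (n + 1) v * gibbonD ν (n + 1) v ^ (n * (4 * (n + 1) + 1))
      = gibbonD ν (n + 1) v ^ (n * (4 * (n + 1) + 1) + 1) := by ring
    _ = (X / ν) ^ (2 * (n + 1) * (n + 1)) := eD
    _ = X ^ (2 * (n + 1) * (n + 1)) / ν ^ (2 * (n + 1) * (n + 1)) := div_pow _ _ _
    _ ≤ X₁ ^ (2 * 1) * Xp ^ (2 * (n + 1 + 1) * n) / ν ^ (2 * (n + 1) * (n + 1)) :=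
        div_le_div_of_nonneg_right hI2 (pow_nonneg hν.le _)
    _ = (Xp / ν) ^ (2 * (n + 1 + 1) * n) * (X₁ / ν) ^ (2 * 1) := by
        rw [div_pow, div_pow, div_mul_div_comm, mul_comm (X₁ ^ (2 * 1)), ← pow_add]
        congr 2
        ring
    _ = gibbonD ν (n + 1 + 1) v ^ (n * (4 * (n + 1) + 1)) * gibbonD ν 1 v := by rw [eDp, eD1]

end VorticityMomentLadder

open VorticityMomentLadder in
/-- **The `Dₘ` ladder closed on its first rung (Gibbon et al. 2014, §2.3), `m > 1`:**
"`Ḋₘ ≤ Dₘ³{−ϖ_{1,m}(Dₘ/D₁)^{ηₘ} + ϖ_{2,m}} + ϖ_{3,m}Gr Dₘ^{(αₘ−1)/αₘ}`, `ηₘ = 2m/3(m−1)`" —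
THEOREM 2 (`exists_gibbonD_ladder`) combined with `Dₘ/D₁ ≤ (D_{m+1}/Dₘ)^{(m−1)(4m+1)}`
(`gibbonD_div_first_le_ratio_pow`), because `ρₘ/((m−1)(4m+1)) = ηₘ`. Typed for classical
solutions of the UNFORCED system (`Gr = 0`) on the unit torus (`ϖ₀ = ν`), natural `m ≥ 2`, as a
bound on every one-sided derivative value `R` of `s ↦ Dₘ(u(s))` within `[a, b]`.
DISCLOSURE (referee F88.1): under its display (s3) the 2014 print (arXiv:1402.1080, §2.3) writes
"`ρₘ = m(4m+1)`", whereas Gibbon 2012 (Thm 2) prints, and `gibbonRho` types, `ρₘ = ⅔m(4m+1)`;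
the 2014 print's own `ηₘ = 2m/3(m−1)` in (s5) equals `ρₘ/((m−1)(4m+1))` only for the `⅔` form
(with `m(4m+1)` it would be `m/(m−1)`), so the `⅔m(4m+1)` value used throughout this file is the
one consistent with both (s4)–(s5) and the 2012 theorem; nothing typed depends on the slip.
[cite: GibbonEtAl2014Nonlinearity, §2.3, the display `Ḋₘ ≤ Dₘ³{−ϖ_{1,m}(Dₘ/D₁)^{ηₘ} + ϖ_{2,m}} + …`
with `ηₘ = 2m/3(m−1)`] -/
theorem exists_gibbonD_ladder_firstRung (m : ℕ) (hm : 2 ≤ m) :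
    ∃ c₁ c₂ : ℝ, 0 < c₁ ∧ 0 ≤ c₂ ∧
      ∀ {a b ν : ℝ} {u : ℝ → UnitAddTorus (Fin 3) → EuclideanSpace ℝ (Fin 3)}
        {p : ℝ → UnitAddTorus (Fin 3) → ℝ},
        Torus.IsClassicalNSSolutionOn (Icc a b) ν 0 u p → a < b → 0 < ν →
        ∀ {t : ℝ}, t ∈ Icc a b → ∀ {R : ℝ},
          HasDerivWithinAt (fun s => gibbonD ν m (u s)) R (Icc a b) t →
          R ≤ gibbonD ν m (u t) ^ 3 *
            (-(ν * c₁ * (gibbonD ν m (u t) / gibbonD ν 1 (u t)) ^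
                (2 * (m : ℝ) / (3 * ((m : ℝ) - 1)))) + ν * c₂) := by
  have hm1 : 1 ≤ m := le_trans (by norm_num) hm
  obtain ⟨c₁, c₂, hc₁, hc₂, hlad⟩ := exists_gibbonD_ladder m hm1
  refine ⟨c₁, c₂, hc₁, hc₂, ?_⟩
  intro a b ν u p h hab hν t ht R hR
  have h1 := hlad h hab hν ht hR
  have hut : Torus.IsSmooth (u t) := h.smooth_velocity.isSmooth_slice ht
  have hm2 : (2 : ℝ) ≤ m := by exact_mod_cast hm
  have hm1' : (0 : ℝ) < (m : ℝ) - 1 := by linarith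
  have h3ne : (3 : ℝ) * ((m : ℝ) - 1) ≠ 0 := by positivity
  set D : ℝ := gibbonD ν m (u t) with hDdef
  set D₁ : ℝ := gibbonD ν 1 (u t) with hD₁def
  set Dp : ℝ := gibbonD ν (m + 1) (u t) with hDpdef
  have hD : 0 < D := gibbonD_pos hν hm1 (u t)
  have hD₁ : 0 < D₁ := gibbonD_pos hν le_rfl (u t)
  have hDp : 0 < Dp := gibbonD_pos hν (by omega) (u t)
  have hη : 0 ≤ 2 * (m : ℝ) / (3 * ((m : ℝ) - 1)) := by positivity
  have hratio : D / D₁ ≤ (Dp / D) ^ ((m - 1) * (4 * m + 1)) :=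
    gibbonD_div_first_le_ratio_pow hν hm hut
  have hc : (((m - 1) * (4 * m + 1) : ℕ) : ℝ) = ((m : ℝ) - 1) * (4 * m + 1) := by
    rw [Nat.cast_mul, Nat.cast_sub hm1]; push_cast; ring
  have e : (((m - 1) * (4 * m + 1) : ℕ) : ℝ) * (2 * (m : ℝ) / (3 * ((m : ℝ) - 1))) =
      gibbonRho m := by
    rw [hc, mul_div_assoc', div_eq_iff h3ne]
    unfold gibbonRho
    rw [div_mul_eq_mul_div, eq_div_iff (by norm_num : (3 : ℝ) ≠ 0)]
    ring
  have h2 : (D / D₁) ^ (2 * (m : ℝ) / (3 * ((m : ℝ) - 1))) ≤ (Dp / D) ^ gibbonRho m := by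
    have h3 := Real.rpow_le_rpow (div_nonneg hD.le hD₁.le) hratio hη
    rw [pow_rpow_eq_rpow_mul (div_nonneg hDp.le hD.le), e] at h3
    exact h3
  have h4 : -(ν * c₁ * (Dp / D) ^ gibbonRho m) + ν * c₂ ≤
      -(ν * c₁ * (D / D₁) ^ (2 * (m : ℝ) / (3 * ((m : ℝ) - 1)))) + ν * c₂ := by
    have := mul_le_mul_of_nonneg_left h2 (by positivity : 0 ≤ ν * c₁)
    linarith
  calc R ≤ D ^ 3 * (-(ν * c₁ * (Dp / D) ^ gibbonRho m) + ν * c₂) := h1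
    _ ≤ D ^ 3 * (-(ν * c₁ * (D / D₁) ^ (2 * (m : ℝ) / (3 * ((m : ℝ) - 1)))) + ν * c₂) :=
        mul_le_mul_of_nonneg_left h4 (pow_nonneg hD.le 3)

open VorticityMomentLadder in
/-- **Regime III (Gibbon et al. 2014, §2.3): `Cₘ D₁ < Dₘ` forces decay.** "Regime III :
`Cₘ D₁ < Dₘ` … Clearly, in regime III the combination of terms within the braces is negative and
can be neglected. … In the unforced case, the `Dₘ` always decay", where
`Cₘ^{ηₘ} = ϖ_{2,m}/ϖ_{1,m}`. Typed: for every natural `m ≥ 2` there is `C ≥ 0` (here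
`C = (c₂/c₁)^{1/ηₘ}`) such that along every classical solution of the unforced system on
`𝕋³ × [a, b]` (`ν > 0`), at every instant with `C·D₁(t) ≤ Dₘ(t)` every one-sided derivative
value of `s ↦ Dₘ(u(s))` within `[a, b]` is `≤ 0` (from `exists_gibbonD_ladder_firstRung`).
[cite: GibbonEtAl2014Nonlinearity, §2.3, Regime III] -/
theorem exists_gibbonD_deriv_nonpos_of_mul_first_le (m : ℕ) (hm : 2 ≤ m) :
    ∃ C : ℝ, 0 ≤ C ∧
      ∀ {a b ν : ℝ} {u : ℝ → UnitAddTorus (Fin 3) → EuclideanSpace ℝ (Fin 3)}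
        {p : ℝ → UnitAddTorus (Fin 3) → ℝ},
        Torus.IsClassicalNSSolutionOn (Icc a b) ν 0 u p → a < b → 0 < ν →
        ∀ {t : ℝ}, t ∈ Icc a b →
          C * gibbonD ν 1 (u t) ≤ gibbonD ν m (u t) → ∀ {R : ℝ},
          HasDerivWithinAt (fun s => gibbonD ν m (u s)) R (Icc a b) t → R ≤ 0 := by
  obtain ⟨c₁, c₂, hc₁, hc₂, hlad⟩ := exists_gibbonD_ladder_firstRung m hm
  have hm1 : 1 ≤ m := le_trans (by norm_num) hm
  have hm2 : (2 : ℝ) ≤ m := by exact_mod_cast hm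
  have hm1' : (0 : ℝ) < (m : ℝ) - 1 := by linarith
  set η : ℝ := 2 * (m : ℝ) / (3 * ((m : ℝ) - 1)) with hηdef
  have hη : 0 < η := by positivity
  -- threshold `C = (c₂/c₁)^{1/η}`
  refine ⟨(c₂ / c₁) ^ (1 / η), Real.rpow_nonneg (div_nonneg hc₂ hc₁.le) _, ?_⟩
  intro a b ν u p h hab hν t ht hcrit R hR
  have h1 := hlad h hab hν ht hR
  set D : ℝ := gibbonD ν m (u t) with hDdef
  set D₁ : ℝ := gibbonD ν 1 (u t) with hD₁def
  have hD : 0 < D := gibbonD_pos hν hm1 (u t)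
  have hD₁ : 0 < D₁ := gibbonD_pos hν le_rfl (u t)
  have hratio : (c₂ / c₁) ^ (1 / η) ≤ D / D₁ := by
    rw [le_div_iff₀ hD₁]; exact hcrit
  have h2 : c₂ / c₁ ≤ (D / D₁) ^ η := by
    have h3 := Real.rpow_le_rpow (Real.rpow_nonneg (div_nonneg hc₂ hc₁.le) _) hratio hη.le
    rw [← Real.rpow_mul (div_nonneg hc₂ hc₁.le), one_div_mul_cancel hη.ne', Real.rpow_one] at h3
    exact h3
  have h4 : ν * c₂ ≤ ν * c₁ * (D / D₁) ^ η := by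
    have : c₂ ≤ c₁ * (D / D₁) ^ η := by
      rw [div_le_iff₀ hc₁] at h2; linarith [h2]
    nlinarith [hν.le]
  have h5 : -(ν * c₁ * (D / D₁) ^ η) + ν * c₂ ≤ 0 := by linarith
  calc R ≤ D ^ 3 * (-(ν * c₁ * (D / D₁) ^ η) + ν * c₂) := h1
    _ ≤ 0 := mul_nonpos_of_nonneg_of_nonpos (pow_nonneg hD.le 3) h5

/-! ### §10 Gibbon 2012, Lemma 1: the `ε`-family of time-integral criteria -/

namespace VorticityMomentLadder

/-- A function continuous on `[a, b]` is in every `Lᵖ` of Lebesgue measure restricted to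
`(a, t]`, `t ≤ b` (bounded on a set of finite measure). [folklore] -/
private theorem memLp_restrict_Ioc_of_continuousOn {f : ℝ → ℝ} {a b t : ℝ}
    (hf : ContinuousOn f (Icc a b)) (ht : t ≤ b) (q : ENNReal) :
    MemLp f q (volume.restrict (Ioc a t)) := by
  obtain ⟨C, hC⟩ := (isCompact_Icc (a := a) (b := t)).exists_bound_of_continuousOn
    (hf.mono (Icc_subset_Icc_right ht))
  haveI : IsFiniteMeasure (volume.restrict (Ioc a t)) :=
    isFiniteMeasure_restrict.2 (by rw [Real.volume_Ioc]; exact ENNReal.ofReal_ne_top)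
  have hmeas : AEStronglyMeasurable f (volume.restrict (Ioc a t)) :=
    ((hf.mono (Icc_subset_Icc_right ht)).mono Ioc_subset_Icc_self).aestronglyMeasurable
      measurableSet_Ioc
  exact (memLp_top_of_bound hmeas C (ae_restrict_of_forall_mem measurableSet_Ioc
    fun x hx => hC x (Ioc_subset_Icc_self hx))).mono_exponent le_top

end VorticityMomentLadder

open VorticityMomentLadder in
/-- **Gibbon 2012, LEMMA 1 (the `ε`-family of time-integral criteria).** "For any value of
`1 ≤ m < ∞` and `ε` uniform in the range `0 < ε < 2`, if the integral condition
`∫₀ᵗ D_{m+1}^ε dτ ≥ c_{ε,ρₘ} ∫₀ᵗ Dₘ^ε dτ`, `c_{ε,ρₘ} = [c_{1,m}c_{2,m}]^{ε/ρₘ}`, is satisfied, then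
`Dₘ(t) ≤ Dₘ(0)`." Typed on the unit torus for classical solutions of the unforced system
(`ν > 0`) on a window `[a, b]`: for every natural `m ≥ 1` there is `K ≥ 0` (here `K = c₂/c₁` with
`c₁, c₂` the constants of `exists_gibbonD_ladder`, so that `c_{ε,ρₘ} = K^{ε/ρₘ}`) such that for
every `0 < ε < 2`, `K^{ε/ρₘ} ∫ₐᵗ Dₘ^ε ≤ ∫ₐᵗ D_{m+1}^ε` implies `Dₘ(t) ≤ Dₘ(a)`. The proof is the
printed one: divide the ladder by `Dₘ^{3−ε}` and integrate (`G = Dₘ^{ε−2}` has one-sided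
derivative `≥ (2−ε)Dₘ^ε(νc₁Zₘ^{ρₘ} − νc₂)`), then Hölder in time with exponents
`(ρₘ/ε, ρₘ/(ρₘ−ε))`: `∫D_{m+1}^ε ≤ (∫Zₘ^{ρₘ}Dₘ^ε)^{ε/ρₘ}(∫Dₘ^ε)^{1−ε/ρₘ}`.
[cite: Gibbon2012JMP, §2.1, Lemma 1 with its proof (arXiv:1108.4651, p. 5)] -/
theorem exists_gibbonD_le_initial_of_integral_rpow_le (m : ℕ) (hm : 1 ≤ m) :
    ∃ K : ℝ, 0 ≤ K ∧
      ∀ {ε : ℝ}, 0 < ε → ε < 2 →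
      ∀ {a b ν : ℝ} {u : ℝ → UnitAddTorus (Fin 3) → EuclideanSpace ℝ (Fin 3)}
        {p : ℝ → UnitAddTorus (Fin 3) → ℝ},
        Torus.IsClassicalNSSolutionOn (Icc a b) ν 0 u p → a < b → 0 < ν →
        ∀ {t : ℝ}, t ∈ Icc a b →
          K ^ (ε / gibbonRho m) * ∫ τ in a..t, gibbonD ν m (u τ) ^ ε ≤
              ∫ τ in a..t, gibbonD ν (m + 1) (u τ) ^ ε →
          gibbonD ν m (u t) ≤ gibbonD ν m (u a) := by
  obtain ⟨c₁, c₂, hc₁, hc₂, hlad⟩ := exists_gibbonD_ladder m hm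
  have hm1 : (1 : ℝ) ≤ m := by exact_mod_cast hm
  set ρ : ℝ := gibbonRho m with hρdef
  have hρ2 : 2 < ρ := by
    rw [hρdef]; unfold gibbonRho; nlinarith
  refine ⟨c₂ / c₁, div_nonneg hc₂ hc₁.le, ?_⟩
  intro ε hε hε2 a b ν u p h hab hν t ht hint
  rcases eq_or_lt_of_le ht.1 with hta | hta
  · rw [hta]
  have hρ0 : 0 < ρ := by linarith
  have hερ : ε < ρ := by linarith
  have hK0 : 0 ≤ c₂ / c₁ := div_nonneg hc₂ hc₁.le
  -- notation along the solution
  set D : ℝ → ℝ := fun s => gibbonD ν m (u s) with hDdef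
  set Dp : ℝ → ℝ := fun s => gibbonD ν (m + 1) (u s) with hDpdef
  set D' : ℝ → ℝ := fun s => derivWithin D (Icc a b) s with hD'def
  have hDpos : ∀ s, 0 < D s := fun s => gibbonD_pos hν hm (u s)
  have hDppos : ∀ s, 0 < Dp s := fun s => gibbonD_pos hν (Nat.le_succ_of_le hm) (u s)
  have hDder : ∀ s ∈ Icc a b, HasDerivWithinAt D (D' s) (Icc a b) s := fun s hs =>
    hasDerivWithinAt_gibbonD_derivWithin h hab hν hm hs
  have hDcont : ContinuousOn D (Icc a b) := continuousOn_gibbonD h hab hν hm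
  have hDpcont : ContinuousOn Dp (Icc a b) := continuousOn_gibbonD h hab hν (Nat.le_succ_of_le hm)
  set Z : ℝ → ℝ := fun s => Dp s / D s with hZdef
  have hZnn : ∀ s, 0 ≤ Z s := fun s => div_nonneg (hDppos s).le (hDpos s).le
  have hZcont : ContinuousOn Z (Icc a b) := hDpcont.div hDcont fun s _ => (hDpos s).ne'
  have hZρcont : ContinuousOn (fun s => Z s ^ ρ) (Icc a b) :=
    hZcont.rpow_const fun s _ => Or.inr hρ0.le
  have hDεcont : ContinuousOn (fun s => D s ^ ε) (Icc a b) :=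
    hDcont.rpow_const fun s _ => Or.inr hε.le
  have hDpεcont : ContinuousOn (fun s => Dp s ^ ε) (Icc a b) :=
    hDpcont.rpow_const fun s _ => Or.inr hε.le
  have hZDcont : ContinuousOn (fun s => Z s ^ ρ * D s ^ ε) (Icc a b) := hZρcont.mul hDεcont
  -- THEOREM 2 at every instant
  have hT2 : ∀ s ∈ Icc a b, D' s ≤ D s ^ 3 * (-(ν * c₁ * Z s ^ ρ) + ν * c₂) :=
    fun s hs => hlad h hab hν hs (hDder s hs)
  -- `G = Dₘ^{ε−2}`, its one-sided derivative, and the lower bound `φ ≤ G'`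
  set G : ℝ → ℝ := fun s => D s ^ (ε - 2) with hGdef
  set G' : ℝ → ℝ := fun s => D' s * (ε - 2) * D s ^ (ε - 2 - 1) with hG'def
  have hGder : ∀ s ∈ Icc a b, HasDerivWithinAt G (G' s) (Icc a b) s := fun s hs =>
    (hDder s hs).rpow_const (Or.inl (hDpos s).ne')
  have hGcont : ContinuousOn G (Icc a b) := fun s hs => (hGder s hs).continuousWithinAt
  set φ : ℝ → ℝ := fun s => (2 - ε) * (ν * c₁ * (Z s ^ ρ * D s ^ ε) - ν * c₂ * D s ^ ε) with hφdef
  have hφG : ∀ s ∈ Icc a b, φ s ≤ G' s := by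
    intro s hs
    have hDs := hDpos s
    have hfac : 0 ≤ (2 - ε) * D s ^ (ε - 2 - 1) := by
      have := Real.rpow_nonneg hDs.le (ε - 2 - 1); nlinarith
    have h1 := mul_le_mul_of_nonneg_right (hT2 s hs) hfac
    have eε : D s ^ 3 * D s ^ (ε - 2 - 1) = D s ^ ε := by
      rw [← Real.rpow_natCast (D s) 3, ← Real.rpow_add hDs]; congr 1; push_cast; ring
    have e2 : D s ^ 3 * (-(ν * c₁ * Z s ^ ρ) + ν * c₂) * ((2 - ε) * D s ^ (ε - 2 - 1)) =
        -φ s := by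
      simp only [hφdef]
      rw [show D s ^ 3 * (-(ν * c₁ * Z s ^ ρ) + ν * c₂) * ((2 - ε) * D s ^ (ε - 2 - 1)) =
        (2 - ε) * (-(ν * c₁ * Z s ^ ρ) + ν * c₂) * (D s ^ 3 * D s ^ (ε - 2 - 1)) by ring, eε]
      ring
    have e3 : D' s * ((2 - ε) * D s ^ (ε - 2 - 1)) = -G' s := by
      simp only [hG'def]; ring
    rw [e2, e3] at h1
    linarith
  have hφcont : ContinuousOn φ (Icc a b) :=
    continuousOn_const.mul ((continuousOn_const.mul hZDcont).sub (continuousOn_const.mul hDεcont))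
  -- (a) FTC on `[a, t]`
  have htI : Icc a t ⊆ Icc a b := Icc_subset_Icc_right ht.2
  have hFTC : (∫ y in a..t, φ y) ≤ G t - G a :=
    intervalIntegral.integral_le_sub_of_hasDeriv_right_of_le ht.1 (hGcont.mono htI)
      (fun x hx => ((hGder x ⟨hx.1.le, hx.2.le.trans ht.2⟩).hasDerivAt
          (Icc_mem_nhds hx.1 (hx.2.trans_le ht.2))).hasDerivWithinAt)
      (hφcont.mono htI).integrableOn_Icc (fun x hx => hφG x ⟨hx.1.le, hx.2.le.trans ht.2⟩)
  -- (b) Hölder in time: `0 ≤ ∫ₐᵗ φ`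
  have hpos : 0 ≤ ∫ y in a..t, φ y := by
    have hioc : ∀ {g : ℝ → ℝ}, ContinuousOn g (Icc a b) → IntegrableOn g (Ioc a t) :=
      fun hg => ((hg.mono htI).integrableOn_Icc).mono_set Ioc_subset_Icc_self
    have hint' : (c₂ / c₁) ^ (ε / ρ) * ∫ s in Ioc a t, D s ^ ε ≤ ∫ s in Ioc a t, Dp s ^ ε := by
      rw [intervalIntegral.integral_of_le ht.1, intervalIntegral.integral_of_le ht.1] at hint
      exact hint
    rw [intervalIntegral.integral_of_le ht.1]
    set P : ℝ := ∫ s in Ioc a t, Z s ^ ρ * D s ^ ε with hPdef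
    set Q : ℝ := ∫ s in Ioc a t, D s ^ ε with hQdef
    have hP0 : 0 ≤ P := setIntegral_nonneg measurableSet_Ioc fun s _ =>
      mul_nonneg (Real.rpow_nonneg (hZnn s) _) (Real.rpow_nonneg (hDpos s).le _)
    have hQ0 : 0 ≤ Q := setIntegral_nonneg measurableSet_Ioc fun s _ =>
      Real.rpow_nonneg (hDpos s).le _
    -- Hölder: `∫ Dp^ε ≤ P^{ε/ρ} Q^{1−ε/ρ}`
    have hpq : Real.HolderConjugate (ρ / ε) (ρ / (ρ - ε)) :=
      { inv_add_inv_eq_inv := by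
          rw [inv_one, inv_div, inv_div, ← add_div, div_eq_iff hρ0.ne']; ring
        left_pos := div_pos hρ0 hε
        right_pos := div_pos hρ0 (by linarith) }
    set f : ℝ → ℝ := fun s => (Z s ^ ρ * D s ^ ε) ^ (ε / ρ) with hfdef
    set g : ℝ → ℝ := fun s => (D s ^ ε) ^ (1 - ε / ρ) with hgdef
    have hZD0 : ∀ s, 0 ≤ Z s ^ ρ * D s ^ ε := fun s =>
      mul_nonneg (Real.rpow_nonneg (hZnn s) _) (Real.rpow_nonneg (hDpos s).le _)
    have hf0 : ∀ s, 0 ≤ f s := fun s => Real.rpow_nonneg (hZD0 s) _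
    have hg0 : ∀ s, 0 ≤ g s := fun s => Real.rpow_nonneg (Real.rpow_nonneg (hDpos s).le _) _
    have hfcont : ContinuousOn f (Icc a b) := hZDcont.rpow_const fun s _ => Or.inr (by positivity)
    have hgcont : ContinuousOn g (Icc a b) :=
      hDεcont.rpow_const fun s _ => Or.inr (by rw [sub_nonneg, div_le_one hρ0]; exact hερ.le)
    have hH := integral_mul_le_Lp_mul_Lq_of_nonneg (μ := volume.restrict (Ioc a t)) hpq
      (f := f) (g := g) (ae_of_all _ hf0) (ae_of_all _ hg0)
      (memLp_restrict_Ioc_of_continuousOn hfcont ht.2 _)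
      (memLp_restrict_Ioc_of_continuousOn hgcont ht.2 _)
    have efg : ∀ s, f s * g s = Dp s ^ ε := by
      intro s
      have hDs := hDpos s
      simp only [hfdef, hgdef]
      rw [Real.mul_rpow (Real.rpow_nonneg (hZnn s) _) (Real.rpow_nonneg hDs.le _),
        ← Real.rpow_mul (hZnn s), ← Real.rpow_mul hDs.le, ← Real.rpow_mul hDs.le,
        mul_div_cancel₀ _ hρ0.ne', mul_assoc, ← Real.rpow_add hDs,
        show ε * (ε / ρ) + ε * (1 - ε / ρ) = ε by ring,
        ← Real.mul_rpow (hZnn s) hDs.le]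
      simp only [hZdef]
      rw [div_mul_cancel₀ _ hDs.ne']
    have ef : ∀ s, f s ^ (ρ / ε) = Z s ^ ρ * D s ^ ε := by
      intro s
      simp only [hfdef]
      rw [← Real.rpow_mul (hZD0 s), div_mul_div_comm, mul_comm ε ρ,
        div_self (mul_ne_zero hρ0.ne' hε.ne'), Real.rpow_one]
    have eg : ∀ s, g s ^ (ρ / (ρ - ε)) = D s ^ ε := by
      intro s
      simp only [hgdef]
      rw [← Real.rpow_mul (Real.rpow_nonneg (hDpos s).le _),
        show (1 - ε / ρ) * (ρ / (ρ - ε)) = 1 by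
          rw [one_sub_div hρ0.ne', div_mul_div_comm, mul_comm, div_self]
          exact mul_ne_zero hρ0.ne' (by linarith : ρ - ε ≠ 0),
        Real.rpow_one]
    have e1 : 1 / (ρ / ε) = ε / ρ := one_div_div _ _
    have e2 : 1 / (ρ / (ρ - ε)) = 1 - ε / ρ := by rw [one_div_div, one_sub_div hρ0.ne']
    rw [show (fun s => f s * g s) = fun s => Dp s ^ ε from funext efg,
      show (fun s => f s ^ (ρ / ε)) = fun s => Z s ^ ρ * D s ^ ε from funext ef,
      show (fun s => g s ^ (ρ / (ρ - ε))) = fun s => D s ^ ε from funext eg, e1, e2] at hH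
    -- `hH : ∫ Dp^ε ≤ P^{ε/ρ} * Q^{1−ε/ρ}`; combine with the hypothesis
    have hKQ : c₂ / c₁ * Q ≤ P := by
      rcases eq_or_lt_of_le hQ0 with hQz | hQpos
      · rw [← hQz, mul_zero]; exact hP0
      have h1 : (c₂ / c₁) ^ (ε / ρ) * Q ≤ P ^ (ε / ρ) * Q ^ (1 - ε / ρ) := hint'.trans hH
      have h2 : Q ^ (ε / ρ) * Q ^ (1 - ε / ρ) = Q := by
        rw [← Real.rpow_add hQpos, show ε / ρ + (1 - ε / ρ) = 1 by ring, Real.rpow_one]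
      have h1' : (c₂ / c₁) ^ (ε / ρ) * Q ^ (ε / ρ) * Q ^ (1 - ε / ρ) ≤
          P ^ (ε / ρ) * Q ^ (1 - ε / ρ) := by
        rw [mul_assoc, h2]; exact h1
      have h3 : (c₂ / c₁) ^ (ε / ρ) * Q ^ (ε / ρ) ≤ P ^ (ε / ρ) :=
        le_of_mul_le_mul_right h1' (Real.rpow_pos_of_pos hQpos _)
      rw [← Real.mul_rpow hK0 hQ0] at h3
      exact (Real.rpow_le_rpow_iff (mul_nonneg hK0 hQ0) hP0 (div_pos hε hρ0)).1 h3
    -- `∫ φ = (2 − ε)(νc₁P − νc₂Q) ≥ 0`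
    have hφval : ∫ s in Ioc a t, φ s = (2 - ε) * (ν * c₁ * P - ν * c₂ * Q) := by
      simp only [hφdef, hPdef, hQdef]
      rw [integral_const_mul, integral_sub ((hioc hZDcont).const_mul _) ((hioc hDεcont).const_mul _),
        integral_const_mul, integral_const_mul]
    rw [hφval]
    have hc2 : ν * c₂ * Q ≤ ν * c₁ * P := by
      have : c₂ * Q ≤ c₁ * P := by
        have := mul_le_mul_of_nonneg_left hKQ hc₁.le
        rwa [← mul_assoc, mul_div_cancel₀ _ hc₁.ne'] at this
      nlinarith [hν.le]
    have : 0 ≤ 2 - ε := by linarith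
    exact mul_nonneg this (by linarith)
  -- (c) conclusion: `Dₘ(a)^{ε−2} ≤ Dₘ(t)^{ε−2}` with `ε − 2 < 0`
  have hG : G a ≤ G t := by linarith [hFTC, hpos]
  exact (Real.rpow_le_rpow_iff_of_neg (hDpos a) (hDpos t) (by linarith)).1 hG

/-! ### §11 The enstrophy stretching term in the `D₁–Dₘ` plane (Gibbon et al. 2014, §3.1) -/

namespace VorticityMomentLadder

/-- **The vortex-stretching term of the enstrophy balance against `J₁` and `Jₘ`**
(Gibbon et al. 2014, §3.1, the display before (ξ_{m,λ})): "`∫|∇u||ω|² dV =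
∫|ω|^{(2m−3)/(m−1)}|ω|^{1/(m−1)}|∇u| dV ≤ (∫|ω|²)^{(2m−3)/2(m−1)} (∫|ω|^{2m})^{1/2m(m−1)}
(∫|∇u|^{2m})^{1/2m} ≤ cₘ (∫|ω|²)^{(2m−3)/2(m−1)} (∫|ω|^{2m})^{1/2(m−1)}`, `1 < m < ∞`, based on
`‖∇u‖_p ≤ c_p‖ω‖_p`". Typed on `𝕋³` for smooth divergence-free fields and natural `m ≥ 2`, with
the stretching density `σ` (`|σ| ≤ |ω|²|∇u|`, `abs_torusStretchingDensity_le_mul_sqrt`):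
`∫σ ≤ K (∫|ω|²)^{(2m−3)/(2m−2)} (∫|ω|^{2m})^{1/(2m−2)}` (two Hölder inequalities and
`exists_integral_gradSq_pow_le`). [cite: GibbonEtAl2014Nonlinearity, §3.1, the three-line display
ending `= cₘL³ϖ₀³ D₁^{(2m−3)/(2m−2)} Dₘ^{(4m−3)/(2m−2)}, 1 < m < ∞`] -/
theorem exists_integral_stretching_le_rpow_mul_rpow (m : ℕ) (hm : 2 ≤ m) :
    ∃ K : ℝ, 0 ≤ K ∧ ∀ v : UnitAddTorus (Fin 3) → EuclideanSpace ℝ (Fin 3), Torus.IsSmooth v →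
      Torus.IsDivFree v →
      ∫ x, torusStretchingDensity v x ≤
        K * (∫ x, torusVorticitySqAt v x) ^ ((2 * (m : ℝ) - 3) / (2 * m - 2)) *
          (∫ x, torusVorticitySqAt v x ^ m) ^ ((1 : ℝ) / (2 * m - 2)) := by
  obtain ⟨K, hK0, hK⟩ := exists_integral_gradSq_pow_le m (by omega)
  refine ⟨K ^ ((1 : ℝ) / (2 * m)), Real.rpow_nonneg hK0 _, fun v hv hdiv => ?_⟩
  set G : UnitAddTorus (Fin 3) → ℝ := fun x => Real.sqrt (∑ j, ‖Torus.partialDeriv j v x‖ ^ 2)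
    with hG
  set A : UnitAddTorus (Fin 3) → ℝ := fun x => torusVorticitySqAt v x with hA
  have hG0 : ∀ x, 0 ≤ G x := fun x => Real.sqrt_nonneg _
  have hA0 : ∀ x, 0 ≤ A x := fun x => torusVorticitySqAt_nonneg v x
  have hAc : Continuous A := (isSmooth_Q hv).continuous
  have hGc : Continuous G := continuous_sqrt_gradSq hv
  have hσc : Continuous (torusStretchingDensity v) := (isSmooth_σ hv).continuous
  have hv1 : Torus.IsContDiff 1 v := hv.isContDiff (by simp)
  have hm2 : (2 : ℝ) ≤ m := by exact_mod_cast hm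
  have hm0 : (0 : ℝ) < m := by linarith
  have hm1 : (0 : ℝ) < (m : ℝ) - 1 := by linarith
  have h23 : (0 : ℝ) < 2 * (m : ℝ) - 3 := by linarith
  have h22 : (0 : ℝ) < 2 * (m : ℝ) - 2 := by linarith
  have hc2 : ((2 * m - 2 : ℕ) : ℝ) = 2 * (m : ℝ) - 2 := by
    rw [Nat.cast_sub (by omega), Nat.cast_mul]; push_cast; ring
  set J1 : ℝ := ∫ x, A x with hJ1
  set Jm : ℝ := ∫ x, A x ^ m with hJm
  have hJ10 : 0 ≤ J1 := integral_nonneg fun x => hA0 x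
  have hJm0 : 0 ≤ Jm := integral_nonneg fun x => pow_nonneg (hA0 x) _
  -- (i) `∫ σ ≤ ∫ A G`
  have h1 : ∫ x, torusStretchingDensity v x ≤ ∫ x, A x * G x := by
    refine integral_mono (integrable_of_continuous hσc)
      (integrable_of_continuous (hAc.mul hGc)) fun x => ?_
    exact (le_abs_self _).trans (abs_torusStretchingDensity_le_mul_sqrt hv1 hdiv x)
  -- (ii) Hölder `((2m−2)/(2m−3), 2m−2)`: `∫ A G ≤ J1^{(2m−3)/(2m−2)} (∫ A G^{2m−2})^{1/(2m−2)}`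
  have hpq1 : Real.HolderConjugate ((2 * (m : ℝ) - 2) / (2 * m - 3)) (2 * (m : ℝ) - 2) :=
    { inv_add_inv_eq_inv := by
        rw [inv_one, inv_div, inv_eq_one_div, ← add_div, div_eq_iff h22.ne']; ring
      left_pos := div_pos h22 h23
      right_pos := h22 }
  have ha0 : (0 : ℝ) ≤ (2 * (m : ℝ) - 3) / (2 * m - 2) := (div_pos h23 h22).le
  have hb0 : (0 : ℝ) ≤ 1 / (2 * (m : ℝ) - 2) := (div_pos one_pos h22).le
  have h2 : ∫ x, A x * G x ≤
      J1 ^ ((2 * (m : ℝ) - 3) / (2 * m - 2)) *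
        (∫ x, A x * G x ^ (2 * m - 2)) ^ ((1 : ℝ) / (2 * m - 2)) := by
    set f : UnitAddTorus (Fin 3) → ℝ := fun x => A x ^ ((2 * (m : ℝ) - 3) / (2 * m - 2)) with hf
    set g : UnitAddTorus (Fin 3) → ℝ := fun x => A x ^ ((1 : ℝ) / (2 * m - 2)) * G x with hg
    have hf0 : ∀ x, 0 ≤ f x := fun x => Real.rpow_nonneg (hA0 x) _
    have hg0 : ∀ x, 0 ≤ g x := fun x => mul_nonneg (Real.rpow_nonneg (hA0 x) _) (hG0 x)
    have hfc : Continuous f := hAc.rpow_const fun x => Or.inr ha0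
    have hgc : Continuous g := (hAc.rpow_const fun x => Or.inr hb0).mul hGc
    have hH := integral_mul_le_Lp_mul_Lq_of_nonneg (μ := volume) hpq1 (f := f) (g := g)
      (ae_of_all _ hf0) (ae_of_all _ hg0) (memLp_of_continuous hfc _) (memLp_of_continuous hgc _)
    have e0 : (fun x => f x * g x) = fun x => A x * G x := by
      funext x
      simp only [hf, hg]
      rw [← mul_assoc, ← Real.rpow_add_of_nonneg (hA0 x) ha0 hb0,
        show (2 * (m : ℝ) - 3) / (2 * m - 2) + 1 / (2 * m - 2) = 1 by
          rw [← add_div, div_eq_iff h22.ne']; ring, Real.rpow_one]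
    have e1 : (fun x => f x ^ ((2 * (m : ℝ) - 2) / (2 * m - 3))) = fun x => A x := by
      funext x
      simp only [hf]
      rw [← Real.rpow_mul (hA0 x), div_mul_div_comm, mul_comm (2 * (m : ℝ) - 3),
        div_self (mul_ne_zero h22.ne' h23.ne'), Real.rpow_one]
    have e2 : (fun x => g x ^ (2 * (m : ℝ) - 2)) = fun x => A x * G x ^ (2 * m - 2) := by
      funext x
      simp only [hg]
      rw [Real.mul_rpow (Real.rpow_nonneg (hA0 x) _) (hG0 x), ← Real.rpow_mul (hA0 x),
        one_div_mul_cancel h22.ne', Real.rpow_one, ← hc2, Real.rpow_natCast]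
    have e3 : (1 : ℝ) / ((2 * (m : ℝ) - 2) / (2 * m - 3)) = (2 * (m : ℝ) - 3) / (2 * m - 2) :=
      one_div_div _ _
    rw [e0, e1, e2, e3] at hH
    exact hH
  -- (iii) Hölder `(m, m/(m−1))`: `∫ A G^{2m−2} ≤ Jm^{1/m} (∫ G^{2m})^{(m−1)/m}`
  have hpq2 : Real.HolderConjugate (m : ℝ) ((m : ℝ) / (m - 1)) :=
    { inv_add_inv_eq_inv := by
        rw [inv_one, inv_div, inv_eq_one_div, ← add_div, div_eq_iff hm0.ne']; ring
      left_pos := hm0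
      right_pos := div_pos hm0 hm1 }
  have h3 : ∫ x, A x * G x ^ (2 * m - 2) ≤
      Jm ^ ((1 : ℝ) / m) * (∫ x, G x ^ (2 * m)) ^ (((m : ℝ) - 1) / m) := by
    have hH := integral_mul_le_Lp_mul_Lq_of_nonneg (μ := volume) hpq2
      (f := fun x => A x) (g := fun x => G x ^ (2 * m - 2))
      (ae_of_all _ fun x => hA0 x) (ae_of_all _ fun x => pow_nonneg (hG0 x) _)
      (memLp_of_continuous hAc _) (memLp_of_continuous (hGc.pow _) _)
    have e1 : (∫ x, A x ^ (m : ℝ)) = Jm :=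
      integral_congr_ae (ae_of_all _ fun x => by simp only [Real.rpow_natCast])
    have e2 : (∫ x, (G x ^ (2 * m - 2)) ^ ((m : ℝ) / (m - 1))) = ∫ x, G x ^ (2 * m) :=
      integral_congr_ae (ae_of_all _ fun x => by
        dsimp only
        rw [pow_rpow_eq_pow (hG0 x) (k := 2 * m)
          (by rw [hc2, mul_div_assoc', div_eq_iff hm1.ne']; push_cast; ring)])
    have e3 : (1 : ℝ) / ((m : ℝ) / (m - 1)) = ((m : ℝ) - 1) / m := one_div_div _ _
    rw [show (fun x => A x * G x ^ (2 * m - 2)) = fun x => A x * G x ^ (2 * m - 2) from rfl] at hH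
    rw [e1, e2, e3] at hH
    simpa only [one_div] using hH
  -- (iv) Calderón–Zygmund: `∫ G^{2m} ≤ K Jm`
  have h4 : ∫ x, G x ^ (2 * m) ≤ K * Jm := hK v hv hdiv
  have hI0 : 0 ≤ ∫ x, G x ^ (2 * m) := integral_nonneg fun x => pow_nonneg (hG0 x) _
  have hI1 : 0 ≤ ∫ x, A x * G x ^ (2 * m - 2) :=
    integral_nonneg fun x => mul_nonneg (hA0 x) (pow_nonneg (hG0 x) _)
  -- (v) assemble
  have h5 : ∫ x, A x * G x ^ (2 * m - 2) ≤ K ^ (((m : ℝ) - 1) / m) * Jm := by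
    have h41 : (∫ x, G x ^ (2 * m)) ^ (((m : ℝ) - 1) / m) ≤ (K * Jm) ^ (((m : ℝ) - 1) / m) :=
      Real.rpow_le_rpow hI0 h4 (div_pos hm1 hm0).le
    have hsum : (1 : ℝ) / m + ((m : ℝ) - 1) / m = 1 := by
      rw [← add_div, div_eq_iff hm0.ne']; ring
    calc ∫ x, A x * G x ^ (2 * m - 2)
        ≤ Jm ^ ((1 : ℝ) / m) * (∫ x, G x ^ (2 * m)) ^ (((m : ℝ) - 1) / m) := h3
      _ ≤ Jm ^ ((1 : ℝ) / m) * (K * Jm) ^ (((m : ℝ) - 1) / m) :=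
          mul_le_mul_of_nonneg_left h41 (Real.rpow_nonneg hJm0 _)
      _ = K ^ (((m : ℝ) - 1) / m) * (Jm ^ ((1 : ℝ) / m) * Jm ^ (((m : ℝ) - 1) / m)) := by
          rw [Real.mul_rpow hK0 hJm0]; ring
      _ = K ^ (((m : ℝ) - 1) / m) * Jm := by
          rw [← Real.rpow_add_of_nonneg hJm0 (by positivity) (div_pos hm1 hm0).le, hsum,
            Real.rpow_one]
  have hKm0 : 0 ≤ K ^ (((m : ℝ) - 1) / m) := Real.rpow_nonneg hK0 _
  have h6 : (∫ x, A x * G x ^ (2 * m - 2)) ^ ((1 : ℝ) / (2 * m - 2)) ≤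
      K ^ ((1 : ℝ) / (2 * m)) * Jm ^ ((1 : ℝ) / (2 * m - 2)) := by
    have h61 := Real.rpow_le_rpow hI1 h5 hb0
    rw [Real.mul_rpow hKm0 hJm0, ← Real.rpow_mul hK0,
      show ((m : ℝ) - 1) / m * (1 / (2 * m - 2)) = 1 / (2 * m) by
        rw [div_mul_div_comm, mul_one, div_eq_div_iff (mul_ne_zero hm0.ne' h22.ne')
          (mul_ne_zero two_ne_zero hm0.ne')]
        ring] at h61
    exact h61
  calc ∫ x, torusStretchingDensity v x ≤ ∫ x, A x * G x := h1
    _ ≤ J1 ^ ((2 * (m : ℝ) - 3) / (2 * m - 2)) *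
          (∫ x, A x * G x ^ (2 * m - 2)) ^ ((1 : ℝ) / (2 * m - 2)) := h2
    _ ≤ J1 ^ ((2 * (m : ℝ) - 3) / (2 * m - 2)) *
          (K ^ ((1 : ℝ) / (2 * m)) * Jm ^ ((1 : ℝ) / (2 * m - 2))) :=
        mul_le_mul_of_nonneg_left h6 (Real.rpow_nonneg hJ10 _)
    _ = K ^ ((1 : ℝ) / (2 * m)) * J1 ^ ((2 * (m : ℝ) - 3) / (2 * m - 2)) *
          Jm ^ ((1 : ℝ) / (2 * m - 2)) := by ring

end VorticityMomentLadder

/-! ### §12 The forcing term (Gibbon 2012, §5 (c)) and the forced `Jₘ` ladder -/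

namespace VorticityMomentLadder

variable {d' : Type*} [Fintype d'] [DecidableEq d'] in
/-- Pointwise Cauchy–Schwarz in the `d²` tensor entries:
`∑ᵢⱼ Wᵢⱼ(v) Wᵢⱼ(g) ≤ 2 |ω_v| |ω_g|` (`|ω|² = ½∑ᵢⱼWᵢⱼ²`). [folklore] -/
private theorem sum_torusVorticityTensor_mul_le (v g : UnitAddTorus d' → EuclideanSpace ℝ d')
    (x : UnitAddTorus d') :
    ∑ i, ∑ j, torusVorticityTensor v i j x *
        (Torus.partialDeriv i g x j - Torus.partialDeriv j g x i) ≤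
      2 * Real.sqrt (torusVorticitySqAt v x) * Real.sqrt (torusVorticitySqAt g x) := by
  have hcs := Real.sum_mul_le_sqrt_mul_sqrt (Finset.univ : Finset (d' × d'))
    (fun q => torusVorticityTensor v q.1 q.2 x) (fun q => torusVorticityTensor g q.1 q.2 x)
  simp only [Fintype.sum_prod_type] at hcs
  have eW : ∀ w : UnitAddTorus d' → EuclideanSpace ℝ d',
      ∑ i, ∑ j, torusVorticityTensor w i j x ^ 2 = 2 * torusVorticitySqAt w x := by
    intro w
    simp only [torusVorticitySqAt, torusVorticityTensor]
    ring
  rw [eW v, eW g, Real.sqrt_mul zero_le_two, Real.sqrt_mul zero_le_two] at hcs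
  have e2 : Real.sqrt 2 * Real.sqrt (torusVorticitySqAt v x) *
      (Real.sqrt 2 * Real.sqrt (torusVorticitySqAt g x)) =
      2 * Real.sqrt (torusVorticitySqAt v x) * Real.sqrt (torusVorticitySqAt g x) := by
    have := Real.mul_self_sqrt (zero_le_two (α := ℝ))
    linear_combination (Real.sqrt (torusVorticitySqAt v x) * Real.sqrt (torusVorticitySqAt g x)) * this
  rw [e2] at hcs
  simpa only [torusVorticityTensor] using hcs

/-- **The forcing term of the `Jₘ` balance (Gibbon 2012, §5 (c), the Hölder step (5.7)):**
"`∫|ω|^{2(m−1)} ω·curl f dV ≤ ‖ω‖_{2m}^{2m−1} ‖∇f‖_{2m}`". Typed on `𝕋ᵈ... = 𝕋³` in the tree's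
normalisation (`|ω|² = torusVorticitySqAt`, the forcing enters the balance
`IsClassicalNSSolutionOn.hasDerivWithinAt_integral_torusVorticitySqAt_pow` through
`∑ᵢⱼ Wᵢⱼ(∂ᵢgⱼ − ∂ⱼgᵢ) = 2ω·curl g`): for smooth `v`, `g` and `m ≥ 1`,
`∫ |ω_v|^{2(m−1)} ∑ᵢⱼWᵢⱼ(v)(∂ᵢgⱼ − ∂ⱼgᵢ) ≤ 2 (∫|ω_v|^{2m})^{(2m−1)/2m} (∫|curl g|^{2m})^{1/2m}`
(pointwise Cauchy–Schwarz, then Hölder with exponents `(2m/(2m−1), 2m)`; the print continues with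
`‖curl f‖_{2m} ≤ c‖∇f‖_{2m}` and its single-scale forcing hypothesis, not typed).
[cite: Gibbon2012JMP, §5 (c) eq. (5.7)] -/
theorem integral_pow_mul_forcing_le {m : ℕ} (hm : 1 ≤ m)
    {v g : UnitAddTorus (Fin 3) → EuclideanSpace ℝ (Fin 3)} (hv : Torus.IsSmooth v)
    (hg : Torus.IsSmooth g) :
    ∫ x, torusVorticitySqAt v x ^ (m - 1) * ∑ i, ∑ j, torusVorticityTensor v i j x *
        (Torus.partialDeriv i g x j - Torus.partialDeriv j g x i) ≤
      2 * (∫ x, torusVorticitySqAt v x ^ m) ^ ((2 * (m : ℝ) - 1) / (2 * m)) *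
        (∫ x, torusVorticitySqAt g x ^ m) ^ ((1 : ℝ) / (2 * m)) := by
  set A : UnitAddTorus (Fin 3) → ℝ := fun y => torusVorticitySqAt v y with hA
  set B : UnitAddTorus (Fin 3) → ℝ := fun y => torusVorticitySqAt g y with hB
  have hA0 : ∀ y, 0 ≤ A y := fun y => torusVorticitySqAt_nonneg v y
  have hB0 : ∀ y, 0 ≤ B y := fun y => torusVorticitySqAt_nonneg g y
  have hAc : Continuous A := (isSmooth_Q hv).continuous
  have hBc : Continuous B := (isSmooth_Q hg).continuous
  have hm0 : (0 : ℝ) < m := by exact_mod_cast hm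
  have h2m1 : (0 : ℝ) < 2 * m - 1 := by
    have : (1 : ℝ) ≤ m := by exact_mod_cast hm
    linarith
  -- the integrand is continuous
  have hFc : Continuous fun x => ∑ i, ∑ j, torusVorticityTensor v i j x *
      (Torus.partialDeriv i g x j - Torus.partialDeriv j g x i) :=
    continuous_finsetSum _ fun i _ => continuous_finsetSum _ fun j _ =>
      (isSmooth_W hv i j).continuous.mul (isSmooth_W hg i j).continuous
  -- (i) pointwise Cauchy–Schwarz: `∫ A^{m−1} ΣWG ≤ ∫ 2 A^{m−1} √A √B`
  have h1 : ∫ x, A x ^ (m - 1) * ∑ i, ∑ j, torusVorticityTensor v i j x *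
        (Torus.partialDeriv i g x j - Torus.partialDeriv j g x i) ≤
      ∫ x, 2 * (A x ^ (m - 1) * Real.sqrt (A x)) * Real.sqrt (B x) := by
    refine integral_mono (integrable_of_continuous ((hAc.pow _).mul hFc))
      (integrable_of_continuous ((continuous_const.mul ((hAc.pow _).mul
        (Real.continuous_sqrt.comp hAc))).mul (Real.continuous_sqrt.comp hBc))) fun x => ?_
    have hp := sum_torusVorticityTensor_mul_le v g x
    have hA1 : 0 ≤ A x ^ (m - 1) := pow_nonneg (hA0 x) _
    calc A x ^ (m - 1) * ∑ i, ∑ j, torusVorticityTensor v i j x *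
          (Torus.partialDeriv i g x j - Torus.partialDeriv j g x i)
        ≤ A x ^ (m - 1) * (2 * Real.sqrt (A x) * Real.sqrt (B x)) :=
          mul_le_mul_of_nonneg_left hp hA1
      _ = 2 * (A x ^ (m - 1) * Real.sqrt (A x)) * Real.sqrt (B x) := by ring
  -- (ii) Hölder `(2m/(2m−1), 2m)` on `∫ (A^{m−1}√A) √B`
  have hpq : Real.HolderConjugate (2 * (m : ℝ) / (2 * m - 1)) (2 * (m : ℝ)) :=
    { inv_add_inv_eq_inv := by
        rw [inv_one, inv_div, inv_eq_one_div, ← add_div, sub_add_cancel, div_self (by positivity)]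
      left_pos := by positivity
      right_pos := by positivity }
  set f : UnitAddTorus (Fin 3) → ℝ := fun y => A y ^ (m - 1) * Real.sqrt (A y) with hf
  set k : UnitAddTorus (Fin 3) → ℝ := fun y => Real.sqrt (B y) with hk
  have hf0 : ∀ y, 0 ≤ f y := fun y => mul_nonneg (pow_nonneg (hA0 y) _) (Real.sqrt_nonneg _)
  have hk0 : ∀ y, 0 ≤ k y := fun y => Real.sqrt_nonneg _
  have hfc : Continuous f := (hAc.pow _).mul (Real.continuous_sqrt.comp hAc)
  have hkc : Continuous k := Real.continuous_sqrt.comp hBc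
  have hH := integral_mul_le_Lp_mul_Lq_of_nonneg (μ := volume) hpq (f := f) (g := k)
    (ae_of_all _ hf0) (ae_of_all _ hk0) (memLp_of_continuous hfc _) (memLp_of_continuous hkc _)
  -- `f = A^{(2m−1)/2}` as a real power, hence `f^{2m/(2m−1)} = A^m`; `k^{2m} = B^m`
  have hcm : ((m - 1 : ℕ) : ℝ) = (m : ℝ) - 1 := by rw [Nat.cast_sub hm, Nat.cast_one]
  have ef0 : ∀ y, f y = A y ^ ((2 * (m : ℝ) - 1) / 2) := by
    intro y
    simp only [hf]
    rw [Real.sqrt_eq_rpow, ← Real.rpow_natCast, hcm,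
      ← Real.rpow_add_of_nonneg (hA0 y) (by linarith [show (1 : ℝ) ≤ m by exact_mod_cast hm])
        (by norm_num)]
    congr 1; ring
  have ef : (fun y => f y ^ (2 * (m : ℝ) / (2 * m - 1))) = fun y => A y ^ m := by
    funext y
    rw [ef0 y, ← Real.rpow_mul (hA0 y),
      show (2 * (m : ℝ) - 1) / 2 * (2 * m / (2 * m - 1)) = ((m : ℕ) : ℝ) by
        rw [div_mul_div_comm, div_eq_iff (mul_ne_zero two_ne_zero h2m1.ne')]; ring,
      Real.rpow_natCast]
  have ek : (fun y => k y ^ (2 * (m : ℝ))) = fun y => B y ^ m := by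
    funext y
    simp only [hk]
    rw [show (2 * (m : ℝ)) = ((2 * m : ℕ) : ℝ) by push_cast; ring, Real.rpow_natCast, pow_mul,
      Real.sq_sqrt (hB0 y)]
  have e1 : (1 : ℝ) / (2 * (m : ℝ) / (2 * m - 1)) = (2 * (m : ℝ) - 1) / (2 * m) := one_div_div _ _
  rw [ef, ek, e1] at hH
  -- assemble
  calc ∫ x, A x ^ (m - 1) * ∑ i, ∑ j, torusVorticityTensor v i j x *
          (Torus.partialDeriv i g x j - Torus.partialDeriv j g x i)
      ≤ ∫ x, 2 * (A x ^ (m - 1) * Real.sqrt (A x)) * Real.sqrt (B x) := h1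
    _ = 2 * ∫ x, f x * k x := by
        rw [← integral_const_mul]
        refine integral_congr_ae (ae_of_all _ fun x => ?_)
        simp only [hf, hk]; ring
    _ ≤ 2 * ((∫ x, A x ^ m) ^ ((2 * (m : ℝ) - 1) / (2 * m)) *
          (∫ x, B x ^ m) ^ ((1 : ℝ) / (2 * m))) := mul_le_mul_of_nonneg_left hH zero_le_two
    _ = 2 * (∫ x, A x ^ m) ^ ((2 * (m : ℝ) - 1) / (2 * m)) *
          (∫ x, B x ^ m) ^ ((1 : ℝ) / (2 * m)) := by ring

end VorticityMomentLadder

open VorticityMomentLadder in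
/-- **The forced `Jₘ` ladder** (Gibbon 2012, §5 (5.9) with the forcing step (5.7) kept in the form
`‖ω‖_{2m}^{2m−1}‖curl f‖_{2m}`): for every `m ≥ 1` there are `c₁ > 0`, `c₂, c₃ ≥ 0` such that along
every classical solution of the FORCED Navier–Stokes system (`ν ≥ 0`, forcing `f`) on
`𝕋³ × [a, b]`, at every `t ∈ [a, b]` at which the forcing slice `f t` is smooth, every one-sided
derivative value `R` of `Jₘ` within `[a, b]` satisfies
`R ≤ −ν c₁ J_{3m}^{1/3} + ν c₂ Jₘ + c₃ Jₘ^{1/2}J_{m+1}^{1/2} + 2m Jₘ^{(2m−1)/2m} (∫|curl f(t)|^{2m})^{1/2m}`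
(the unforced `exists_vorticityMoment_ladder` plus `integral_pow_mul_forcing_le`; the print's
conversion of the last term into `c_{3,m}ϖ₀²Ωₘ^{2m−1}Gr` uses its single-scale forcing hypothesis
(5.8) and is not typed). [cite: Gibbon2012JMP, Thm 2 proof, §5 (5.6)–(5.7), (5.9)] -/
theorem exists_vorticityMoment_ladder_forced (m : ℕ) (hm : 1 ≤ m) :
    ∃ c₁ c₂ c₃ : ℝ, 0 < c₁ ∧ 0 ≤ c₂ ∧ 0 ≤ c₃ ∧
      ∀ {a b ν : ℝ} {f u : ℝ → UnitAddTorus (Fin 3) → EuclideanSpace ℝ (Fin 3)}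
        {p : ℝ → UnitAddTorus (Fin 3) → ℝ},
        Torus.IsClassicalNSSolutionOn (Icc a b) ν f u p → a < b → 0 ≤ ν →
        ∀ {t : ℝ}, t ∈ Icc a b → Torus.IsSmooth (f t) → ∀ {R : ℝ},
          HasDerivWithinAt (fun s => ∫ x, torusVorticitySqAt (u s) x ^ m) R (Icc a b) t →
          R ≤ -(ν * c₁ * (∫ x, torusVorticitySqAt (u t) x ^ (3 * m)) ^ ((1 : ℝ) / 3)) +
              ν * c₂ * (∫ x, torusVorticitySqAt (u t) x ^ m) +
              c₃ * Real.sqrt (∫ x, torusVorticitySqAt (u t) x ^ m) *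
                Real.sqrt (∫ x, torusVorticitySqAt (u t) x ^ (m + 1)) +
              2 * m * (∫ x, torusVorticitySqAt (u t) x ^ m) ^ ((2 * (m : ℝ) - 1) / (2 * m)) *
                (∫ x, torusVorticitySqAt (f t) x ^ m) ^ ((1 : ℝ) / (2 * m)) := by
  obtain ⟨C₁, C₂, hC₁, hC₂, hvisc⟩ := exists_integral_pow_three_mul_rpow_le m hm
  obtain ⟨K, hK0, hstr⟩ := exists_integral_pow_mul_stretching_le m hm
  have hm0 : (0 : ℝ) < m := by exact_mod_cast hm
  have hC₁1 : 0 < C₁ + 1 := by linarith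
  refine ⟨(m : ℝ) / (C₁ + 1), (m : ℝ) * C₂ / (C₁ + 1), 2 * m * K, by positivity, by positivity,
    by positivity, ?_⟩
  intro a b ν f u p h hab hν t ht hft R hR
  have hut : Torus.IsSmooth (u t) := h.smooth_velocity.isSmooth_slice ht
  have hdiv : Torus.IsDivFree (u t) := h.divFree t ht
  set A : UnitAddTorus (Fin 3) → ℝ := fun y => torusVorticitySqAt (u t) y with hA
  set Q : UnitAddTorus (Fin 3) → ℝ := fun y =>
    ∑ k, ∑ i, ∑ j, Torus.partialDeriv k (torusVorticityTensor (u t) i j) y ^ 2 with hQ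
  have hA0 : ∀ y, 0 ≤ A y := fun y => torusVorticitySqAt_nonneg (u t) y
  have hQ0 : ∀ y, 0 ≤ Q y := fun y =>
    Finset.sum_nonneg fun k _ => Finset.sum_nonneg fun i _ => Finset.sum_nonneg fun j _ => sq_nonneg _
  -- the exact balance and uniqueness of the one-sided derivative
  have hD := h.hasDerivWithinAt_integral_torusVorticitySqAt_pow hab m ht
  have hU : UniqueDiffWithinAt ℝ (Icc a b) t := uniqueDiffOn_Icc hab t ht
  have hReq := (hR.derivWithin hU).symm.trans (hD.derivWithin hU)
  -- the four estimates
  have hS := hstr (u t) hut hdiv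
  have hV := hvisc (u t) hut
  have hF := integral_pow_mul_forcing_le hm hut hft
  have hV2 : 0 ≤ ∫ x, torusVorticitySqAt (u t) x ^ (m - 2) *
      ∑ k, Torus.partialDeriv k (torusVorticitySqAt (u t)) x ^ 2 :=
    integral_nonneg fun x => mul_nonneg (pow_nonneg (hA0 x) _)
      (Finset.sum_nonneg fun k _ => sq_nonneg _)
  have hV1 : 0 ≤ ∫ x, torusVorticitySqAt (u t) x ^ (m - 1) * Q x :=
    integral_nonneg fun x => mul_nonneg (pow_nonneg (hA0 x) _) (hQ0 x)
  set J3 : ℝ := (∫ x, torusVorticitySqAt (u t) x ^ (3 * m)) ^ ((1 : ℝ) / 3) with hJ3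
  set Jm : ℝ := ∫ x, torusVorticitySqAt (u t) x ^ m with hJm
  set V1 : ℝ := ∫ x, torusVorticitySqAt (u t) x ^ (m - 1) * Q x with hV1def
  set Fm : ℝ := ∫ x, torusVorticitySqAt (u t) x ^ (m - 1) * ∑ i, ∑ j,
      torusVorticityTensor (u t) i j x *
        (Torus.partialDeriv i (f t) x j - Torus.partialDeriv j (f t) x i) with hFm
  have hJm0 : 0 ≤ Jm := integral_nonneg fun x => pow_nonneg (hA0 x) _
  have hm1 : (0 : ℝ) ≤ (m : ℝ) - 1 := by
    have : (1 : ℝ) ≤ m := by exact_mod_cast hm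
    linarith
  have hkey : -(ν * ((m : ℝ) * V1)) ≤
      -(ν * ((m : ℝ) / (C₁ + 1)) * J3) + ν * ((m : ℝ) * C₂ / (C₁ + 1)) * Jm := by
    have h1 : J3 ≤ (C₁ + 1) * V1 + C₂ * Jm := by
      have : C₁ * V1 ≤ (C₁ + 1) * V1 := by nlinarith
      linarith [hV]
    have h2 : J3 / (C₁ + 1) ≤ V1 + C₂ / (C₁ + 1) * Jm := by
      rw [div_le_iff₀ hC₁1]
      have : (V1 + C₂ / (C₁ + 1) * Jm) * (C₁ + 1) = (C₁ + 1) * V1 + C₂ * Jm := by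
        field_simp
      rw [this]
      exact h1
    have h3 : ν * (m : ℝ) * (J3 / (C₁ + 1)) ≤ ν * (m : ℝ) * (V1 + C₂ / (C₁ + 1) * Jm) :=
      mul_le_mul_of_nonneg_left h2 (by positivity)
    have e : ν * ((m : ℝ) / (C₁ + 1)) * J3 = ν * (m : ℝ) * (J3 / (C₁ + 1)) := by ring
    have e' : ν * ((m : ℝ) * C₂ / (C₁ + 1)) * Jm = ν * (m : ℝ) * (C₂ / (C₁ + 1) * Jm) := by ring
    rw [e, e']
    nlinarith
  rw [hReq]
  have hstretch : 2 * (m : ℝ) * ∫ x, torusVorticitySqAt (u t) x ^ (m - 1) *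
      torusStretchingDensity (u t) x ≤ 2 * m * K * Real.sqrt Jm *
        Real.sqrt (∫ x, torusVorticitySqAt (u t) x ^ (m + 1)) := by
    have := mul_le_mul_of_nonneg_left hS (by positivity : (0 : ℝ) ≤ 2 * m)
    simpa only [mul_assoc] using this
  have hforce : (m : ℝ) * Fm ≤ 2 * m * Jm ^ ((2 * (m : ℝ) - 1) / (2 * m)) *
      (∫ x, torusVorticitySqAt (f t) x ^ m) ^ ((1 : ℝ) / (2 * m)) := by
    have := mul_le_mul_of_nonneg_left hF hm0.le
    simpa only [mul_assoc, mul_comm, mul_left_comm] using this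
  nlinarith [hkey, hstretch, hforce, hV2, mul_nonneg hν (mul_nonneg (mul_nonneg hm0.le hm1) hV2)]

end Literature.Analysis.FluidPDE
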